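import Mathlib
import HarnessLib
import Literature.Analysis.FluidPDE.VorticityCalculus
import Summits.NavierStokesRegularity.NavierStokesRegularity.Theses.PoloidalWindowDoor
import Summits.NavierStokesRegularity.NavierStokesRegularity.Theses.LoopPeriodRatchet
import Summits.NavierStokesRegularity.NavierStokesRegularity.Theorems.PoloidalWindowDoorPoloidalWindowRigidityHotLoopsReduction
import Summits.NavierStokesRegularity.NavierStokesRegularity.Theorems.PoloidalWindowDoorPoloidalWindowRigidityFirstIntegral
import Summits.NavierStokesRegularity.NavierStokesRegularity.Theorems.PoloidalWindowDoorPoloidalWindowRigidityHotPlaneConst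
import Summits.NavierStokesRegularity.NavierStokesRegularity.Theorems.PoloidalWindowDoorPoloidalWindowRigidityZeroModeNoHotPlane
import Summits.NavierStokesRegularity.NavierStokesRegularity.Theorems.PoloidalWindowDoorPoloidalWindowRigidityHotSplitRidgeReductions
import Summits.NavierStokesRegularity.NavierStokesRegularity.Theorems.PoloidalWindowDoorPoloidalWindowRigidityHotSplitRidgeKernels
import Summits.NavierStokesRegularity.NavierStokesRegularity.Theorems.PoloidalWindowDoorPoloidalWindowRigidityHotSplitCells
import Summits.NavierStokesRegularity.NavierStokesRegularity.Theorems.PoloidalWindowDoorPoloidalWindowRigidityHotSplitComposition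
import Summits.NavierStokesRegularity.NavierStokesRegularity.Theorems.PoloidalWindowDoorPoloidalWindowRigidityLeafUniformPins
import Summits.NavierStokesRegularity.NavierStokesRegularity.Theorems.PoloidalWindowDoorPoloidalWindowRigidityLeafUniformHFlat
import Summits.NavierStokesRegularity.NavierStokesRegularity.Theorems.PoloidalWindowDoorPoloidalWindowRigidityLeafUniformVortexLine
import Summits.NavierStokesRegularity.NavierStokesRegularity.Theorems.PoloidalWindowDoorPoloidalWindowRigidityLeafUniformLeafGlobalLaw
import Summits.NavierStokesRegularity.NavierStokesRegularity.Theorems.PoloidalWindowDoorPoloidalWindowRigidityLeafUniformLeafEnds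
import Summits.NavierStokesRegularity.NavierStokesRegularity.Theorems.PoloidalWindowDoorLrcModEntireFarThreadReduction
import Summits.NavierStokesRegularity.NavierStokesRegularity.Theorems.PoloidalWindowDoorLrcModEntireThreadDichotomy
import Summits.NavierStokesRegularity.NavierStokesRegularity.Theorems.PoloidalWindowDoorLrcModEntireThreadPins
import Summits.NavierStokesRegularity.NavierStokesRegularity.Theorems.PoloidalWindowDoorLrcModEntireIff
import Summits.NavierStokesRegularity.NavierStokesRegularity.Theorems.PoloidalWindowDoorLrcModEntireUntwistedGerm
import Summits.NavierStokesRegularity.NavierStokesRegularity.Theorems.PoloidalWindowDoorPoloidalWindowRigiditySymmetryGerms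
import Summits.NavierStokesRegularity.NavierStokesRegularity.Theorems.PoloidalWindowDoorPoloidalWindowRigidityVerticalShearGerm
import Summits.NavierStokesRegularity.NavierStokesRegularity.Theorems.PoloidalWindowDoorLrcModEntireTwistingTHLocalHypGerm
import Summits.NavierStokesRegularity.NavierStokesRegularity.Theorems.PoloidalWindowDoorLrcModEntireTwistingTHLocalNonUmbilic
import Summits.NavierStokesRegularity.NavierStokesRegularity.Theorems.PoloidalWindowDoorLrcModEntireTwistingTHLocalGalilean
import Summits.NavierStokesRegularity.NavierStokesRegularity.Theorems.PoloidalWindowDoorLrcModEntireTwistingTHLocalNormalFormRS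
import Summits.NavierStokesRegularity.NavierStokesRegularity.Theorems.PoloidalWindowDoorPoloidalWindowRigidityLeafUniformHotRegularAlone
import Literature.Analysis.Calculus.RealAnalyticPlanarZeroSetBranches
import Summits.NavierStokesRegularity.NavierStokesRegularity.Theorems.PoloidalWindowDoorPoloidalWindowRigidityHotForestNoHotLoop
import Summits.NavierStokesRegularity.NavierStokesRegularity.Theorems.PoloidalWindowDoorPoloidalWindowRigidityHotForestSeparatrix
import Summits.NavierStokesRegularity.NavierStokesRegularity.Theorems.PoloidalWindowDoorPoloidalWindowRigidityHotForestCapturedEnd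
import Summits.NavierStokesRegularity.NavierStokesRegularity.Theorems.PoloidalWindowDoorPoloidalWindowRigidityHotHullNullEndTopology
import Literature.Analysis.Calculus.RealAnalyticPlanarZeroSetBranchesOMinimal
import Summits.NavierStokesRegularity.NavierStokesRegularity.Theorems.PoloidalWindowDoorPoloidalWindowRigidityHotHullLeafRecurrence


/-!
# Crux `PoloidalWindowRigidity` (K2, stmt-NavierStokesRegularity-19708) + item `LrcModEntire` (stmt-20428) — LINE 21 `hot_hull` (v1.9)
# (IDEATOR seat ns-idea-8, generation 10; lens «barrier»; bears_on LADDER-NS N0, rung N0-LocalTubeDoorPoloidal, THICK column; targets BOTH research residues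
#  C2a′ `stub_cellC2aRidge` and C2b′ `stub_cellC2bRidge` of LINE 15 `hot_split` v1.6 (tree `Lines/hot_split.lean` 0dd9c4b44e10), VERBATIM, and REFINES the
#  escaping cell ESC-END of LINE 20 `hot_forest` v1.1 (tree `Lines/hot_forest.lean` 6d5c24c54f16), whose provable supports and convergent-web cell it reuses
#  VERBATIM.)

**v1.9 (maintenance, 2026-08-29 ≈08:30Z — NO statement changed):** H6 `stub_leafRecurrence` PROVED BY NAME to K2-p2 g14's landed p708183
`…Theorems.PoloidalWindowDoorPoloidalWindowRigidityHotHullLeafRecurrence.leafRecurrence` (Birkhoff recurrence in the compact sliding hull; statement VERBATIM);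
sorries 7 → 6 (S0 `stub_localTHEmptyHypNUGRS`, WALL `stub_wall` ⟨27893⟩, and the four research cells `stub_cellConvergentWeb`, `stub_cellNullContinuum`,
`stub_cellRecurrentLeaf`, `stub_cellOscillatingEnd`) — EVERY PROVABLE HAND STUB OF LINE 21 IS NOW A TREE THEOREM; what remains is S0, the wall and research.

**v1.8 (maintenance, 2026-08-29 ≈08:20Z — NO statement changed; defs blockdiff-identical to v1.7):** V1 DISCHARGED one level down — every
`(hV1 : Literature.Analysis.Calculus.realAnalytic_planarZeroSet_conicStructure)` binder of v1.7 is now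
`(hO : Literature.ModelTheory.ExponentialFields.VandendriesMiller1994_realAnExp_isOMinimal)` («`ℝ_an,exp` is o-minimal», van den Dries–Miller 1994, the
tree's NAMED FACT), with `v1_of_oMinimal hO := Literature.Analysis.Calculus.realAnalytic_planarZeroSet_conicStructure_of_realAnExp_isOMinimal hO`
(nsreg-typer g27: p707348 `PlanarConic.exists_branches_of_dim_le_one` PROVED + p707485) feeding `….coordPlane_fin3`; so the cone's ONLY Literature leaf is the
o-minimality of `ℝ_an,exp`.  Sorry count unchanged.

**No summit and no crux is proved here.**  `PoloidalWindowRigidity_of_hotHull` / `LrcModEntire_of_hotHull` are CONDITIONAL on the sorried stubs, exactly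
like every line of the column; the new content is the typed HOT TRANSLATION HULL (re-pinning at hot points — PROVED; thickness at every point of every
pinned profile mod the (TH)-germ = S0 — PROVED from the tree's `threadDichotomy`; Type-I compactness along hot sequences; the topology / ODE of limits of an
escaping hot end) and the END-VORTICITY CUT of ESC-END into a NULL cell — which is then THE SAME cell as the other residue C2b′ — and a PERSISTENT cell.

## Why this line (barrier-inversion on CENSUS-C2-g8, NOTES_g9 B-g9-5/B-g9-6, this seat's B-g10-2)

Every recorded attack on the residues is POINT-LOCAL, AVERAGED, a COMPARISON, LEAF-LOCAL (B-g9-6) or — since LINE 20 — PLANE-TOPOLOGICAL at one time.  All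
of them study ONE profile `v` at ITS pin.  But the residues quantify over the whole class 𝒫 of pinned thick peakless profiles, and 𝒫 is (almost) closed
under the two operations an ESCAPING hot end invites:

* **TRANSLATION to a hot point (H1, PROVED here).**  For `y ∈ H` the translate `v(·, · + y)` is again `Pinned C` with the same `N`: the class clauses are
  translation-covariant (tree `…LeafUniformPins.class_translate`), `v₂(−1,y) = N` moves the Type-I extremality `√(−t)|v₂| ≤ |N|` along, and the three pins
  (`∇v₂ = 0`, `∂ₜv₂ = N/2`, `N·Δv₂ ≤ 0`) RE-DERIVE THEMSELVES at the new origin by Fermat (tree `threadPin_of_hotSpot`, `threadSignedPin`).  `Peakless` is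
  translation-invariant (PROVED).  So every hot point is a pin: the hot set is homogeneous for the whole door analysis.
* **LIMITS along hot sequences (H3 `HullLimit`, PROVED here, v1.2).**  The tree's KNSS extraction `…Theorems.exists_tendsto_of_isTypeIAncientMild_seq`
  (Type-I ancient mild compactness WITH convergence of derivatives, locally uniform on slices) applied to the re-pinned translates: the limit `U` is in the
  class (`IsTypeIAncientMild.mild_eq_heatExtension` …), poloidal (`…PoloidalExtremal.poloidal_of_tendsto`), keeps `N` and the Type-I extremality (pointwise
  limits), is pinned BY FERMAT (`threadPin_of_hotSpot`, `threadSignedPin`), its vorticity slices are locally uniform limits (`curl = curlCLM ∘ D`), and it is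
  PEAKLESS — islands are STRICT brackets, and strict brackets of the limit pull back to the approximants (`peaklessClosed_holds`, PROVED: closed
  thickenings + uniform convergence on compacts + argmax).  So the HULL (H1 + H2 + H3) is entirely in hand, mod S0 for the thickness of thin limit points.
* **THICKNESS does not pass to limits — and need not (H2 `ThickDense`, PROVED mod THGerm = S0).**  The door's `…ThreadDichotomy.threadDichotomy` (tree, five
  cases at ANY space-time point `z₀`) says: either a thick window accumulates at `z₀`, or near `z₀` the profile is untwisted (tree `stub_untwistedGerm` ⇒ germ ⇒
  absurd by tree `false_of_germ_of_nondegenerate`), (TH) (⇒ germ by THE (TH)-GERM STATEMENT `THGerm` — verbatim the tree's `hTHgerm`, which IS S0's consequence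
  through the landed chain NormalFormRS → Galilean → NonUmbilic → HypGerm, `thGerm_holds`), time-only-sloped (tree `eq_zero_of_local_timeOnlySlope` ⇒ `v ≡ 0`), or
  degenerate (tree `eq_zero_of_curl_eq_zero_on_open` / `…horizontalGradient…` / `…verticalShear…` ⇒ `v ≡ 0`); `v ≡ 0` contradicts `N ≠ 0`.  HENCE EVERY POINT OF
  EVERY PINNED PROFILE CARRIES A THICK WINDOW (mod S0) — the theorem form of the g9 seed «use thickness off the leaf» (B-g9-6) and the reason hull limits land
  back in 𝒫.  (B-g9-5 said limits "re-enter the door"; H2 is the observation that the door's own dichotomy dispatches the re-entry, by name.)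

With 𝒫 closed under hulls, the escaping cell ESC-END of LINE 20 (a complete injective hot leaf `Γ`, `ω ≠ 0` on it, one end `l` leaving every compact set) is
CUT BY THE END VORTICITY `|ω(−1, γ τ)|` as `τ → l`:

* **`|ω| → 0` (null end) ⇒ cell NULL-CONTINUUM.**  H3 along `γ(τs k)`, `τs → l`, gives a hull limit `U ∈ 𝒫`; H4 `NullEndTopology` (hand target, M/L:
  boundary bumping + Blaschke limits of the arcs of `Γ − γ(τs k)` in closed balls — Kuratowski II §47 — plus the two locally uniform convergences) gives a
  CONNECTED UNBOUNDED set `L ∋ 0` of hot points of `U` with `ω_U(−1,·) = 0` on `L`.  That is precisely the situation of the OTHER residue C2b′ (all of `H`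
  null; `L :=` the hot component of `0`, unbounded by tree `hotComponent_unbounded`): the single cell `CellNullContinuum` (pinned thick peakless profile + an
  unbounded null hot continuum through the pin, all hot laws in hand) now carries C2b′ (kernel `stub_cellC2bRidge`, term-mode) AND the null end of C2a′.
* **`|ω| ≥ δ` frequently (persistent end) ⇒ cell PERSISTENT-END.**  Mathlib `exists_seq_forall_of_frequently` picks `τs → l` with `|ω(γ(τs k))| ≥ δ`; H3
  gives `U ∈ 𝒫` with `|ω_U(−1,0)| ≥ δ` (pointwise limit), THICK by H2; H5 `LeafLimit` (hand target, M: Grönwall, Mathlib `dist_le_of_approx_trajectories_ODE`)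
  makes the re-based forward leaves `γ(τs k + σ) − γ(τs k)` converge to the complete hot leaf `γ_U` of `U` through its pin.  The cell holds `v`'s ESC-END
  data, the persistence, AND the hull limit `(U, W', γ_U)` with both convergences: the pin of `U` is a regular hot point whose leaf is END-HOMOGENEOUS (a
  two-sided limit of forward translates of one half-leaf).
  Why open (honest): no monotone / almost-periodic functional along hot leaves is known (B-g9-4(iii), B-g10-2), so homogeneity has nothing to be fed to yet;
  the cell is the typed meeting point for such a functional, or for iterating the hull inside `U`.

KERNEL (sorry-free, logic + two limits): `cellEscapingEnd_of_hull : ThickDense → THGerm → HullLimit → NullEndTopology → LeafLimit → HotLapSign → HotTimePin →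
NoHotCycle → HotSeparatrix → CellNullContinuum → CellPersistentEnd → CellEscapingEnd`; `stub_cellC2bRidge` (C2b′ VERBATIM) is now a TERM from
`CellNullContinuum` + tree `hotComponent_unbounded` + Mathlib `connectedComponentIn`; C2a′ by LINE 20's kernel `cellC2aRidge_of_forest` VERBATIM with ESC-END :=
`cellEscapingEnd_holds`; HL3′, the crux and the item BY NAME exactly as LINE 20 (S0 and ⟨27893⟩ VERBATIM).  Residues of the THICK column after this line:
{NULL-CONTINUUM, PERSISTENT-END, CONVERGENT-WEB} + S0 + wall — C2b′ is no longer a separate residue.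

## Barriers / Disproof used / honesty
- technique_class: symmetry-group closure of the hypothesis class (translation) + Type-I compactness (blow-up-free: no rescaling, the hull is at FIXED scale)
  + the door's local structure dichotomy re-applied at limit points + planar continuum theory + ODE stability; glued case split on the end vorticity.
- Finite-jet / Cartan–Kähler barrier (Disproof (THICK) certificates; POLY-SECTOR-K2p5): not engaged — no jet computation; the hull compares the profile with
  its own far translates.  Codimension / averaging barriers (B-g8-2/4): nothing is averaged.  B-g8-3 (blow-down / backward uniqueness need decay we do not
  have): the hull is NOT a blow-down — no rescaling, Type-I compactness at scale one, and the limit is used through the DOOR (pins + thickness + peakless),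
  not through unique continuation.  B-g9-5 / B-g10-2 (limits re-enter the door; extremality over the compact class gives nothing): H2 dispatches the re-entry
  BY NAME mod S0; NO extremal choice is made (no "minimal hull", no recurrence claimed) — the cells receive the limit as DATA, and their openness is stated.
  B-g9-6 (2.5-D toy): the toy is not Type-I ancient mild; within 𝒫 the straight hot line with constant `|ω|` would sit in PERSISTENT-END with `U = v` — the
  cell does not claim to exclude it kinematically.  `AxisymmetricTypeIExclusion`, `LeraySelfSimilarBlowupExclusion`, `HyperbolicSystemNoComparison`: not engaged
  (no self-similarity, no comparison principle).
- Disproof.lean (461 l.): `stubTwisting_iff_residues` (THICK residue via the pinned form, as hot_split) frames the target; the file carries NO `_false_without_<H>`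
  theorem for this crux, so the load-bearing package is read off the residues and KEPT — every cell keeps the full `Pinned` package for `v` AND for `U` (H3
  re-derives it); `twist_eq_zero_of_constDir` / `not_singular_of_constDir_window` quantify over a WINDOW of constant vorticity direction — no cell is an
  instance; `noThickObliqueTwistingGerm` / `oblique25_cubic_example` are (TH)-side, untouched.  Negatives index (22492 / I8a / I8c / I9: closed orbits, period
  ratchets; 21503 TorsionNormalForm; 20426 SwirlDominance…): no cell restates one.  STRENGTH OF RECORD (v1.5, critic P1): PERSISTENT-END / RECURRENT-LEAF / OSCILLATING-END are each
  WEAKER than the residue they refine (more hypotheses, same conclusion `False`); NULL-CONTINUUM vs ESC-END|null carries DIFFERENT data (leaf forgotten, limit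
  continuum kept — not nested); and C2b′ is ABSORBED into the STRONGER cell NULL-CONTINUUM (C2b′'s «ω ≡ 0 on all of H» implies NULL's «ω ≡ 0 on an
  unbounded hot continuum ∋ 0», tree `hotComponent_unbounded`) — debt moved, not reduced.
- The polynomial sector is EMPTY (Theorem P) and is not touched; S0 (`stub_localTHEmptyHypNUGRS`, (TH) column, lead K2-p3) and ⟨27893⟩ are VERBATIM and untouched;
  THGerm is CONSUMED only through `thGerm_holds`, i.e. through S0 by name — this line adds no claim in the (TH) sector.
-/


open scoped InnerProductSpace RealInnerProductSpace Laplacian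

-- the summit and its single sub-problem share the name (CONVENTIONS §1)
set_option linter.dupNamespace false

namespace Summit.NavierStokesRegularity.NavierStokesRegularity.Cruxes.PoloidalWindowRigidity.HotHull

open Set Function MeasureTheory
open Literature.Analysis Literature.Analysis.FluidPDE
open Summit.NavierStokesRegularity.NavierStokesRegularity.Theses.LoopPeriodRatchet
open Summit.NavierStokesRegularity.NavierStokesRegularity.Theses.PoloidalWindowDoor
open Summit.NavierStokesRegularity.NavierStokesRegularity.Theorems

/-! ## The hypothesis packages of HL3′ (VERBATIM hot_split v1.6 = leaf_uniform v1.3.1) -/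

/-- **Pinned** — VERBATIM hot_split: Type-I decay, continuity, mild identity, div-free, e₃-poloidal, `N := v₂(−1,0) ≠ 0`, the global bound
`√(−t)|v₂| ≤ |N|`, `∇v₂(−1,0) = 0`, the time and Laplace pins. -/
def Pinned (C : ℝ) (v : ℝ → EuclideanSpace ℝ (Fin 3) → EuclideanSpace ℝ (Fin 3)) : Prop :=
  Literature.Analysis.FluidPDE.HasTypeITimeDecay C v ∧
  ContinuousOn (Function.uncurry v) (Set.Iio (0 : ℝ) ×ˢ Set.univ) ∧
  (∀ s t : ℝ, s < t → t < 0 → ∀ x, v t x =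
    Literature.Analysis.UnboundedOperators.heatExtension (v s) (t - s) x -
      Literature.Analysis.FluidPDE.oseenDuhamel 1 s v v t x) ∧
  (∀ t < 0, Literature.Analysis.FluidPDE.VectorCalculus.IsDivFree (v t)) ∧
  (∀ s < 0, ∀ y, ⟪Literature.Analysis.FluidPDE.curl (v s) y, EuclideanSpace.single 2 1⟫_ℝ = 0) ∧
  v (-1) 0 2 ≠ 0 ∧ (∀ t < 0, ∀ x, Real.sqrt (-t) * |v t x 2| ≤ |v (-1) 0 2|) ∧
  (∀ h : EuclideanSpace ℝ (Fin 3), fderiv ℝ (v (-1)) 0 h 2 = 0) ∧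
  (deriv (fun s => v s 0 2) (-1) = v (-1) 0 2 / 2 ∧ v (-1) 0 2 * (Δ (fun y => v (-1) y 2)) 0 ≤ 0)

/-- **ThickWindow** — VERBATIM hot_split. -/
def ThickWindow (v : ℝ → EuclideanSpace ℝ (Fin 3) → EuclideanSpace ℝ (Fin 3)) (W : Set (ℝ × EuclideanSpace ℝ (Fin 3))) : Prop :=
  IsOpen W ∧ W ⊆ Set.Iio (0 : ℝ) ×ˢ Set.univ ∧
  (∀ z ∈ W, (Literature.Analysis.FluidPDE.curl (v z.1) z.2 ≠ 0 ∧
      (fderiv ℝ (v z.1) z.2 (EuclideanSpace.single 0 1) 2 ≠ 0 ∨ fderiv ℝ (v z.1) z.2 (EuclideanSpace.single 1 1) 2 ≠ 0) ∧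
      (fderiv ℝ (v z.1) z.2 (EuclideanSpace.single 2 1) 0 ≠ 0 ∨ fderiv ℝ (v z.1) z.2 (EuclideanSpace.single 2 1) 1 ≠ 0)) ∧
    (fderiv ℝ (fun x => fderiv ℝ (v z.1) x (EuclideanSpace.single 2 1) 2) z.2 (EuclideanSpace.single 0 1) *
          fderiv ℝ (v z.1) z.2 (EuclideanSpace.single 1 1) 2 -
        fderiv ℝ (fun x => fderiv ℝ (v z.1) x (EuclideanSpace.single 2 1) 2) z.2 (EuclideanSpace.single 1 1) *
          fderiv ℝ (v z.1) z.2 (EuclideanSpace.single 0 1) 2 ≠ 0)) ∧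
  (∀ m : ℝ → ℝ → ℝ, ∀ W₁ : Set (ℝ × EuclideanSpace ℝ (Fin 3)), W₁ ⊆ W → IsOpen W₁ → W₁.Nonempty →
      ∃ z ∈ W₁, ∃ b : Fin 3, b ≠ 2 ∧
        fderiv ℝ (v z.1) z.2 (EuclideanSpace.single 2 1) b ≠
          m z.1 (z.2 2) * fderiv ℝ (v z.1) z.2 (EuclideanSpace.single b 1) 2) ∧
  (∀ r : ℝ, 0 < r → (Metric.ball ((-1 : ℝ), (0 : EuclideanSpace ℝ (Fin 3))) r ∩ W).Nonempty)

/-- **Peakless** — VERBATIM hot_split: no island bracket of `σ·v₂(s,·)` on any horizontal plane at any time `s < 0`. -/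
def Peakless (v : ℝ → EuclideanSpace ℝ (Fin 3) → EuclideanSpace ℝ (Fin 3)) : Prop :=
  ∀ (s z₀ σ M : ℝ) (K O : Set (EuclideanSpace ℝ (Fin 3))), s < 0 →
    ((σ = 1 ∨ σ = -1) ∧ IsCompact K ∧ K.Nonempty ∧ (∀ y ∈ K, y 2 = z₀ ∧ σ * v s y 2 = M) ∧
      IsOpen O ∧ K ⊆ O ∧ (∀ y ∈ O, y 2 = z₀ → σ * v s y 2 ≤ M) ∧
      (∀ y ∈ O, y 2 = z₀ → σ * v s y 2 = M → y ∈ K)) → False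

/-- The HOT SET of the hot-spot plane `P₀ = {y₂ = 0}` at time `−1` — VERBATIM hot_split: `H := {y : y₂ = 0, v₂(−1,y) = v₂(−1,0)}`. -/
def hotSet (v : ℝ → EuclideanSpace ℝ (Fin 3) → EuclideanSpace ℝ (Fin 3)) : Set (EuclideanSpace ℝ (Fin 3)) :=
  {y | y 2 = 0 ∧ v (-1) y 2 = v (-1) 0 2}

/-! ## The leaf-uniform quantities (second derivatives of `w := v₂(−1,·)` in the column's nested-`fderiv` convention) -/

/-- `∂_b∂_a v₂(−1,·)(y)` — the second derivative of the vertical component of the time-`−1` slice, nested `fderiv` convention of the column. -/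
noncomputable def hess (v : ℝ → EuclideanSpace ℝ (Fin 3) → EuclideanSpace ℝ (Fin 3)) (y a b : EuclideanSpace ℝ (Fin 3)) : ℝ :=
  fderiv ℝ (fun x => fderiv ℝ (fun x' => v (-1) x' 2) x a) y b

/-- `Δₕv₂(−1,·)(y) = ∂₀₀v₂ + ∂₁₁v₂` — the HORIZONTAL Laplacian of the vertical component at time `−1`. -/
noncomputable def lapH (v : ℝ → EuclideanSpace ℝ (Fin 3) → EuclideanSpace ℝ (Fin 3)) (y : EuclideanSpace ℝ (Fin 3)) : ℝ :=
  hess v y (EuclideanSpace.single 0 1) (EuclideanSpace.single 0 1) + hess v y (EuclideanSpace.single 1 1) (EuclideanSpace.single 1 1)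

/-- `I₂(y) := ∂_zz v₂ − |∇ₕ∂_z v₂|²/Δₕv₂` — the CURTAIN quantity (meaningful where `Δₕv₂ ≠ 0`). -/
noncomputable def curtain (v : ℝ → EuclideanSpace ℝ (Fin 3) → EuclideanSpace ℝ (Fin 3)) (y : EuclideanSpace ℝ (Fin 3)) : ℝ :=
  hess v y (EuclideanSpace.single 2 1) (EuclideanSpace.single 2 1) -
    (hess v y (EuclideanSpace.single 2 1) (EuclideanSpace.single 0 1) ^ 2 +
      hess v y (EuclideanSpace.single 2 1) (EuclideanSpace.single 1 1) ^ 2) / lapH v y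

/-! ## Horizontal flatness (VERBATIM leaf_uniform v1.3.1 = null_leaf v1.2) -/

/-- Horizontal flatness of the 2-jet of `w = v₂(−1,·)` at `y` (the same predicate as null_leaf's `HFlat`): `∂_a∂_b w(y) = ∂_b∂_a w(y) = 0` for `a` horizontal. -/
def HFlat (v : ℝ → EuclideanSpace ℝ (Fin 3) → EuclideanSpace ℝ (Fin 3)) (y : EuclideanSpace ℝ (Fin 3)) : Prop :=
  ∀ a b : EuclideanSpace ℝ (Fin 3), a 2 = 0 → hess v y a b = 0 ∧ hess v y b a = 0


/-! ## Structure stubs shared VERBATIM with LINE 18 `leaf_uniform` v1.3.1 / LINE 20 `hot_forest` v1.1 (same statements — one hand job closes both lines' copies)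

v1.1 (2026-08-29, critic idea-crit-7 g6 BY-NAME notes 04:51Z/05:13Z): R9 `hotLapSign`, R10 `hotTimePin` (p694348 `…LeafUniformPins`), R15
`vortexLineGlobal` (`…LeafUniformVortexLine`), R19 `leafEnds` (p698325 `…LeafUniformLeafEnds`), R20 `hotFlatPointHFlat` (p697413 `…LeafUniformHFlat`)
have LANDED in the tree as theorems of exactly these statements; their stubs below are discharged BY NAME (`exact <tree decl>`), never restated
(hot_forest count: sorries 17 → 12).  hot_hull v1.1 (2026-08-29 06:0xZ): R16 `leafGlobalLaw` has LANDED too (`…LeafUniformLeafGlobalLaw`, ns-es-p1 g7) and is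
discharged BY NAME below — this file's sorries 15 → 14.  hot_hull v1.2 (2026-08-29 06:3xZ): H3 is PROVED — `ClassCompactness` from the tree's KNSS extraction
`…Theorems.exists_tendsto_of_isTypeIAncientMild_seq` + `poloidal_of_tendsto` + the Fermat pins + `PeaklessClosed` (PROVED here, `peaklessClosed_holds`); sorries
14 → 13 (R18 · V1 · F1a · F1b · F2 · F3 · CONVERGENT-WEB · S0 · wall · H4 · H5 · NULL-CONTINUUM · PERSISTENT-END).  hot_hull v1.3 (06:4xZ, same day): V1 is
DERIVED from the planar fact-grade item V1⁰ `PlanarAnalyticConicStructure` (the DRAFT TEXT of the Literature fact, director-ns KEY-NS #198 (2) / critic P1, exactly as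
hot_forest v1.3) by the PROVED chart transport `planarZeroBranches_of_conic`; sorries 13 (V1⁰ replaces V1).  hot_hull v1.4 (06:2xZ): R18 `hotRegularAlone` LANDED (p701832 + p701918,
ns-es-p1 g7) and DISCHARGED BY NAME — sorries 13 → 12 (V1⁰ · F1a · F1b · F2 · F3 · CONVERGENT-WEB · S0 · wall · H4 · H5 · NULL-CONTINUUM · PERSISTENT-END).
hot_hull v1.5 (06:3xZ): PERSISTENT-END is CUT AGAIN by the liminf of the end vorticity — the UNIFORMLY persistent end is made RECURRENT by BIRKHOFF's theorem
in the compact sliding hull (new support H6 `LeafRecurrence`, L; Bhatia–Szegö Thms 2.9.1 / 2.9.7 / 2.9.11) and handed to the new cell RECURRENT-LEAF (an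
almost-periodic two-sided persistent vortex leaf in a THICK class profile), the rest is the new cell OSCILLATING-END (`liminf = 0 < limsup` along the same
leaf); kernel `cellPersistentEnd_of_recurrence` PROVED, `stub_cellPersistentEnd` is a TERM; statements of every earlier item byte-identical; sorries 12 → 14
hot_hull v1.6 (06:4xZ): H5 `LeafLimit` is PROVED in-file (`leafLimit_holds`: Mathlib `dist_le_of_approx_trajectories_ODE` Grönwall comparison of the re-based
leaves with the limit leaf built by `Literature.Analysis.ODE.exists_solution_real_of_lipschitz_of_bound`, two-sided by time reversal; hot-set membership by
`TendstoLocallyUniformly.tendsto_comp`); `stub_leafLimit` is a TERM; every statement byte-identical; sorries 14 → 13 = V1⁰ · F1a · F1b · F2 · F3 · CONVERGENT-WEB ·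
S0 · wall · H4 · H6 · NULL-CONTINUUM · RECURRENT-LEAF · OSCILLATING-END.
hot_hull v1.7 (generation 11, 07:4xZ — MAINTENANCE, wiring only; statements of every item byte-identical): BY NAME from the tree F1a `noHotCycle` (p701982) ·
F1b `noHotLoop` (p702250) · F2 `hotSeparatrix` (ns-k2-port-2 g4) · F3 `capturedEndConverges_of_branches` (p702676) · H4 `nullEndTopology` (p704094); V1 :=
`Literature.Analysis.Calculus.realAnalytic_planarZeroSet_conicStructure.coordPlane_fin3 hV1` (p703245) — the Literature NAMED FACT enters AS THE HYPOTHESIS `hV1` of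
`capturedEndConverges_holds`, `stub_cellC2aRidge`, `hotHull_peaklessEmpty`, `PoloidalWindowRigidity_of_hotHull`, `LrcModEntire_of_hotHull` (named debt +1, no sorry);
V1⁰ + transport deleted (dead code).  Sorries 13 → 7 = CONVERGENT-WEB · S0 `stub_localTHEmptyHypNUGRS` · wall `stub_wall` · H6 `stub_leafRecurrence` · NULL-CONTINUUM ·
RECURRENT-LEAF · OSCILLATING-END.
(V1⁰ · F1a · F1b · F2 · F3 · CONVERGENT-WEB · S0 · wall · H4 · H5 · H6 · NULL-CONTINUUM · RECURRENT-LEAF · OSCILLATING-END). -/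

/-- **R9 `HotLapSign` (PROVABLE, S; LOAD-BEARING).**  At every hot point `N·Δₕv₂(−1,y) ≤ 0` (`y` maximises `σv₂(−1,·)` over `ℝ³` by the global
bound at `t = −1`, so every pure second derivative of `σv₂(−1,·)` at `y` is `≤ 0`; tree `contDiff_slice`, second-order test as in
`…LrcModEntireHigherOrderMaxTest` / `…ThreadPins`). -/
def HotLapSign : Prop :=
  ∀ (C : ℝ) (v : ℝ → EuclideanSpace ℝ (Fin 3) → EuclideanSpace ℝ (Fin 3)), Pinned C v →
    ∀ y ∈ hotSet v, v (-1) 0 2 * lapH v y ≤ 0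

/-- **stub R9** (PROVABLE, S). -/
theorem stub_hotLapSign : HotLapSign := by
  -- LANDED in the tree (closes the verbatim leaf_uniform item AS TYPED); discharged BY NAME, never restated.
  exact Summit.NavierStokesRegularity.NavierStokesRegularity.Theorems.PoloidalWindowDoorPoloidalWindowRigidityLeafUniformPins.hotLapSign

/-- **R10 `HotTimePin` (PROVABLE, S/M; LOAD-BEARING: handed to both cells).**  The time pin holds at EVERY hot point:
`∂ₜv₂(−1,y) = N/2` for `y ∈ H` (each hot point maximises `√(−t)σv₂` over `(−∞,0) × ℝ³`; differentiability in `t` of the classical solution; tree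
pattern `…HotSpot.hotSpot_firstOrder`).  With vertical NS at a critical point of `v₂`: `−∂_z p(−1,y) = N/2 − Δv₂(−1,y)` on all of `H`.
v1.1 note for the hand prover (critic A2): the statement uses `deriv`, so the proof MUST route through time-differentiability of the mild Type-I
ancient solution at `t = −1` (tree `Literature.Analysis.FluidPDE.TypeIAncientMildClassical` / the `…HotSpot.hotSpot_firstOrder` pattern); with
`deriv`-junk alone the statement would read `0 = N/2`, false — size S/M, not S. -/
def HotTimePin : Prop :=
  ∀ (C : ℝ) (v : ℝ → EuclideanSpace ℝ (Fin 3) → EuclideanSpace ℝ (Fin 3)), Pinned C v →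
    ∀ y ∈ hotSet v, deriv (fun s => v s y 2) (-1) = v (-1) 0 2 / 2

/-- **stub R10** (PROVABLE, S/M). -/
theorem stub_hotTimePin : HotTimePin := by
  -- LANDED in the tree (closes the verbatim leaf_uniform item AS TYPED); discharged BY NAME, never restated.
  exact Summit.NavierStokesRegularity.NavierStokesRegularity.Theorems.PoloidalWindowDoorPoloidalWindowRigidityLeafUniformPins.hotTimePin

/-- **R15 `VortexLineGlobal` (PROVABLE, M; support).**  Through every point there is a GLOBAL integral curve of `ω(−1,·)`: the field is `C¹`
(`slice_facts` / `contDiff_curl`) and BOUNDED on `ℝ³`: the ONE source (v1.3.1, critic's light ask) is the tree's PROVED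
`Literature.Analysis.FluidPDE.exists_tube_extension_of_typeI_ancient_mild` (TypeIAncientMildTubeAnalyticity.lean — the slice `v(−1,·)` extends holomorphically to a
UNIFORM complex tube of radius `r > 0` with a UNIFORM bound `B`; its hypotheses are `Pinned`'s first four conjuncts + `C¹` slices from `slice_facts`), whence
`sup‖Dv(−1,·)‖ ≤ B/r` by the Cauchy estimate on each coordinate disc and `sup‖ω(−1,·)‖ < ∞`; so maximal solutions of `γ′ = ω(γ)` (Mathlib Picard–Lindelöf +
continuation under `‖γ′‖ ≤ sup‖ω‖`) live on all of `ℝ`. -/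
def VortexLineGlobal : Prop :=
  ∀ (C : ℝ) (v : ℝ → EuclideanSpace ℝ (Fin 3) → EuclideanSpace ℝ (Fin 3)), Pinned C v →
    ∀ y : EuclideanSpace ℝ (Fin 3), ∃ γ : ℝ → EuclideanSpace ℝ (Fin 3), γ 0 = y ∧ ∀ τ : ℝ, HasDerivAt γ (Literature.Analysis.FluidPDE.curl (v (-1)) (γ τ)) τ

/-- **stub R15** (hand target). -/
theorem stub_vortexLineGlobal : VortexLineGlobal := by
  -- LANDED in the tree (closes the verbatim leaf_uniform item AS TYPED); discharged BY NAME, never restated.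
  exact Summit.NavierStokesRegularity.NavierStokesRegularity.Theorems.PoloidalWindowDoorPoloidalWindowRigidityLeafUniformVortexLine.vortexLineGlobal

/-- **R16 `LeafGlobalLaw` (PROVABLE, L; support — the GLOBAL form of R2 + R8 (+ R11 on Morse leaves) along a complete vortex line; v1.3: the Morse
hypothesis now guards only the curtain law).**  Along a global integral curve `γ` of `ω(−1,·)` starting at a hot point with `ω ≠ 0`: (a) every `γ τ` is hot
(first integrals `(γ τ)₂` and `w(γ τ)`: poloidality + frozen law, tree `…LoopTangencyPin.apply_integralCurve_eq`), `ω(γ τ) ≠ 0` (ODE uniqueness: an integral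
curve through a non-zero of a `C¹` field never meets a zero) and the ridge law `Δₕw(γ τ)‖ω(γ 0)‖² = Δₕw(γ 0)‖ω(γ τ)‖²` (R8's pointwise Wronskian identity at
every `τ`, constancy on the connected line); (b) if moreover `Δₕw(γ 0) ≠ 0` (MORSE; then `Δₕw ≠ 0` along `γ` by (a)), the curtain law `curtain(γ τ) = curtain(γ 0)`
(R11's identity).  The calculus is R8/R11's — one hand proves the pointwise identities once and gets R8, R11 and R16 together. -/
def LeafGlobalLaw : Prop :=
  ∀ (C : ℝ) (v : ℝ → EuclideanSpace ℝ (Fin 3) → EuclideanSpace ℝ (Fin 3)), Pinned C v →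
    (∀ s < 0, ∀ y, ⟪fderiv ℝ (v s) y (Literature.Analysis.FluidPDE.curl (v s) y), EuclideanSpace.single 2 1⟫_ℝ = 0) →
    (∀ y ∈ hotSet v, fderiv ℝ (fun x => v (-1) x 2) y = 0) →
    ∀ γ : ℝ → EuclideanSpace ℝ (Fin 3), (∀ τ : ℝ, HasDerivAt γ (Literature.Analysis.FluidPDE.curl (v (-1)) (γ τ)) τ) → γ 0 ∈ hotSet v →
      Literature.Analysis.FluidPDE.curl (v (-1)) (γ 0) ≠ 0 →
      (∀ τ : ℝ, γ τ ∈ hotSet v ∧ Literature.Analysis.FluidPDE.curl (v (-1)) (γ τ) ≠ 0 ∧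
        lapH v (γ τ) * ‖Literature.Analysis.FluidPDE.curl (v (-1)) (γ 0)‖ ^ 2 = lapH v (γ 0) * ‖Literature.Analysis.FluidPDE.curl (v (-1)) (γ τ)‖ ^ 2) ∧
      (lapH v (γ 0) ≠ 0 → ∀ τ : ℝ, curtain v (γ τ) = curtain v (γ 0))

/-- **R16 — DISCHARGED BY NAME (v1.1)** from the landed `…LeafUniformLeafGlobalLaw.leafGlobalLaw` (ns-es-p1 g7, `--supports 19708` helper; R16 VERBATIM with
the line's `Pinned` / `hotSet` / `lapH` / `hess` / `curtain` unfolded — es-p1's by-name wiring). -/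
theorem stub_leafGlobalLaw : LeafGlobalLaw := fun C v hP hfr hcrit γ hγ h0 hne =>
  PoloidalWindowDoorPoloidalWindowRigidityLeafUniformLeafGlobalLaw.leafGlobalLaw C v hP hfr hcrit γ hγ h0 hne

/-- **R18 `HotRegularAlone` (PROVABLE, L; support — near a REGULAR hot point the hot set is ONE vortex arc; STRUCT-g9-2 (W1)).**  The slice `v(−1,·)` is
real-analytic on `ℝ³` (tree, PROVED: `IsTypeIAncientMild.analyticOnNhd_slice_univ` ∘ `…PoloidalWindowDoorPoloidalWindowRigidityWindow.isTypeIAncientMild_of_class`);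
near a hot `y` with `ω(y) ≠ 0`, in the plane `P₀` the frozen law makes `w := v₂(−1,·)` a function of the local stream value, `w = Φ ∘ ψ` with `∇ψ = (ω₁, −ω₀) ≠ 0`
(flow box; analytic implicit chart, tree `Literature.Analysis.Calculus.ImplicitChart` `analyticAt_implicitFunction`), `Φ` analytic in one variable with a local
maximum `N` at `ψ₀`; `Φ ≢ N` near `ψ₀` (else a plane-neighbourhood of `y` is hot, contradicting the no-interior hypothesis R4), so by the one-variable identity
theorem (Mathlib `AnalyticAt.eventually_eq_or_eventually_ne`) `ψ₀` is isolated in `{Φ = N}`: `Φ = N − a(ψ−ψ₀)^{2k}(1+…)`, `a ≠ 0`, `k ≥ 1` — the pair `(k, a)` is a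
LEAF INVARIANT extending R8 (`k = 1 ⇔` MORSE with `c = Φ''(ψ₀)`; FLAT `⇔ k ≥ 2`) — and the hot set near `y` is exactly the arc `{ψ = ψ₀}` = the vortex arc through
`y`.  Holds for MORSE and FLAT leaves alike; it is the only place analyticity enters this line. -/
def HotRegularAlone : Prop :=
  ∀ (C : ℝ) (v : ℝ → EuclideanSpace ℝ (Fin 3) → EuclideanSpace ℝ (Fin 3)), Pinned C v →
    (∀ s < 0, ∀ y, ⟪fderiv ℝ (v s) y (Literature.Analysis.FluidPDE.curl (v s) y), EuclideanSpace.single 2 1⟫_ℝ = 0) →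
    (∀ y ∈ hotSet v, ∀ r : ℝ, 0 < r →
      ∃ y' : EuclideanSpace ℝ (Fin 3), y' 2 = 0 ∧ dist y' y < r ∧ v (-1) y' 2 ≠ v (-1) 0 2) →
    (∀ y ∈ hotSet v, Literature.Analysis.FluidPDE.curl (v (-1)) y ≠ 0 → ∃ r : ℝ, 0 < r ∧ ∃ (α : ℝ → EuclideanSpace ℝ (Fin 3)) (δ : ℝ), 0 < δ ∧ α 0 = y ∧
        (∀ s ∈ Set.Ioo (-δ) δ, HasDerivAt α (Literature.Analysis.FluidPDE.curl (v (-1)) (α s)) s) ∧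
        ∀ y' ∈ hotSet v, dist y' y < r → ∃ s ∈ Set.Ioo (-δ) δ, y' = α s)

/-- **R18 — DISCHARGED BY NAME** from the landed `…Theorems.PoloidalWindowDoorPoloidalWindowRigidityLeafUniformHotRegularAlone.hotRegularAlone`
(p701832 `…LeafUniformAloneCore` + p701918, ns-es-p1 g7, `--supports 19708` helper; R18 VERBATIM with `Pinned` / `hotSet` unfolded), never restated. -/
theorem stub_hotRegularAlone : HotRegularAlone := fun C v hP hfr hni y hy hω =>
  Summit.NavierStokesRegularity.NavierStokesRegularity.Theorems.PoloidalWindowDoorPoloidalWindowRigidityLeafUniformHotRegularAlone.hotRegularAlone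
    C v hP hfr hni y hy hω

/-- **R19 `LeafEnds` (PROVABLE, M/L; support — topological dynamics of a complete hot leaf, MORSE OR FLAT; v1.3 replaces v1.2's Morse-only R17).**  Given
(a) of R16 along a complete vortex line `γ`, local aloneness of regular hot points (R18's conclusion), a closed hot set and no compact isolated hot piece (R3):
(i) `γ` is INJECTIVE — a non-injective solution of the autonomous `C¹` ODE is periodic, its image is compact and, by aloneness at each of its points, relatively
open in `H`: a compact isolated hot piece; (ii) for each end (`atTop`, `atBot`) either `γ` leaves every compact set or it has a cluster point `q`; then `q ∈ H`
(closed), `ω(q) = 0` (were `ω(q) ≠ 0`, aloneness at `q` puts the returning points `γ τ_k` on the single arc through `q`, and ODE uniqueness + injectivity force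
`τ_k → τ*` with `γ τ* = q`, against `τ_k → ∞`), and `Δₕw(q) = 0` (the ridge law gives `Δₕw(γ τ_k) = Δₕw(γ 0)‖ω(γ τ_k)‖²/‖ω(γ 0)‖² → 0` by continuity of `ω`
and of `Δₕw` for the `C²` slice).  (Under the analytic web — Łojasiewicz's planar structure theorem, not used here — the captured end even CONVERGES to `q`
along an analytic arc of finite length; not claimed.)  PLANARITY (v1.3.1, answers critic P1 on v1.2's R17): the hot set is PLANAR BY DEFINITION
(`hotSet v ⊆ P₀ = {y₂ = 0}`) and R3 / aloneness / isolation are statements about that planar set, so the only normal direction is the horizontal `n` and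
`∂ₙ∂ₙw = Δₕw` (Morse) resp. the finite transversal order `2k` (R18) decide aloneness INSIDE `P₀`; a hot 2-sheet of `ℝ³` through the leaf with tangent
`αn + βe_z`, `β ≠ 0` (2-jet-consistent when `Δₕw·curtain = 0`) meets `P₀` transversally in the leaf itself and does not affect R3 — no Morse–Bott analysis on
`span(n, e_z)` and no `curtain ≠ 0` hypothesis is needed. -/
def LeafEnds : Prop :=
  ∀ (C : ℝ) (v : ℝ → EuclideanSpace ℝ (Fin 3) → EuclideanSpace ℝ (Fin 3)), Pinned C v → IsClosed (hotSet v) →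
    (∀ K O : Set (EuclideanSpace ℝ (Fin 3)), IsCompact K → K.Nonempty → K ⊆ hotSet v → IsOpen O → K ⊆ O →
      O ∩ hotSet v ⊆ K → False) →
    (∀ y ∈ hotSet v, Literature.Analysis.FluidPDE.curl (v (-1)) y ≠ 0 → ∃ r : ℝ, 0 < r ∧ ∃ (α : ℝ → EuclideanSpace ℝ (Fin 3)) (δ : ℝ), 0 < δ ∧ α 0 = y ∧
        (∀ s ∈ Set.Ioo (-δ) δ, HasDerivAt α (Literature.Analysis.FluidPDE.curl (v (-1)) (α s)) s) ∧
        ∀ y' ∈ hotSet v, dist y' y < r → ∃ s ∈ Set.Ioo (-δ) δ, y' = α s) →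
    ∀ γ : ℝ → EuclideanSpace ℝ (Fin 3), (∀ τ : ℝ, HasDerivAt γ (Literature.Analysis.FluidPDE.curl (v (-1)) (γ τ)) τ) →
      (∀ τ : ℝ, γ τ ∈ hotSet v ∧ Literature.Analysis.FluidPDE.curl (v (-1)) (γ τ) ≠ 0 ∧
        lapH v (γ τ) * ‖Literature.Analysis.FluidPDE.curl (v (-1)) (γ 0)‖ ^ 2 = lapH v (γ 0) * ‖Literature.Analysis.FluidPDE.curl (v (-1)) (γ τ)‖ ^ 2) →
      Function.Injective γ ∧
      (Filter.Tendsto γ Filter.atTop (Filter.cocompact (EuclideanSpace ℝ (Fin 3))) ∨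
        ∃ q : EuclideanSpace ℝ (Fin 3), MapClusterPt q Filter.atTop γ ∧ q ∈ hotSet v ∧ Literature.Analysis.FluidPDE.curl (v (-1)) q = 0 ∧ lapH v q = 0) ∧
      (Filter.Tendsto γ Filter.atBot (Filter.cocompact (EuclideanSpace ℝ (Fin 3))) ∨
        ∃ q : EuclideanSpace ℝ (Fin 3), MapClusterPt q Filter.atBot γ ∧ q ∈ hotSet v ∧ Literature.Analysis.FluidPDE.curl (v (-1)) q = 0 ∧ lapH v q = 0)

/-- **stub R19** (hand target). -/
theorem stub_leafEnds : LeafEnds := by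
  -- LANDED in the tree (closes the verbatim leaf_uniform item AS TYPED); discharged BY NAME, never restated.
  exact Summit.NavierStokesRegularity.NavierStokesRegularity.Theorems.PoloidalWindowDoorPoloidalWindowRigidityLeafUniformLeafEnds.leafEnds

/-- **R20 `HotFlatPointHFlat` (PROVABLE, S/M; support).**  A hot point with `Δₕw = 0` is horizontally FLAT: `y` is a global extremum of `w = v₂(−1,·)` on `ℝ³`
(the pinned bound at `t = −1`), so `σ·Hess w(y) ≤ 0` (`σ = sign N`; `C²` slice, symmetric nested `fderiv`s — Mathlib `second_derivative_symmetric`); a negative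
semidefinite horizontal block with zero trace vanishes, and the `2×2` minors on `(a, e₂)` then kill the mixed entries `∂_a∂_z w`.  In particular EVERY point of a flat
leaf, and every captured end point (R19: `Δₕw(q) = 0`), is `HFlat`. -/
def HotFlatPointHFlat : Prop :=
  ∀ (C : ℝ) (v : ℝ → EuclideanSpace ℝ (Fin 3) → EuclideanSpace ℝ (Fin 3)), Pinned C v → ∀ y ∈ hotSet v, lapH v y = 0 → HFlat v y

/-- **stub R20** (hand target). -/
theorem stub_hotFlatPointHFlat : HotFlatPointHFlat := by
  -- LANDED in the tree (closes the verbatim leaf_uniform item AS TYPED); discharged BY NAME, never restated.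
  exact Summit.NavierStokesRegularity.NavierStokesRegularity.Theorems.PoloidalWindowDoorPoloidalWindowRigidityLeafUniformHFlat.hotFlatPointHFlat

/-! ## The GLOBAL PLANAR STRUCTURE of the hot set (VERBATIM LINE 20 `hot_forest` v1.1): no cycles, separatrices, convergent ends -/

/-- **V1 `PlanarZeroBranches` (LITERATURE NAMED FACT — VENDORED p703245 as `Literature.Analysis.Calculus.realAnalytic_planarZeroSet_conicStructure` with the PROVED corollary
`….coordPlane_fin3` = this statement verbatim; support — local conic structure of planar real-analytic zero sets).**  For `g : ℝ³ → ℝ`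
real-analytic and a zero `q ∈ P₀ = {y₂ = 0}` near which `g|_{P₀}` is not identically zero, there are `r > 0`, `m : ℕ` and `m` HALF-BRANCHES
`β i : [0,1) → P₀`, continuous, `β i 0 = q`, PARAMETRISED BY DISTANCE (`dist (β i s) q = r·s`), inside the zero set, pairwise disjoint off `q`, covering every
zero of `g|_{P₀}` in the punctured disc of radius `r` (`m = 0` iff `q` is an isolated zero).  SOURCE OF RECORD (v1.3, critic P1 / KEY-NS #198 (2)): the
o-minimal LOCAL CONIC STRUCTURE theorem with the distance clause `‖φ(x) − p‖ = ‖x − p‖`, van den Dries 1998 Ch. 9 Thm. (2.3) [corpus:book:dries1998-tame-topology-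
o-minimal-structures p.174] (= Coste Thm. 4.10 [corpus:paper:arxiv-1806.05349 p.4 Prop. 2.3]; curve selection Shiota I.2.1.7 [ibid. Prop. 2.2]; Bierstone–Milman
1988 §2), in `ℝ_an`, plus finiteness of `{g = 0} ∩ S(q,ε)` by the identity theorem — the PLANAR intrinsic statement is the Literature `def`
`realAnalytic_planarZeroSet_conicStructure` (closed-disc form) with PROVED corollaries `.openDisc` (= the former draft V1⁰) and `.coordPlane_fin3` (= V1);
Milnor 1968 Thm. 2.10 / Lemma 3.3 cover the ALGEBRAIC case only and are not the anchor.  Not in Mathlib.  **v1.7: V1 := `….coordPlane_fin3 hV1`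
with the fact as the hypothesis `hV1`; V1⁰ and the transport deleted.**  Consumed by the hand proving F3 `CapturedEndConverges` (V1 as HYPOTHESIS, fact-free). -/
def PlanarZeroBranches : Prop :=
  ∀ (g : EuclideanSpace ℝ (Fin 3) → ℝ), AnalyticOnNhd ℝ g Set.univ →
    ∀ q : EuclideanSpace ℝ (Fin 3), q 2 = 0 → g q = 0 →
      (∀ r : ℝ, 0 < r → ∃ y : EuclideanSpace ℝ (Fin 3), y 2 = 0 ∧ dist y q < r ∧ g y ≠ 0) →
      ∃ r : ℝ, 0 < r ∧ ∃ (m : ℕ) (β : Fin m → ℝ → EuclideanSpace ℝ (Fin 3)),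
        (∀ i, ContinuousOn (β i) (Set.Ico 0 1) ∧ β i 0 = q ∧
          ∀ s ∈ Set.Ico (0 : ℝ) 1, (β i s) 2 = 0 ∧ g (β i s) = 0 ∧ dist (β i s) q = r * s) ∧
        (∀ i j, ∀ s ∈ Set.Ioo (0 : ℝ) 1, β i s = β j s → i = j) ∧
        (∀ y : EuclideanSpace ℝ (Fin 3), y 2 = 0 → g y = 0 → 0 < dist y q → dist y q < r →
          ∃ i, ∃ s ∈ Set.Ioo (0 : ℝ) 1, y = β i s)

/-- **V1 discharged (v1.8)**: the planar conic-structure fact now FOLLOWS from the tree's named fact «`ℝ_an,exp` is o-minimal»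
(van den Dries–Miller 1994) by nsreg-typer g27's landed p707348 `PlanarConic.exists_branches_of_dim_le_one` + p707485
`Literature.Analysis.Calculus.realAnalytic_planarZeroSet_conicStructure_of_realAnExp_isOMinimal`; so the only Literature leaf in the cone is `hO`. -/
theorem v1_of_oMinimal (hO : Literature.ModelTheory.ExponentialFields.VandendriesMiller1994_realAnExp_isOMinimal) :
    Literature.Analysis.Calculus.realAnalytic_planarZeroSet_conicStructure :=
  Literature.Analysis.Calculus.realAnalytic_planarZeroSet_conicStructure_of_realAnExp_isOMinimal hO

/-- **V1 on this line — BY NAME from the Literature (v1.7).**  The NAMED FACT `Literature.Analysis.Calculus.realAnalytic_planarZeroSet_conicStructure`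
(van den Dries 1998 Ch. 9 (2.3), local conic structure of planar real-analytic zero sets; vendored p703245, nsreg-typer g27) enters AS A HYPOTHESIS `hV1`
(a named Literature debt, not a sorry); its PROVED corollary `….coordPlane_fin3` is this statement VERBATIM (critic idea-crit-7 g7 06:45:35Z (a)).  The former
draft V1⁰ `PlanarAnalyticConicStructure` and the in-file chart transport `planarZeroBranches_of_conic` are retired (dead code, deleted). -/
theorem stub_planarZeroBranches (hO : Literature.ModelTheory.ExponentialFields.VandendriesMiller1994_realAnExp_isOMinimal) : PlanarZeroBranches :=
  Literature.Analysis.Calculus.realAnalytic_planarZeroSet_conicStructure.coordPlane_fin3 (v1_of_oMinimal hO)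

/-- **F1a `NoHotCycle` (PROVABLE, M; LOAD-BEARING).**  A pinned, peakless profile whose hot set has no planar interior point carries NO HOT CYCLE: no
continuous `1`-periodic curve, injective on `[0,1)`, runs inside `hotSet v`.  Proof (file header): Jordan (tree `JordanCurveTheorem_holds.of_periodic` on
`θ ↦ ⟨c θ 0, c θ 1⟩ : ℂ`) ⇒ bounded interior `U`; `σ·v₂(−1,·)` on the compact planar closure attains a minimum `m`; `m = |N|` makes an open planar disc hot
(contradicting the no-interior hypothesis at a point of `U`, which is then hot); `m < |N|` makes the minimisers a compact `K ⊂ U` and `(K, {y : (y₀,y₁) ∈ U})`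
an island bracket of `−σ·v₂(−1,·)` at `z₀ = 0`, `s = −1`, against `Peakless`.  Slice continuity from `Pinned` (tree `slice_facts`). -/
def NoHotCycle : Prop :=
  ∀ (C : ℝ) (v : ℝ → EuclideanSpace ℝ (Fin 3) → EuclideanSpace ℝ (Fin 3)), Pinned C v → Peakless v →
    (∀ y ∈ hotSet v, ∀ r : ℝ, 0 < r →
      ∃ y' : EuclideanSpace ℝ (Fin 3), y' 2 = 0 ∧ dist y' y < r ∧ v (-1) y' 2 ≠ v (-1) 0 2) →
    ∀ c : ℝ → EuclideanSpace ℝ (Fin 3), Continuous c → (∀ θ : ℝ, c (θ + 1) = c θ) → Set.InjOn c (Set.Ico 0 1) →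
      (∀ θ : ℝ, c θ ∈ hotSet v) → False

/-- **F1a BY NAME (v1.7)** — K2-p2 g14's p701982 `…Theorems.PoloidalWindowDoorPoloidalWindowRigidityHotForestNoHotCycle.noHotCycle` (this statement with
`Pinned` / `Peakless` / `hotSet` δ-unfolded; closes by unfolding; never restated). -/
theorem stub_noHotCycle : NoHotCycle :=
  Summit.NavierStokesRegularity.NavierStokesRegularity.Theorems.PoloidalWindowDoorPoloidalWindowRigidityHotForestNoHotCycle.noHotCycle

/-- **F1b `NoHotLoop` (PROVABLE, S/M ⇐ F1a; LOAD-BEARING).**  An injective continuous hot curve avoiding `q` cannot converge to `q` at BOTH ends (`q ∈ H` by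
closedness of the slice's level set; close the curve up at `q`: `θ ↦ γ (tan (π(θ − ½)))` on `(0,1)`, `q` at the integers — continuous, `1`-periodic,
injective on `[0,1)`; F1a). -/
def NoHotLoop : Prop :=
  ∀ (C : ℝ) (v : ℝ → EuclideanSpace ℝ (Fin 3) → EuclideanSpace ℝ (Fin 3)), Pinned C v → Peakless v →
    (∀ y ∈ hotSet v, ∀ r : ℝ, 0 < r →
      ∃ y' : EuclideanSpace ℝ (Fin 3), y' 2 = 0 ∧ dist y' y < r ∧ v (-1) y' 2 ≠ v (-1) 0 2) →
    ∀ γ : ℝ → EuclideanSpace ℝ (Fin 3), Continuous γ → Function.Injective γ → (∀ τ : ℝ, γ τ ∈ hotSet v) →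
      ∀ q : EuclideanSpace ℝ (Fin 3), (∀ τ : ℝ, γ τ ≠ q) →
        Filter.Tendsto γ Filter.atTop (nhds q) → Filter.Tendsto γ Filter.atBot (nhds q) → False

/-- **F1b BY NAME (v1.7)** — K2-p2 g14's p702250 `…Theorems.PoloidalWindowDoorPoloidalWindowRigidityHotForestNoHotLoop.noHotLoop`. -/
theorem stub_noHotLoop : NoHotLoop :=
  Summit.NavierStokesRegularity.NavierStokesRegularity.Theorems.PoloidalWindowDoorPoloidalWindowRigidityHotForestNoHotLoop.noHotLoop

/-- **F2 `HotSeparatrix` (PROVABLE, S/M; LOAD-BEARING — the separatrix law).**  A complete integral curve of `ω(−1,·)` one of whose ends has a CLUSTER POINT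
in the hot set lies entirely in the hot set: `y ↦ v₂(−1,y)` and `y ↦ y₂` are first integrals (frozen law at `s = −1` + poloidality from `Pinned`; tree
`…LoopTangencyPin.apply_integralCurve_eq` on every `(−T, T)`), so both are constant along `γ`, and along a subsequence `γ τ_k → q` continuity gives the
constants `v₂(−1,q) = N` and `q₂ = 0`. -/
def HotSeparatrix : Prop :=
  ∀ (C : ℝ) (v : ℝ → EuclideanSpace ℝ (Fin 3) → EuclideanSpace ℝ (Fin 3)), Pinned C v →
    (∀ s < 0, ∀ y, ⟪fderiv ℝ (v s) y (Literature.Analysis.FluidPDE.curl (v s) y), EuclideanSpace.single 2 1⟫_ℝ = 0) →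
    ∀ γ : ℝ → EuclideanSpace ℝ (Fin 3), (∀ τ : ℝ, HasDerivAt γ (Literature.Analysis.FluidPDE.curl (v (-1)) (γ τ)) τ) →
      ∀ q ∈ hotSet v, (MapClusterPt q Filter.atTop γ ∨ MapClusterPt q Filter.atBot γ) → ∀ τ : ℝ, γ τ ∈ hotSet v

/-- **F2 BY NAME (v1.7)** — ns-k2-port-2 g4's `…Theorems.PoloidalWindowDoorPoloidalWindowRigidityHotForestSeparatrix.hotSeparatrix` (first integrals
`y₂`, `v₂(−1,·)` along the leaf + closedness). -/
theorem stub_hotSeparatrix : HotSeparatrix :=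
  Summit.NavierStokesRegularity.NavierStokesRegularity.Theorems.PoloidalWindowDoorPoloidalWindowRigidityHotForestSeparatrix.hotSeparatrix

/-- **F3 `CapturedEndConverges` (PROVABLE, M ⇐ V1; LOAD-BEARING).**  An injective complete hot leaf with `ω ≠ 0` along it, and a cluster point `q` with
`ω(q) = 0` at `+∞` (resp. `−∞`), CONVERGES to `q` at that end.  Proof (file header): V1 for `g := v₂(−1,·) − N` at `q` (analytic slice, tree
`IsTypeIAncientMild.analyticOnNhd_slice_univ`; `g|_{P₀} ≢ 0` near `q` by the no-interior hypothesis, `q` being hot as a limit of hot points); components of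
`γ⁻¹(B_r(q))` run in one half-branch, on which `dist(γ, q) = r·s` is continuous and injective, hence strictly monotone; bounded components are impossible
(`dist → r` at both ends), so the late returns lie in a component `[T, ∞)` along which `dist(γ τ, q) ↓ 0`. -/
def CapturedEndConverges : Prop :=
  ∀ (C : ℝ) (v : ℝ → EuclideanSpace ℝ (Fin 3) → EuclideanSpace ℝ (Fin 3)), Pinned C v →
    (∀ y ∈ hotSet v, ∀ r : ℝ, 0 < r →
      ∃ y' : EuclideanSpace ℝ (Fin 3), y' 2 = 0 ∧ dist y' y < r ∧ v (-1) y' 2 ≠ v (-1) 0 2) →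
    ∀ γ : ℝ → EuclideanSpace ℝ (Fin 3), (∀ τ : ℝ, HasDerivAt γ (Literature.Analysis.FluidPDE.curl (v (-1)) (γ τ)) τ) →
      (∀ τ : ℝ, γ τ ∈ hotSet v ∧ Literature.Analysis.FluidPDE.curl (v (-1)) (γ τ) ≠ 0) → Function.Injective γ →
      ∀ q : EuclideanSpace ℝ (Fin 3), Literature.Analysis.FluidPDE.curl (v (-1)) q = 0 →
        (MapClusterPt q Filter.atTop γ → Filter.Tendsto γ Filter.atTop (nhds q)) ∧
        (MapClusterPt q Filter.atBot γ → Filter.Tendsto γ Filter.atBot (nhds q))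

/-- **F3 ⇐ V1 BY NAME (v1.7)** — ns-es-p1 g7's p702676 `…Theorems.PoloidalWindowDoorPoloidalWindowRigidityHotForestCapturedEnd.capturedEndConverges_of_branches`
(core p702591 `…HotForestCapturedCore`: open partition by branch index, strict monotonicity of the distance along a branch). -/
theorem stub_capturedEndConverges_of_branches : PlanarZeroBranches → CapturedEndConverges :=
  Summit.NavierStokesRegularity.NavierStokesRegularity.Theorems.PoloidalWindowDoorPoloidalWindowRigidityHotForestCapturedEnd.capturedEndConverges_of_branches

/-- **F3 on this line** := (F3 ⇐ V1, by name) applied to V1 (by name, under the Literature hypothesis `hV1`) — the named fact sits in the cone of the kernel AS A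
HYPOTHESIS, not in a docstring and not as a sorry. -/
theorem capturedEndConverges_holds (hO : Literature.ModelTheory.ExponentialFields.VandendriesMiller1994_realAnExp_isOMinimal) : CapturedEndConverges :=
  stub_capturedEndConverges_of_branches (stub_planarZeroBranches hO)

/-! ## The two research cells of C2a′ on this line (OPEN) — every binder of `stub_cellC2aRidge` verbatim, then the forest structure in hand -/

/-- **Cell ESC-END `CellEscapingEnd` (OPEN, research).**  EVERY binder of C2a′ + the time pin on `H` (R10) + the Laplace sign on `H` (R9) + the no-cycle law
(F1a) and the separatrix law (F2) for this profile + the complete hot leaf `γ` through the arc's base point: global integral curve, hot and regular at every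
time with the ridge law `Δₕw(γ τ)‖ω(γ 0)‖² = Δₕw(γ 0)‖ω(γ τ)‖²`, the curtain law if Morse (`Δₕw(γ 0) ≠ 0`), injective, and ONE END leaving every compact set
⇒ `False`.  Why it might fail: the generic picture (a proper hot vortex half-line carrying `w = N`, `−σ∂_z p ≥ |N|/2`); the missing input is a Liouville /
zero-mode mechanism AT INFINITY along a curve (codimension 2 for box means, B-g8-4) or the ancient dynamics of the ridge; the 2.5-D toy of B-g9-6 sits here. -/
def CellEscapingEnd : Prop :=
  ∀ (C : ℝ) (v : ℝ → EuclideanSpace ℝ (Fin 3) → EuclideanSpace ℝ (Fin 3)) (W : Set (ℝ × EuclideanSpace ℝ (Fin 3))),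
    Pinned C v → ThickWindow v W → Peakless v →
    (∀ s < 0, ∀ y, ⟪fderiv ℝ (v s) y (Literature.Analysis.FluidPDE.curl (v s) y), EuclideanSpace.single 2 1⟫_ℝ = 0) →
    IsClosed (hotSet v) → (∀ y ∈ hotSet v, fderiv ℝ (fun x => v (-1) x 2) y = 0) →
    (∀ K O : Set (EuclideanSpace ℝ (Fin 3)), IsCompact K → K.Nonempty → K ⊆ hotSet v → IsOpen O → K ⊆ O →
      O ∩ hotSet v ⊆ K → False) →
    (∀ y ∈ hotSet v, ∀ r : ℝ, 0 < r →
      ∃ y' : EuclideanSpace ℝ (Fin 3), y' 2 = 0 ∧ dist y' y < r ∧ v (-1) y' 2 ≠ v (-1) 0 2) →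
    (∃ (γ : ℝ → EuclideanSpace ℝ (Fin 3)) (ε : ℝ), 0 < ε ∧ γ 0 ∈ hotSet v ∧
      Literature.Analysis.FluidPDE.curl (v (-1)) (γ 0) ≠ 0 ∧
      ∀ τ ∈ Set.Ioo (-ε) ε, HasDerivAt γ (Literature.Analysis.FluidPDE.curl (v (-1)) (γ τ)) τ ∧ γ τ ∈ hotSet v) →
    (∀ y ∈ hotSet v, deriv (fun s => v s y 2) (-1) = v (-1) 0 2 / 2) →
    (∀ y ∈ hotSet v, v (-1) 0 2 * lapH v y ≤ 0) →
    (∀ c : ℝ → EuclideanSpace ℝ (Fin 3), Continuous c → (∀ θ : ℝ, c (θ + 1) = c θ) → Set.InjOn c (Set.Ico 0 1) →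
      (∀ θ : ℝ, c θ ∈ hotSet v) → False) →
    (∀ γ : ℝ → EuclideanSpace ℝ (Fin 3), (∀ τ : ℝ, HasDerivAt γ (Literature.Analysis.FluidPDE.curl (v (-1)) (γ τ)) τ) →
      ∀ q ∈ hotSet v, (MapClusterPt q Filter.atTop γ ∨ MapClusterPt q Filter.atBot γ) → ∀ τ : ℝ, γ τ ∈ hotSet v) →
    (∃ γ : ℝ → EuclideanSpace ℝ (Fin 3), γ 0 ∈ hotSet v ∧ Literature.Analysis.FluidPDE.curl (v (-1)) (γ 0) ≠ 0 ∧
      (∀ τ : ℝ, HasDerivAt γ (Literature.Analysis.FluidPDE.curl (v (-1)) (γ τ)) τ) ∧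
      (∀ τ : ℝ, γ τ ∈ hotSet v ∧ Literature.Analysis.FluidPDE.curl (v (-1)) (γ τ) ≠ 0 ∧
        lapH v (γ τ) * ‖Literature.Analysis.FluidPDE.curl (v (-1)) (γ 0)‖ ^ 2 = lapH v (γ 0) * ‖Literature.Analysis.FluidPDE.curl (v (-1)) (γ τ)‖ ^ 2) ∧
      (lapH v (γ 0) ≠ 0 → ∀ τ : ℝ, curtain v (γ τ) = curtain v (γ 0)) ∧
      Function.Injective γ ∧
      (Filter.Tendsto γ Filter.atTop (Filter.cocompact (EuclideanSpace ℝ (Fin 3))) ∨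
        Filter.Tendsto γ Filter.atBot (Filter.cocompact (EuclideanSpace ℝ (Fin 3))))) →
    False

/- (LINE 21: `CellEscapingEnd` is no longer a stub — it is DERIVED below, `cellEscapingEnd_holds`.) -/

/-- **Cell CONVERGENT-WEB `CellConvergentWeb` (OPEN, research).**  EVERY binder of C2a′ + R10 + R9 + the no-cycle law (F1a) and the separatrix law (F2) for
this profile + the complete hot leaf `γ` through the arc's base point (global, hot and regular with the ridge law, curtain law if Morse, injective) which is
a bounded HETEROCLINIC hot connection: `γ → q⁺` at `+∞`, `γ → q⁻` at `−∞`, with `q^± ∈ H` vorticity zeros, horizontally flat, `q⁺ ≠ q⁻` ⇒ `False`.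
Why it might fail: a bounded hot saddle connection inside an unbounded hot tree is consistent with every finite jet and every leaf invariant; the missing
input is the ancient dynamics of a pinned heteroclinic vortex connection, or an induction through the web to infinity (every further vertex may be degenerate). -/
def CellConvergentWeb : Prop :=
  ∀ (C : ℝ) (v : ℝ → EuclideanSpace ℝ (Fin 3) → EuclideanSpace ℝ (Fin 3)) (W : Set (ℝ × EuclideanSpace ℝ (Fin 3))),
    Pinned C v → ThickWindow v W → Peakless v →
    (∀ s < 0, ∀ y, ⟪fderiv ℝ (v s) y (Literature.Analysis.FluidPDE.curl (v s) y), EuclideanSpace.single 2 1⟫_ℝ = 0) →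
    IsClosed (hotSet v) → (∀ y ∈ hotSet v, fderiv ℝ (fun x => v (-1) x 2) y = 0) →
    (∀ K O : Set (EuclideanSpace ℝ (Fin 3)), IsCompact K → K.Nonempty → K ⊆ hotSet v → IsOpen O → K ⊆ O →
      O ∩ hotSet v ⊆ K → False) →
    (∀ y ∈ hotSet v, ∀ r : ℝ, 0 < r →
      ∃ y' : EuclideanSpace ℝ (Fin 3), y' 2 = 0 ∧ dist y' y < r ∧ v (-1) y' 2 ≠ v (-1) 0 2) →
    (∃ (γ : ℝ → EuclideanSpace ℝ (Fin 3)) (ε : ℝ), 0 < ε ∧ γ 0 ∈ hotSet v ∧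
      Literature.Analysis.FluidPDE.curl (v (-1)) (γ 0) ≠ 0 ∧
      ∀ τ ∈ Set.Ioo (-ε) ε, HasDerivAt γ (Literature.Analysis.FluidPDE.curl (v (-1)) (γ τ)) τ ∧ γ τ ∈ hotSet v) →
    (∀ y ∈ hotSet v, deriv (fun s => v s y 2) (-1) = v (-1) 0 2 / 2) →
    (∀ y ∈ hotSet v, v (-1) 0 2 * lapH v y ≤ 0) →
    (∀ c : ℝ → EuclideanSpace ℝ (Fin 3), Continuous c → (∀ θ : ℝ, c (θ + 1) = c θ) → Set.InjOn c (Set.Ico 0 1) →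
      (∀ θ : ℝ, c θ ∈ hotSet v) → False) →
    (∀ γ : ℝ → EuclideanSpace ℝ (Fin 3), (∀ τ : ℝ, HasDerivAt γ (Literature.Analysis.FluidPDE.curl (v (-1)) (γ τ)) τ) →
      ∀ q ∈ hotSet v, (MapClusterPt q Filter.atTop γ ∨ MapClusterPt q Filter.atBot γ) → ∀ τ : ℝ, γ τ ∈ hotSet v) →
    (∃ (γ : ℝ → EuclideanSpace ℝ (Fin 3)) (qp qm : EuclideanSpace ℝ (Fin 3)),
      γ 0 ∈ hotSet v ∧ Literature.Analysis.FluidPDE.curl (v (-1)) (γ 0) ≠ 0 ∧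
      (∀ τ : ℝ, HasDerivAt γ (Literature.Analysis.FluidPDE.curl (v (-1)) (γ τ)) τ) ∧
      (∀ τ : ℝ, γ τ ∈ hotSet v ∧ Literature.Analysis.FluidPDE.curl (v (-1)) (γ τ) ≠ 0 ∧
        lapH v (γ τ) * ‖Literature.Analysis.FluidPDE.curl (v (-1)) (γ 0)‖ ^ 2 = lapH v (γ 0) * ‖Literature.Analysis.FluidPDE.curl (v (-1)) (γ τ)‖ ^ 2) ∧
      (lapH v (γ 0) ≠ 0 → ∀ τ : ℝ, curtain v (γ τ) = curtain v (γ 0)) ∧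
      Function.Injective γ ∧
      Filter.Tendsto γ Filter.atTop (nhds qp) ∧ Filter.Tendsto γ Filter.atBot (nhds qm) ∧
      qp ∈ hotSet v ∧ qm ∈ hotSet v ∧
      Literature.Analysis.FluidPDE.curl (v (-1)) qp = 0 ∧ Literature.Analysis.FluidPDE.curl (v (-1)) qm = 0 ∧
      HFlat v qp ∧ HFlat v qm ∧ qp ≠ qm) →
    False

/-- **stub CONVERGENT-WEB** (OPEN, research). -/
theorem stub_cellConvergentWeb : CellConvergentWeb := by
  sorry

/-! ## Shared research stubs (VERBATIM hot_split v1.6 / hot_forest v1.1): S0 and the wall -/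

/-- **SHARED STUB S0 ((TH) column) — VERBATIM `stub_localTHEmptyHypNUGRS`** (twist_split = hot_loops v4.3 = loop_island = hot_split). -/
theorem stub_localTHEmptyHypNUGRS :
    ∀ (u : ℝ → EuclideanSpace ℝ (Fin 3) → EuclideanSpace ℝ (Fin 3)) (μ A : ℝ → ℝ → ℝ)
      (U : Set (ℝ × EuclideanSpace ℝ (Fin 3))) (p₀ : ℝ × EuclideanSpace ℝ (Fin 3)),
      IsOpen U → p₀ ∈ U →
      AnalyticOnNhd ℝ (Function.uncurry u) U →
      (∀ p ∈ U, AnalyticAt ℝ (Function.uncurry μ) (p.1, p.2 2)) →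
      (∀ p ∈ U, AnalyticAt ℝ (Function.uncurry A) (p.1, p.2 2)) →
      (∀ p ∈ U, fderiv ℝ (u p.1) p.2 (EuclideanSpace.single 0 1) 1 = fderiv ℝ (u p.1) p.2 (EuclideanSpace.single 1 1) 0) →
      (∀ p ∈ U, fderiv ℝ (u p.1) p.2 (EuclideanSpace.single 0 1) 0 + fderiv ℝ (u p.1) p.2 (EuclideanSpace.single 1 1) 1 +
        fderiv ℝ (u p.1) p.2 (EuclideanSpace.single 2 1) 2 = 0) →
      (∀ p ∈ U, ∀ b : Fin 3, b ≠ 2 →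
        fderiv ℝ (u p.1) p.2 (EuclideanSpace.single 2 1) b =
          μ p.1 (p.2 2) * fderiv ℝ (u p.1) p.2 (EuclideanSpace.single b 1) 2) →
      (∀ p ∈ U,
        (1 - μ p.1 (p.2 2)) *
            (deriv (fun s => u s p.2 2) p.1 + fderiv ℝ (fun y => u p.1 y 2) p.2 (u p.1 p.2)
              - Δ (fun y => u p.1 y 2) p.2) =
          A p.1 (p.2 2) + (deriv (fun s => μ s (p.2 2)) p.1 - deriv (deriv (μ p.1)) (p.2 2)) * u p.1 p.2 2
            + deriv (μ p.1) (p.2 2) / 2 * u p.1 p.2 2 ^ 2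
            - 2 * deriv (μ p.1) (p.2 2) * fderiv ℝ (u p.1) p.2 (EuclideanSpace.single 2 1) 2) →
      fderiv ℝ (fun y => fderiv ℝ (u p₀.1) y (EuclideanSpace.single 2 1) 2) p₀.2 (EuclideanSpace.single 0 1) *
            fderiv ℝ (u p₀.1) p₀.2 (EuclideanSpace.single 1 1) 2 -
          fderiv ℝ (fun y => fderiv ℝ (u p₀.1) y (EuclideanSpace.single 2 1) 2) p₀.2 (EuclideanSpace.single 1 1) *
            fderiv ℝ (u p₀.1) p₀.2 (EuclideanSpace.single 0 1) 2 ≠ 0 →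
      μ p₀.1 (p₀.2 2) ≠ 0 → μ p₀.1 (p₀.2 2) ≠ 1 → deriv (μ p₀.1) (p₀.2 2) ≠ 0 →
      μ p₀.1 (p₀.2 2) < 0 →
      (fderiv ℝ (u p₀.1) p₀.2 (EuclideanSpace.single 0 1) 0 ≠ fderiv ℝ (u p₀.1) p₀.2 (EuclideanSpace.single 1 1) 1 ∨
        fderiv ℝ (u p₀.1) p₀.2 (EuclideanSpace.single 1 1) 0 ≠ 0) →
      u p₀.1 p₀.2 = 0 →
      fderiv ℝ (u p₀.1) p₀.2 (EuclideanSpace.single 0 1) 2 = 0 →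
      fderiv ℝ (u p₀.1) p₀.2 (EuclideanSpace.single 1 1) 2 = 1 → False := by
  sorry

/-- **THE WALL ⟨27893⟩ BY NAME (`stub_wall`)** — item `LoopPeriodRatchet.FrequencyGrowthExponent` (rank 2, OPEN); feeds the landed reduction only. -/
theorem stub_wall : FrequencyGrowthExponent := by
  sorry

/-! ## v1 (LINE 21) — the HOT TRANSLATION HULL: re-pinning at hot points, thickness at EVERY space-time point (mod S0) from the tree's
`threadDichotomy`, Type-I compactness along hot sequences, and the END-VORTICITY CUT of the escaping cell

The lever (new on this crux): the residues quantify over ALL pinned thick peakless profiles, and that class is (almost) closed under the two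
operations an escaping hot end invites — TRANSLATION to another hot point (H1, proved here: every clause of `Pinned` is translation-covariant and
the three pins re-derive themselves at any hot point by Fermat, tree `threadPin_of_hotSpot` / `threadSignedPin`) and LOCALLY UNIFORM LIMITS along
a hot sequence (H3 `HullLimit`: KNSS Type-I compactness, tree `KNSS2009_lemma61_typeI_rate`; `Peakless` persists because islands are STRICT
brackets).  The one clause that does not pass to limits is `ThickWindow` — and the door's own `threadDichotomy` (tree, 5 cases) says that a
pinned profile with NO thick window anywhere near a point `z₀` is untwisted / (TH) / time-only-sloped / degenerate there, each of which the tree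
closes outright except (TH), which is S0.  Hence H2 `ThickDense` (PROVED mod the (TH)-germ = S0 by name): EVERY point of EVERY pinned profile
carries a thick window.  So hull limits land back in the class, and the escaping cell ESC-END splits by the behaviour of `|ω|` along the end:
`|ω| → 0` ⇒ the hull limit carries an UNBOUNDED NULL HOT CONTINUUM through its pin (H4, planar continuum theory) — which is exactly the
situation of the other residue C2b′ (there the null continuum is the hot component of `0`, unbounded by tree `hotComponent_unbounded`): ONE cell
`CellNullContinuum` now carries both; `|ω| ≥ δ` frequently ⇒ the hull limit is a pinned thick peakless profile whose pin is a REGULAR point of a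
complete hot leaf that is the limit of the forward translates of the escaping end (H5, Grönwall): cell `CellPersistentEnd`. -/

/-! ### H0 — translation bookkeeping (PROVED) -/

theorem curl_translate_arg (w : EuclideanSpace ℝ (Fin 3) → EuclideanSpace ℝ (Fin 3)) (c x : EuclideanSpace ℝ (Fin 3)) :
    Literature.Analysis.FluidPDE.curl (fun y => w (y + c)) x = Literature.Analysis.FluidPDE.curl w (x + c) := by
  rw [curl_eq_curlCLM, curl_eq_curlCLM, fderiv_comp_add_right]

theorem isDivFree_translate_arg {w : EuclideanSpace ℝ (Fin 3) → EuclideanSpace ℝ (Fin 3)}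
    (hw : Literature.Analysis.FluidPDE.VectorCalculus.IsDivFree w) (c : EuclideanSpace ℝ (Fin 3)) :
    Literature.Analysis.FluidPDE.VectorCalculus.IsDivFree (fun y => w (y + c)) := fun x => by
  have e : Literature.Analysis.FluidPDE.VectorCalculus.divergence (fun y => w (y + c)) x =
      Literature.Analysis.FluidPDE.VectorCalculus.divergence w (x + c) := by
    simp only [Literature.Analysis.FluidPDE.VectorCalculus.divergence, fderiv_comp_add_right]
  rw [e, hw (x + c)]

/-! ### H1 — RE-PINNING (PROVED): the translate of a pinned profile by a HOT point is pinned (same `C`, same `N`); `Peakless` is translation-invariant -/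

/-- **H1a (PROVED).**  `v(·, · + y)` is `Pinned` for every hot point `y`: the class clauses by tree `…LeafUniformPins.class_translate`, solenoidality and
poloidality by H0, `N` and the Type-I extremality because `v₂(−1,y) = N`, and the three pins BY FERMAT at the new origin (tree `threadPin_of_hotSpot`,
`threadSignedPin`). -/
theorem pinned_translate {C : ℝ} {v : ℝ → EuclideanSpace ℝ (Fin 3) → EuclideanSpace ℝ (Fin 3)} (hP : Pinned C v)
    {y : EuclideanSpace ℝ (Fin 3)} (hy : y ∈ hotSet v) : Pinned C (fun t x => v t (x + y)) := by
  obtain ⟨hrate, hcont, hmild, hdiv, hpol, hne, hhot, -, -⟩ := hP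
  obtain ⟨hrate', hcont', hmild'⟩ := PoloidalWindowDoorPoloidalWindowRigidityLeafUniformPins.class_translate hrate hcont hmild y
  have hyN : v (-1) y 2 = v (-1) 0 2 := hy.2
  have hdiv' : ∀ t < 0, Literature.Analysis.FluidPDE.VectorCalculus.IsDivFree ((fun t x => v t (x + y)) t) :=
    fun t ht => isDivFree_translate_arg (hdiv t ht) y
  have hpol' : ∀ s < 0, ∀ x, ⟪Literature.Analysis.FluidPDE.curl ((fun t x => v t (x + y)) s) x, EuclideanSpace.single 2 1⟫_ℝ = 0 := by
    intro s hs x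
    show ⟪Literature.Analysis.FluidPDE.curl (fun x' => v s (x' + y)) x, EuclideanSpace.single 2 1⟫_ℝ = 0
    rw [curl_translate_arg]
    exact hpol s hs (x + y)
  have hne' : (fun t x => v t (x + y)) (-1) 0 2 ≠ 0 := by
    show v (-1) (0 + y) 2 ≠ 0
    rw [zero_add, hyN]
    exact hne
  have hhot' : ∀ t < 0, ∀ x, Real.sqrt (-t) * |(fun t x => v t (x + y)) t x 2| ≤ |(fun t x => v t (x + y)) (-1) 0 2| := by
    intro t ht x
    show Real.sqrt (-t) * |v t (x + y) 2| ≤ |v (-1) (0 + y) 2|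
    rw [zero_add, hyN]
    exact hhot t ht (x + y)
  exact ⟨hrate', hcont', hmild', hdiv', hpol', hne', hhot',
    PoloidalWindowDoorLrcModEntireThreadPins.threadPin_of_hotSpot hrate' hcont' hmild' hhot',
    PoloidalWindowDoorLrcModEntireThreadPins.threadSignedPin C _ hrate' hcont' hmild' hdiv' hne' hhot'⟩

/-- **H1b (PROVED).**  `Peakless` is invariant under every spatial translation (islands translate to islands, on the shifted plane). -/
theorem peakless_translate {v : ℝ → EuclideanSpace ℝ (Fin 3) → EuclideanSpace ℝ (Fin 3)} (hK : Peakless v)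
    (y : EuclideanSpace ℝ (Fin 3)) : Peakless (fun t x => v t (x + y)) := by
  intro s z₀ σ M K O hs h
  obtain ⟨hσ, hKc, hKne, hKval, hO, hKO, hOle, hOeq⟩ := h
  have hφ : Continuous fun x : EuclideanSpace ℝ (Fin 3) => x + y := by fun_prop
  have hOi : IsOpen ((fun x : EuclideanSpace ℝ (Fin 3) => x + y) '' O) := by
    have e : (fun x : EuclideanSpace ℝ (Fin 3) => x + y) '' O = (Homeomorph.addRight y) '' O := rfl
    rw [e]
    exact (Homeomorph.addRight y).isOpenMap O hO
  refine hK s (z₀ + y 2) σ M ((fun x => x + y) '' K) ((fun x => x + y) '' O) hs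
    ⟨hσ, hKc.image hφ, hKne.image _, ?_, hOi, Set.image_mono hKO, ?_, ?_⟩
  · rintro _ ⟨x, hx, rfl⟩
    refine ⟨?_, (hKval x hx).2⟩
    show (x + y) 2 = z₀ + y 2
    rw [PiLp.add_apply, (hKval x hx).1]
  · rintro _ ⟨x, hx, rfl⟩ hx2
    have hx2' : x 2 = z₀ := by
      have h' : x 2 + y 2 = z₀ + y 2 := by rw [← PiLp.add_apply]; exact hx2
      linarith
    exact hOle x hx hx2'
  · rintro _ ⟨x, hx, rfl⟩ hx2 hval
    have hx2' : x 2 = z₀ := by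
      have h' : x 2 + y 2 = z₀ + y 2 := by rw [← PiLp.add_apply]; exact hx2
      linarith
    exact ⟨x, hOeq x hx hx2' hval, rfl⟩

/-! ### H2 — THICKNESS AT EVERY POINT, mod the (TH)-germ = S0 (PROVED): the door's `threadDichotomy` dispatches every non-thick point -/

/-- `ThickWindow` re-centred at an arbitrary space-time point `z₀` (the body of `ThickWindow`, VERBATIM, with `Metric.ball z₀ r`);
`ThickWindowAt v W (−1, 0)` is `ThickWindow v W` definitionally. -/
def ThickWindowAt (v : ℝ → EuclideanSpace ℝ (Fin 3) → EuclideanSpace ℝ (Fin 3)) (W : Set (ℝ × EuclideanSpace ℝ (Fin 3)))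
    (z₀ : ℝ × EuclideanSpace ℝ (Fin 3)) : Prop :=
  IsOpen W ∧ W ⊆ Set.Iio (0 : ℝ) ×ˢ Set.univ ∧
    (∀ z ∈ W, (Literature.Analysis.FluidPDE.curl (v z.1) z.2 ≠ 0 ∧
        (fderiv ℝ (v z.1) z.2 (EuclideanSpace.single 0 1) 2 ≠ 0 ∨ fderiv ℝ (v z.1) z.2 (EuclideanSpace.single 1 1) 2 ≠ 0) ∧
        (fderiv ℝ (v z.1) z.2 (EuclideanSpace.single 2 1) 0 ≠ 0 ∨ fderiv ℝ (v z.1) z.2 (EuclideanSpace.single 2 1) 1 ≠ 0)) ∧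
      (fderiv ℝ (fun x => fderiv ℝ (v z.1) x (EuclideanSpace.single 2 1) 2) z.2 (EuclideanSpace.single 0 1) *
            fderiv ℝ (v z.1) z.2 (EuclideanSpace.single 1 1) 2 -
          fderiv ℝ (fun x => fderiv ℝ (v z.1) x (EuclideanSpace.single 2 1) 2) z.2 (EuclideanSpace.single 1 1) *
            fderiv ℝ (v z.1) z.2 (EuclideanSpace.single 0 1) 2 ≠ 0)) ∧
    (∀ m : ℝ → ℝ → ℝ, ∀ W₁ : Set (ℝ × EuclideanSpace ℝ (Fin 3)), W₁ ⊆ W → IsOpen W₁ → W₁.Nonempty →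
        ∃ z ∈ W₁, ∃ b : Fin 3, b ≠ 2 ∧
          fderiv ℝ (v z.1) z.2 (EuclideanSpace.single 2 1) b ≠
            m z.1 (z.2 2) * fderiv ℝ (v z.1) z.2 (EuclideanSpace.single b 1) 2) ∧
    (∀ r : ℝ, 0 < r → (Metric.ball z₀ r ∩ W).Nonempty)

/-- **The (TH)-germ statement** — VERBATIM the section hypothesis `hTHgerm` of tree `…LrcModEntireFarThreadReduction` (the conclusion of tree
`…TwistingTHLocalHypGerm.stub_twistingTH_of_localEmptyHyp`): on a non-degenerate, gradient-pinned, twisting, (TH) window the profile has a symmetry /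
entire germ.  It is S0's consequence through the landed chain NormalFormRS → Galilean → NonUmbilic → HypGerm (`thGerm_holds` below, BY NAME). -/
def THGerm : Prop :=
  ∀ (C : ℝ) (v : ℝ → EuclideanSpace ℝ (Fin 3) → EuclideanSpace ℝ (Fin 3)),
    Literature.Analysis.FluidPDE.HasTypeITimeDecay C v →
    ContinuousOn (Function.uncurry v) (Set.Iio (0 : ℝ) ×ˢ Set.univ) →
    (∀ s t : ℝ, s < t → t < 0 → ∀ x, v t x =
      Literature.Analysis.UnboundedOperators.heatExtension (v s) (t - s) x -
        Literature.Analysis.FluidPDE.oseenDuhamel 1 s v v t x) →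
    (∀ t < 0, Literature.Analysis.FluidPDE.VectorCalculus.IsDivFree (v t)) →
    (∀ s < 0, ∀ y, ⟪Literature.Analysis.FluidPDE.curl (v s) y, EuclideanSpace.single 2 1⟫_ℝ = 0) →
    ∀ W : Set (ℝ × EuclideanSpace ℝ (Fin 3)), IsOpen W → W.Nonempty → W ⊆ Set.Iio (0 : ℝ) ×ˢ Set.univ →
      (∀ z ∈ W, (Literature.Analysis.FluidPDE.curl (v z.1) z.2 ≠ 0 ∧
          (fderiv ℝ (v z.1) z.2 (EuclideanSpace.single 0 1) 2 ≠ 0 ∨ fderiv ℝ (v z.1) z.2 (EuclideanSpace.single 1 1) 2 ≠ 0) ∧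
          (fderiv ℝ (v z.1) z.2 (EuclideanSpace.single 2 1) 0 ≠ 0 ∨ fderiv ℝ (v z.1) z.2 (EuclideanSpace.single 2 1) 1 ≠ 0))) →
      (∀ m : ℝ → ℝ, ∀ W₁ : Set (ℝ × EuclideanSpace ℝ (Fin 3)), W₁ ⊆ W → IsOpen W₁ → W₁.Nonempty →
          ∃ z ∈ W₁, ∃ b : Fin 3, b ≠ 2 ∧
            fderiv ℝ (v z.1) z.2 (EuclideanSpace.single 2 1) b ≠
              m z.1 * fderiv ℝ (v z.1) z.2 (EuclideanSpace.single b 1) 2) →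
      (∀ z ∈ W, (fderiv ℝ (fun x => fderiv ℝ (v z.1) x (EuclideanSpace.single 2 1) 2) z.2 (EuclideanSpace.single 0 1) *
              fderiv ℝ (v z.1) z.2 (EuclideanSpace.single 1 1) 2 -
            fderiv ℝ (fun x => fderiv ℝ (v z.1) x (EuclideanSpace.single 2 1) 2) z.2 (EuclideanSpace.single 1 1) *
              fderiv ℝ (v z.1) z.2 (EuclideanSpace.single 0 1) 2 ≠ 0)) →
      (∃ m : ℝ → ℝ → ℝ, ∀ z ∈ W, ∀ b : Fin 3, b ≠ 2 →
          fderiv ℝ (v z.1) z.2 (EuclideanSpace.single 2 1) b =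
            m z.1 (z.2 2) * fderiv ℝ (v z.1) z.2 (EuclideanSpace.single b 1) 2) →
      ∃ s : ℝ, s < 0 ∧ ∃ U : Set (EuclideanSpace ℝ (Fin 3)), IsOpen U ∧ U.Nonempty ∧
        ((∃ e : EuclideanSpace ℝ (Fin 3), e ≠ 0 ∧
            ∀ y ∈ U, fderiv ℝ (Literature.Analysis.FluidPDE.curl (v s)) y e = 0) ∨
         (∃ c : EuclideanSpace ℝ (Fin 3), ∀ y ∈ U,
            Literature.Analysis.FluidPDE.rotGen (Literature.Analysis.FluidPDE.curl (v s) y) =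
              fderiv ℝ (Literature.Analysis.FluidPDE.curl (v s)) y (Literature.Analysis.FluidPDE.rotGen (y - c))) ∨
         (∃ w : EuclideanSpace ℝ (Fin 3) → EuclideanSpace ℝ (Fin 3), AnalyticOnNhd ℝ w Set.univ ∧
            ¬ BddAbove (Set.range fun y => ‖w y‖) ∧ ∀ y ∈ U, v s y = w y))

/-- **THGerm ⇐ S0, BY NAME** through the tree chain `localTHEmptyHypNF_of_normalFormRS` → `localTHEmptyHypNonUmbilic_of_galilean` →
`localTHEmptyHyp_of_localTHEmptyHypNonUmbilic` → `stub_twistingTH_of_localEmptyHyp` (all landed; S0 = `stub_localTHEmptyHypNUGRS`, OPEN, owned by the (TH) column). -/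
theorem thGerm_holds : THGerm :=
  PoloidalWindowDoorLrcModEntireTwistingTHLocalHypGerm.stub_twistingTH_of_localEmptyHyp
    (PoloidalWindowDoorLrcModEntireTwistingTHLocalNonUmbilic.localTHEmptyHyp_of_localTHEmptyHypNonUmbilic
      (PoloidalWindowDoorLrcModEntireTwistingTHLocalGalilean.localTHEmptyHypNonUmbilic_of_galilean
        (PoloidalWindowDoorLrcModEntireTwistingTHLocalNormalFormRS.localTHEmptyHypNF_of_normalFormRS stub_localTHEmptyHypNUGRS)))

/-- **H2 `ThickDense`**: given the (TH)-germ statement, EVERY space-time point `z₀` (with `z₀.1 < 0`) of EVERY pinned profile carries a thick window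
accumulating at `z₀`.  (So thickness is not a property of the pin: it holds everywhere, off the leaf included — the theorem form of the g9 seed
"use thickness off the leaf".) -/
def ThickDense : Prop :=
  THGerm → ∀ (C : ℝ) (v : ℝ → EuclideanSpace ℝ (Fin 3) → EuclideanSpace ℝ (Fin 3)), Pinned C v →
    ∀ z₀ : ℝ × EuclideanSpace ℝ (Fin 3), z₀.1 < 0 → ∃ W : Set (ℝ × EuclideanSpace ℝ (Fin 3)), ThickWindowAt v W z₀

/-- **H2 PROVED** from the tree: `…ThreadDichotomy.threadDichotomy` (5 cases) at `z₀`; case (i) IS a thick window at `z₀`; (ii) untwisted ⇒ a germ by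
tree `…UntwistedGerm.stub_untwistedGerm` ⇒ absurd on a non-degenerate window by tree `…LrcModEntireIff.false_of_germ_of_nondegenerate`; (iii) (TH) ⇒ the
same via `THGerm`; (iv) time-only slope ⇒ `v ≡ 0` by tree `…FarThreadReduction.eq_zero_of_local_timeOnlySlope`; (v) degenerate ⇒ `v ≡ 0` by tree
`…SymmetryGerms.eq_zero_of_curl_eq_zero_on_open` / `eq_zero_of_horizontalGradient_eq_zero_on_open` / `…VerticalShearGerm.eq_zero_of_verticalShear_eq_zero_on_open`;
`v ≡ 0` contradicts `N ≠ 0`. -/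
theorem thickDense_holds : ThickDense := by
  intro hTH C v hP z₀ hz₀
  obtain ⟨hrate, hcont, hmild, hdiv, hpol, hne, -, -, -⟩ := hP
  have habs : ¬ (∀ t < 0, ∀ x, v t x = 0) := fun h0 => hne (by rw [h0 (-1) (by norm_num) 0]; rfl)
  have hgermAbs : ∀ W : Set (ℝ × EuclideanSpace ℝ (Fin 3)), W.Nonempty → W ⊆ Set.Iio (0 : ℝ) ×ˢ Set.univ →
      (∀ z ∈ W, Literature.Analysis.FluidPDE.curl (v z.1) z.2 ≠ 0 ∧
          (fderiv ℝ (v z.1) z.2 (EuclideanSpace.single 0 1) 2 ≠ 0 ∨ fderiv ℝ (v z.1) z.2 (EuclideanSpace.single 1 1) 2 ≠ 0) ∧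
          (fderiv ℝ (v z.1) z.2 (EuclideanSpace.single 2 1) 0 ≠ 0 ∨ fderiv ℝ (v z.1) z.2 (EuclideanSpace.single 2 1) 1 ≠ 0)) →
      (∃ s : ℝ, s < 0 ∧ ∃ U : Set (EuclideanSpace ℝ (Fin 3)), IsOpen U ∧ U.Nonempty ∧
        ((∃ e : EuclideanSpace ℝ (Fin 3), e ≠ 0 ∧
            ∀ y ∈ U, fderiv ℝ (Literature.Analysis.FluidPDE.curl (v s)) y e = 0) ∨
         (∃ c : EuclideanSpace ℝ (Fin 3), ∀ y ∈ U,
            Literature.Analysis.FluidPDE.rotGen (Literature.Analysis.FluidPDE.curl (v s) y) =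
              fderiv ℝ (Literature.Analysis.FluidPDE.curl (v s)) y (Literature.Analysis.FluidPDE.rotGen (y - c))) ∨
         (∃ w : EuclideanSpace ℝ (Fin 3) → EuclideanSpace ℝ (Fin 3), AnalyticOnNhd ℝ w Set.univ ∧
            ¬ BddAbove (Set.range fun y => ‖w y‖) ∧ ∀ y ∈ U, v s y = w y))) → False := by
    intro W hWne hWs hnd hgerm
    obtain ⟨z₁, hz₁⟩ := hWne
    obtain ⟨s, hs', U, hU, hUne, hg⟩ := hgerm
    exact PoloidalWindowDoorLrcModEntireIff.false_of_germ_of_nondegenerate hrate hcont hmild hdiv hpol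
      (Set.mem_prod.1 (hWs hz₁)).1 (hnd z₁ hz₁).1 hs' hU hUne hg
  rcases PoloidalWindowDoorLrcModEntireThreadDichotomy.threadDichotomy C v hrate hcont hmild hdiv hpol z₀ hz₀ with
    ⟨W, hW, hWs, hndtw, hthick, hacc⟩ | ⟨W, hW, hWne, hWs, hnd, htw0⟩ | ⟨W, hW, hWne, hWs, hnd, hpin', htw, hTH'⟩ |
    ⟨W, hW, hWne, hWs, m, hm⟩ | ⟨s, hs', U, hU, hUne, hdeg⟩
  · exact ⟨W, hW, hWs, hndtw, hthick, hacc⟩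
  · exact (hgermAbs W hWne hWs hnd (PoloidalWindowDoorLrcModEntireUntwistedGerm.stub_untwistedGerm C v hrate hcont hmild hdiv hpol
      W hW hWne hWs hnd htw0)).elim
  · exact (hgermAbs W hWne hWs hnd (hTH C v hrate hcont hmild hdiv hpol W hW hWne hWs hnd hpin' htw hTH')).elim
  · exact (habs (PoloidalWindowDoorLrcModEntireFarThreadReduction.eq_zero_of_local_timeOnlySlope hrate hcont hmild hdiv hpol
      hW hWne hWs hm)).elim
  · rcases hdeg with hcurl | hflat | hrig
    · exact (habs (PoloidalWindowDoorPoloidalWindowRigiditySymmetryGerms.eq_zero_of_curl_eq_zero_on_open hrate hcont hmild hdiv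
        hs' hU hUne hcurl)).elim
    · exact (habs (PoloidalWindowDoorPoloidalWindowRigiditySymmetryGerms.eq_zero_of_horizontalGradient_eq_zero_on_open hrate hcont hmild hdiv
        hs' (hpol s hs') hU hUne fun y hy => (hflat y hy).1)).elim
    · exact (habs (PoloidalWindowDoorPoloidalWindowRigidityVerticalShearGerm.eq_zero_of_verticalShear_eq_zero_on_open hrate hcont hmild hdiv
        hs' hU hUne hrig)).elim

/-- **H2 at the pin of any pinned profile**: `ThickDense → THGerm → ∃ W, ThickWindow v W` (`ThickWindowAt v W (−1,0)` is `ThickWindow v W` definitionally). -/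
theorem thickWindow_of_dense (hTD : ThickDense) (hTH : THGerm) {C : ℝ} {v : ℝ → EuclideanSpace ℝ (Fin 3) → EuclideanSpace ℝ (Fin 3)}
    (hP : Pinned C v) : ∃ W : Set (ℝ × EuclideanSpace ℝ (Fin 3)), ThickWindow v W :=
  hTD hTH C v hP ((-1 : ℝ), (0 : EuclideanSpace ℝ (Fin 3))) (by show (-1 : ℝ) < 0; norm_num)

/-! ### H3 — Type-I COMPACTNESS along hot sequences (`HullLimit`, PROVED — v1.2) -/

/-- **H3 `HullLimit` (PROVED below, v1.2 — `hullLimit_holds` is sorry-free; LOAD-BEARING).**  Along any sequence of hot points `y_k ∈ H`, a subsequence of the re-pinned translates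
`v(·, · + y_k)` (each `Pinned C`, `Peakless` by H1) converges locally uniformly on every slice, with vorticity slices at `s = −1` converging locally
uniformly too, to a profile `U` that is again `Pinned C` and `Peakless`.  Proof route: uniform `C^k` bounds of Type-I ancient mild slices (tree
`exists_tube_extension_of_typeI_ancient_mild`, `curl_slice_bounded_lipschitz`) ⇒ Arzelà–Ascoli on compacts + diagonal; the limit is in the class by
tree `Literature…AncientMildCompactness.KNSS2009_lemma61_typeI_rate` (mild formula and Type-I rate pass to the limit; weak ⇒ strong solenoidality for
analytic slices); poloidality, `N`, the Type-I extremality pass to pointwise limits; the pins by Fermat (tree `threadPin_of_hotSpot`, `threadSignedPin`);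
`Peakless U`: an island bracket `(K, O)` of `U` is STRICT (`= M` only on `K`), so for `j` large the maximisers of `σ·v_j` over a slightly smaller
closed neighbourhood form an island bracket of `v_j` (uniform convergence on the compact closure) — contradiction (cf. tree `…HotLoopsIslandsPersist`). -/
def HullLimit : Prop :=
  ∀ (C : ℝ) (v : ℝ → EuclideanSpace ℝ (Fin 3) → EuclideanSpace ℝ (Fin 3)), Pinned C v → Peakless v →
    ∀ y : ℕ → EuclideanSpace ℝ (Fin 3), (∀ k, y k ∈ hotSet v) →
      ∃ (φ : ℕ → ℕ) (U : ℝ → EuclideanSpace ℝ (Fin 3) → EuclideanSpace ℝ (Fin 3)), StrictMono φ ∧ Pinned C U ∧ Peakless U ∧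
        (∀ t < 0, TendstoLocallyUniformly (fun j x => v t (x + y (φ j))) (U t) Filter.atTop) ∧
        TendstoLocallyUniformly (fun j x => Literature.Analysis.FluidPDE.curl (v (-1)) (x + y (φ j)))
          (Literature.Analysis.FluidPDE.curl (U (-1))) Filter.atTop

/-- **H3′ `ClassCompactness` (PROVED below, v1.2: `classCompactness_of_peaklessClosed` + `peaklessClosed_holds`; LOAD-BEARING).**  Sequential compactness of the pinned peakless class at FIXED
`C` and fixed hot value `N`: any sequence of `Pinned C`, `Peakless` profiles with the same `v₂(−1,0)` has a subsequence converging locally uniformly on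
every slice (vorticity slices at `s = −1` too) to a `Pinned C`, `Peakless` profile.  Ingredients by name: tree `exists_tube_extension_of_typeI_ancient_mild`
/ `curl_slice_bounded_lipschitz` (uniform slice bounds ⇒ Arzelà–Ascoli + diagonal), `Literature…AncientMildCompactness.KNSS2009_lemma61_typeI_rate` (the
limit is Type-I ancient mild; weak ⇒ strong solenoidality for analytic slices), pointwise limits for poloidality / `N ≠ 0` (the common value) / the Type-I
extremality, Fermat for the pins (tree `threadPin_of_hotSpot`, `threadSignedPin`), strictness of island brackets for `Peakless` (cf. tree
`…HotLoopsIslandsPersist`).  Why it might fail: only formally (the weak/strong solenoidality and `C¹`-compactness plumbing is long); no mathematical risk known. -/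
def ClassCompactness : Prop :=
  ∀ (C : ℝ) (vs : ℕ → ℝ → EuclideanSpace ℝ (Fin 3) → EuclideanSpace ℝ (Fin 3)),
    (∀ k, Pinned C (vs k)) → (∀ k, Peakless (vs k)) → (∀ k, vs k (-1) 0 2 = vs 0 (-1) 0 2) →
      ∃ (φ : ℕ → ℕ) (U : ℝ → EuclideanSpace ℝ (Fin 3) → EuclideanSpace ℝ (Fin 3)), StrictMono φ ∧ Pinned C U ∧ Peakless U ∧
        (∀ t < 0, TendstoLocallyUniformly (fun j => vs (φ j) t) (U t) Filter.atTop) ∧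
        TendstoLocallyUniformly (fun j => Literature.Analysis.FluidPDE.curl (vs (φ j) (-1)))
          (Literature.Analysis.FluidPDE.curl (U (-1))) Filter.atTop

/-- **H3″ `PeaklessClosed` (PROVED below, `peaklessClosed_holds`; pure topology of locally uniform limits — the one piece of H3′ that is not a tree theorem).**  `Peakless` is
CLOSED under locally uniform convergence of continuous slices: an island bracket `(K, O)` of the limit `U` is STRICT (`σU₂ = M` on `O ∩ {y₂ = z₀}` only
on `K`), so on the compact ring `(cthickening 2r K \ thickening r K) ∩ {y₂ = z₀} ⊆ O` one has `σU₂ ≤ M − 3δ`; for `j` large (`‖v_j − U‖ < δ` on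
`cthickening 2r K`) the maximisers of `σ(v_j)₂` over `cthickening r K ∩ {y₂ = z₀}` together with `O_j := thickening 2r K` form an island bracket of
`v_j` — contradiction.  Mathlib: `IsCompact.exists_cthickening_subset_open`, `IsCompact.cthickening`, `tendstoLocallyUniformly_iff_forall_isCompact`,
`Metric.tendstoUniformlyOn_iff`, `IsCompact.exists_isMaxOn`. -/
def PeaklessClosed : Prop :=
  ∀ (vs : ℕ → ℝ → EuclideanSpace ℝ (Fin 3) → EuclideanSpace ℝ (Fin 3)) (U : ℝ → EuclideanSpace ℝ (Fin 3) → EuclideanSpace ℝ (Fin 3)),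
    (∀ k, Peakless (vs k)) → (∀ k, ∀ t < 0, Continuous (vs k t)) → (∀ t < 0, Continuous (U t)) →
    (∀ t < 0, TendstoLocallyUniformly (fun j => vs j t) (U t) Filter.atTop) → Peakless U

section H3closed
open Filter Topology Metric

/-- **H3″ PROVED.**  `Peakless` is closed under locally uniform convergence of continuous slices (strict island brackets pull back; see the docstring
of `PeaklessClosed`). -/
theorem peaklessClosed_holds : PeaklessClosed := by
  intro vs U hK hcvs hcU hconv s z₀ σ M K O hs h
  obtain ⟨hσ, hKc, hKne, hKval, hO, hKO, hOle, hOeq⟩ := h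
  have hc2 : Continuous fun x : EuclideanSpace ℝ (Fin 3) => x 2 := by fun_prop
  have hPc : IsClosed {y : EuclideanSpace ℝ (Fin 3) | y 2 = z₀} := isClosed_eq hc2 continuous_const
  -- a closed thickening of `K` inside `O`
  obtain ⟨δ₀, hδ₀, hδ₀O⟩ := hKc.exists_cthickening_subset_open hO hKO
  set r : ℝ := δ₀ / 2 with hr_def
  have hr : 0 < r := by positivity
  have hrδ : r < δ₀ := by rw [hr_def]; linarith
  -- the compact sets `A := cthickening r K ∩ P`, `B := cthickening δ₀ K`, the ring `R := (B \ thickening r K) ∩ P`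
  have hAc : IsCompact (cthickening r K ∩ {y : EuclideanSpace ℝ (Fin 3) | y 2 = z₀}) := hKc.cthickening.inter_right hPc
  have hBc : IsCompact (cthickening δ₀ K) := hKc.cthickening
  have hRc : IsCompact ((cthickening δ₀ K \ thickening r K) ∩ {y : EuclideanSpace ℝ (Fin 3) | y 2 = z₀}) :=
    (hBc.diff isOpen_thickening).inter_right hPc
  have hKA : K ⊆ cthickening r K ∩ {y : EuclideanSpace ℝ (Fin 3) | y 2 = z₀} :=
    fun y hy => ⟨self_subset_cthickening K hy, (hKval y hy).1⟩
  have hKB : K ⊆ cthickening δ₀ K := self_subset_cthickening K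
  have hf : Continuous fun y => σ * U s y 2 := continuous_const.mul (hc2.comp (hcU s hs))
  -- strictness of the bracket on the ring
  have hRlt : ∀ y ∈ (cthickening δ₀ K \ thickening r K) ∩ {y : EuclideanSpace ℝ (Fin 3) | y 2 = z₀}, σ * U s y 2 < M := by
    rintro y ⟨⟨hyB, hynt⟩, hyP⟩
    have hyO : y ∈ O := hδ₀O hyB
    rcases (hOle y hyO hyP).lt_or_eq with hlt | heq
    · exact hlt
    · exact absurd (self_subset_thickening hr K (hOeq y hyO hyP heq)) hynt
  -- a margin `δ > 0` on the ring
  obtain ⟨δ, hδ, hRle⟩ : ∃ δ > 0, ∀ y ∈ (cthickening δ₀ K \ thickening r K) ∩ {y : EuclideanSpace ℝ (Fin 3) | y 2 = z₀},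
      σ * U s y 2 ≤ M - 3 * δ := by
    by_cases hRne : ((cthickening δ₀ K \ thickening r K) ∩ {y : EuclideanSpace ℝ (Fin 3) | y 2 = z₀}).Nonempty
    · obtain ⟨y₀, hy₀, hmax⟩ := hRc.exists_isMaxOn hRne hf.continuousOn
      refine ⟨(M - σ * U s y₀ 2) / 3, by linarith [hRlt y₀ hy₀], fun y hy => ?_⟩
      have h1 : σ * U s y 2 ≤ σ * U s y₀ 2 := hmax hy
      linarith
    · exact ⟨1, one_pos, fun y hy => (hRne ⟨y, hy⟩).elim⟩
  -- uniform convergence on the compact `B`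
  have hunif : TendstoUniformlyOn (fun j => vs j s) (U s) atTop (cthickening δ₀ K) :=
    (tendstoLocallyUniformly_iff_forall_isCompact.1 (hconv s hs)) _ hBc
  obtain ⟨j, hj⟩ := ((Metric.tendstoUniformlyOn_iff.1 hunif) δ hδ).exists
  have hσ1 : |σ| = 1 := by rcases hσ with h1 | h1 <;> simp [h1]
  have hclose : ∀ y ∈ cthickening δ₀ K, |σ * vs j s y 2 - σ * U s y 2| < δ := by
    intro y hy
    have h1 : dist (U s y 2) (vs j s y 2) ≤ dist (U s y) (vs j s y) := PiLp.dist_apply_le (U s y) (vs j s y) 2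
    have h2 := hj y hy
    rw [Real.dist_eq] at h1
    calc |σ * vs j s y 2 - σ * U s y 2| = |σ| * |vs j s y 2 - U s y 2| := by rw [← mul_sub, abs_mul]
      _ = |U s y 2 - vs j s y 2| := by rw [hσ1, one_mul, abs_sub_comm]
      _ < δ := lt_of_le_of_lt h1 h2
  -- the maximisers of `σ(v_j)₂` over `A`
  have hg : Continuous fun y => σ * vs j s y 2 := continuous_const.mul (hc2.comp (hcvs j s hs))
  have hAne : (cthickening r K ∩ {y : EuclideanSpace ℝ (Fin 3) | y 2 = z₀}).Nonempty := hKne.mono hKA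
  obtain ⟨y₁, hy₁A, hmax₁⟩ := hAc.exists_isMaxOn hAne hg.continuousOn
  obtain ⟨yK, hyK⟩ := hKne
  have hMj : M - δ < σ * vs j s y₁ 2 := by
    have h1 : σ * vs j s yK 2 ≤ σ * vs j s y₁ 2 := hmax₁ (hKA hyK)
    have h2 := hclose yK (hKB hyK)
    rw [(hKval yK hyK).2] at h2
    have h3 := (abs_lt.1 h2).1
    linarith
  -- on the ring, `σ(v_j)₂ < M − δ < M_j`
  have hring : ∀ y ∈ thickening δ₀ K, y 2 = z₀ → y ∉ cthickening r K → σ * vs j s y 2 < M - δ := by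
    intro y hyO hyP hyA
    have hyB : y ∈ cthickening δ₀ K := thickening_subset_cthickening δ₀ K hyO
    have hyR : y ∈ (cthickening δ₀ K \ thickening r K) ∩ {y : EuclideanSpace ℝ (Fin 3) | y 2 = z₀} :=
      ⟨⟨hyB, fun h' => hyA (thickening_subset_cthickening r K h')⟩, hyP⟩
    have h1 := hRle y hyR
    have h2 := (abs_lt.1 (hclose y hyB)).2
    linarith
  -- the island bracket of `v_j`: contradiction with `Peakless (vs j)`
  refine hK j s z₀ σ (σ * vs j s y₁ 2)
    ((cthickening r K ∩ {y : EuclideanSpace ℝ (Fin 3) | y 2 = z₀}) ∩ {y | σ * vs j s y 2 = σ * vs j s y₁ 2})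
    (thickening δ₀ K) hs ⟨hσ, hAc.inter_right (isClosed_eq hg continuous_const), ⟨y₁, hy₁A, rfl⟩,
      fun y hy => ⟨hy.1.2, hy.2⟩, isOpen_thickening, fun y hy => cthickening_subset_thickening' hδ₀ hrδ K hy.1.1, ?_, ?_⟩
  · intro y hyO hyP
    by_cases hyA : y ∈ cthickening r K
    · exact hmax₁ ⟨hyA, hyP⟩
    · have := hring y hyO hyP hyA
      linarith
  · intro y hyO hyP hyM
    by_cases hyA : y ∈ cthickening r K
    · exact ⟨⟨hyA, hyP⟩, hyM⟩
    · have := hring y hyO hyP hyA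
      linarith

end H3closed

/-- **H3″ on this line (PROVED).** -/
theorem stub_peaklessClosed : PeaklessClosed :=
  peaklessClosed_holds

section H3proof
open Filter Topology

/-- Slices of a profile of the class are continuous (indeed real-analytic on `ℝ³`: tree `IsTypeIAncientMild.analyticOnNhd_slice_univ` ∘
`…PoloidalWindowDoorPoloidalWindowRigidityWindow.isTypeIAncientMild_of_class`). -/
theorem continuous_slice_of_pinned {C : ℝ} {v : ℝ → EuclideanSpace ℝ (Fin 3) → EuclideanSpace ℝ (Fin 3)} (hP : Pinned C v)
    {t : ℝ} (ht : t < 0) : Continuous (v t) :=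
  ((PoloidalWindowDoorPoloidalWindowRigidityWindow.isTypeIAncientMild_of_class hP.1 hP.2.1 hP.2.2.1
    hP.2.2.2.1).analyticOnNhd_slice_univ ht).continuous

/-- **H3′ ⇐ H3″ (PROVED; everything else BY NAME).**  Sequential compactness of the pinned peakless class at fixed `C` and fixed hot value:
the subsequence and the limit `U` with pointwise convergence of values AND derivatives and locally uniform convergence of slices and slice-derivatives
are the tree's KNSS extraction `…exists_tendsto_of_isTypeIAncientMild_seq` (each `v_k` is in
`IsTypeIAncientMild C` by `…Window.isTypeIAncientMild_of_class`); the class clauses of `U` come back by `IsTypeIAncientMild.mild_eq_heatExtension` /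
`.2.1` / `.2.2.2` / `ContDiffOn.continuousOn`; poloidality of `U` by `…PoloidalExtremal.poloidal_of_tendsto`; the hot value, `N ≠ 0` and the Type-I
extremality by pointwise limits; the gradient thread and the time / Laplacian pins RE-DERIVE THEMSELVES by Fermat (tree `threadPin_of_hotSpot`,
`threadSignedPin`); vorticity slices converge locally uniformly because `curl = curlCLM ∘ D` with `curlCLM` uniformly continuous; `Peakless U` is H3″. -/
theorem classCompactness_of_peaklessClosed (hPC : PeaklessClosed) : ClassCompactness := by
  intro C vs hP hK hN
  have hw : ∀ k, IsTypeIAncientMild C (vs k) := fun k =>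
    PoloidalWindowDoorPoloidalWindowRigidityWindow.isTypeIAncientMild_of_class (hP k).1 (hP k).2.1 (hP k).2.2.1 (hP k).2.2.2.1
  obtain ⟨φ, hφ, W, hW, hpt, hfd, htlu, htlufd⟩ :=
    exists_tendsto_of_isTypeIAncientMild_seq C hw
  -- the four class clauses of the limit
  have hrate : Literature.Analysis.FluidPDE.HasTypeITimeDecay C W := hW.2.2.2
  have hcont : ContinuousOn (Function.uncurry W) (Set.Iio (0 : ℝ) ×ˢ Set.univ) := hW.1.continuousOn
  have hmild : ∀ s t : ℝ, s < t → t < 0 → ∀ x, W t x =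
      Literature.Analysis.UnboundedOperators.heatExtension (W s) (t - s) x -
        Literature.Analysis.FluidPDE.oseenDuhamel 1 s W W t x :=
    fun s t hst ht x => hW.mild_eq_heatExtension hst ht x
  have hdiv : ∀ t < 0, Literature.Analysis.FluidPDE.VectorCalculus.IsDivFree (W t) := hW.2.1
  -- poloidality passes to the limit (pointwise convergence of derivatives)
  have hpol : ∀ s < 0, ∀ y, ⟪Literature.Analysis.FluidPDE.curl (W s) y, EuclideanSpace.single 2 1⟫_ℝ = 0 :=
    fun s hs y => PoloidalWindowDoorPoloidalWindowRigidityPoloidalExtremal.poloidal_of_tendsto (hfd s hs y)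
      (fun j => (hP (φ j)).2.2.2.2.1 s hs y)
  -- the common hot value passes to the limit
  have hc2 : Continuous fun x : EuclideanSpace ℝ (Fin 3) => x 2 := by fun_prop
  have hval : ∀ t < 0, ∀ x, Tendsto (fun j => vs (φ j) t x 2) atTop (𝓝 (W t x 2)) :=
    fun t ht x => (hc2.tendsto _).comp (hpt t ht x)
  have hWN : W (-1) 0 2 = vs 0 (-1) 0 2 := by
    have h1 := hval (-1) (by norm_num) 0
    have h2 : (fun j => vs (φ j) (-1) 0 2) = fun _ => vs 0 (-1) 0 2 := funext fun j => hN (φ j)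
    rw [h2] at h1
    exact (tendsto_nhds_unique h1 tendsto_const_nhds).symm ▸ rfl
  have hne : W (-1) 0 2 ≠ 0 := by
    rw [hWN]
    exact (hP 0).2.2.2.2.2.1
  -- the Type-I extremality passes to the limit
  have hhot : ∀ t < 0, ∀ x, Real.sqrt (-t) * |W t x 2| ≤ |W (-1) 0 2| := by
    intro t ht x
    have hlim : Tendsto (fun j => Real.sqrt (-t) * |vs (φ j) t x 2|) atTop (𝓝 (Real.sqrt (-t) * |W t x 2|)) :=
      ((continuous_const.mul continuous_abs).tendsto _).comp (hval t ht x)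
    refine le_of_tendsto hlim (Eventually.of_forall fun j => ?_)
    have h := (hP (φ j)).2.2.2.2.2.2.1 t ht x
    rw [hN (φ j)] at h
    rw [hWN]
    exact h
  -- the pins re-derive themselves by Fermat at the hot spot of the limit
  have hPW : Pinned C W :=
    ⟨hrate, hcont, hmild, hdiv, hpol, hne, hhot,
      PoloidalWindowDoorLrcModEntireThreadPins.threadPin_of_hotSpot hrate hcont hmild hhot,
      PoloidalWindowDoorLrcModEntireThreadPins.threadSignedPin C W hrate hcont hmild hdiv hne hhot⟩
  -- `Peakless` passes to the limit (H3″)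
  have hKW : Peakless W :=
    hPC (fun j => vs (φ j)) W (fun j => hK (φ j)) (fun j t ht => continuous_slice_of_pinned (hP (φ j)) ht)
      (fun t ht => continuous_slice_of_pinned hPW ht) (fun t ht => htlu t ht)
  -- vorticity slices converge locally uniformly: `curl = curlCLM ∘ D`
  have hcurl : TendstoLocallyUniformly (fun j => Literature.Analysis.FluidPDE.curl (vs (φ j) (-1)))
      (Literature.Analysis.FluidPDE.curl (W (-1))) atTop := by
    have e1 : (fun j => Literature.Analysis.FluidPDE.curl (vs (φ j) (-1))) = fun j => curlCLM ∘ fderiv ℝ (vs (φ j) (-1)) := by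
      funext j x; exact curl_eq_curlCLM _ _
    have e2 : Literature.Analysis.FluidPDE.curl (W (-1)) = curlCLM ∘ fderiv ℝ (W (-1)) := by
      funext x; exact curl_eq_curlCLM _ _
    rw [e1, e2]
    exact curlCLM.uniformContinuous.comp_tendstoLocallyUniformly (htlufd (-1) (by norm_num))
  exact ⟨φ, W, hφ, hPW, hKW, fun t ht => htlu t ht, hcurl⟩

end H3proof

/-- **H3′ on this line (PROVED)** ⇐ H3″ (proved) — everything else BY NAME. -/
theorem stub_classCompactness : ClassCompactness :=
  classCompactness_of_peaklessClosed stub_peaklessClosed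

/-- **H3 ⇐ H3′ ∧ H1 (PROVED)**: apply class compactness to the re-pinned translates `v(·, · + y_k)` (pinned by `pinned_translate`, peakless by
`peakless_translate`, common hot value `N`), and rewrite the vorticity of a translate by H0. -/
theorem hullLimit_of_compactness (hCC : ClassCompactness) : HullLimit := by
  intro C v hP hK y hy
  obtain ⟨φ, U, hφ, hPU, hPkU, hconv, hcurl⟩ := hCC C (fun k t x => v t (x + y k)) (fun k => pinned_translate hP (hy k))
    (fun k => peakless_translate hK (y k))
    (fun k => by
      show v (-1) (0 + y k) 2 = v (-1) (0 + y 0) 2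
      rw [zero_add, zero_add, (hy k).2, (hy 0).2])
  refine ⟨φ, U, hφ, hPU, hPkU, fun t ht => hconv t ht, ?_⟩
  have e : (fun j => Literature.Analysis.FluidPDE.curl ((fun k t x => v t (x + y k)) (φ j) (-1))) =
      fun j x => Literature.Analysis.FluidPDE.curl (v (-1)) (x + y (φ j)) := by
    funext j x
    exact curl_translate_arg (v (-1)) (y (φ j)) x
  rw [e] at hcurl
  exact hcurl

/-- **H3 on this line (PROVED)** ⇐ H3′ ∧ H1. -/
theorem hullLimit_holds : HullLimit :=
  hullLimit_of_compactness stub_classCompactness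

/-! ### H4 — the NULL END leaves an UNBOUNDED NULL HOT CONTINUUM in the hull limit (`NullEndTopology`, PROVABLE, M/L: planar continuum theory) -/

/-- **H4 `NullEndTopology` (PROVABLE, M/L; LOAD-BEARING).**  Pure topology + the two convergences: if an injective hot curve `γ` escapes to
infinity along the end `l ∈ {+∞, −∞}` with `ω(−1, γ τ) → 0`, and the translates by `γ(τs k)` (`τs k → l`) converge locally uniformly (slice and
vorticity slice at `s = −1`) to `U(−1,·)`, `ω_U(−1,·)`, then `U` carries a CONNECTED UNBOUNDED set `L ∋ 0` of hot points of `U` on which `ω_U(−1,·)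
= 0`.  PROOF ROUTE OF RECORD (v1.5, critic idea-crit-7 g7 P2 — PARAMETER INTERVALS, no boundary bumping for mere connected sets, which would be
false for combs): `J_k^R :=` the connected component of `τs k` in the closed set `{σ : ‖γ σ − γ(τs k)‖ ≤ R}`; it is a compact interval with
`inf J_k^R → l` from the ESCAPE OF THE END ALONE (for `k` large `γ 0 ∉ closedBall (γ(τs k)) R` bounds `J_k^R` on the near side, and a bounded `inf`
along a subsequence would keep `γ(τs k)` bounded), hence `sup_{σ ∈ J_k^R} ‖ω(−1, γ σ)‖ → 0`; `A_k^R := γ(J_k^R) − γ(τs k)` is a CONTINUUM containing `0`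
and MEETING the sphere `‖x‖ = R` (it cannot stay inside the open ball: `J_k^R` would then be open-and-closed in a neighbourhood, contradicting
maximality — equivalently IVT on `σ ↦ ‖γ σ − γ(τs k)‖` up to the exit parameter); Blaschke sub-limits `L^R` in `NonemptyCompacts (closedBall 0 R)`
(Mathlib `CompactSpace (NonemptyCompacts _)`, `Mathlib.Topology.Sets.VietorisTopology`); «a Hausdorff limit of continua through the common point `0` is a
continuum through `0`» (Macías §1.8 [corpus:book:macias2018-topics-continua p.59], ≈ 100–150 lines to type, not in Mathlib); `L := ⋃_R L^R` is connected
through the common point `0` (NO nesting / diagonal needed: `U` is the limit of the FULL sequence) and unbounded since each `L^R` meets the `R`-sphere; hot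
and null by the two locally uniform convergences + continuity of the limits.  `Function.Injective γ` is NOT needed by this route (harmless; the kernel
supplies it from ESC-END).  Size M (300–450 lines, critic 06:29:30Z). -/
def NullEndTopology : Prop :=
  ∀ (v U : ℝ → EuclideanSpace ℝ (Fin 3) → EuclideanSpace ℝ (Fin 3)) (γ : ℝ → EuclideanSpace ℝ (Fin 3)) (τs : ℕ → ℝ) (l : Filter ℝ),
    (l = Filter.atTop ∨ l = Filter.atBot) →
    Continuous γ → Function.Injective γ → (∀ τ : ℝ, γ τ ∈ hotSet v) →
    Filter.Tendsto γ l (Filter.cocompact _) →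
    Filter.Tendsto (fun τ => Literature.Analysis.FluidPDE.curl (v (-1)) (γ τ)) l (nhds 0) →
    Filter.Tendsto τs Filter.atTop l →
    IsClosed (hotSet U) → Continuous (U (-1)) → Continuous (Literature.Analysis.FluidPDE.curl (U (-1))) →
    TendstoLocallyUniformly (fun k x => v (-1) (x + γ (τs k))) (U (-1)) Filter.atTop →
    TendstoLocallyUniformly (fun k x => Literature.Analysis.FluidPDE.curl (v (-1)) (x + γ (τs k)))
      (Literature.Analysis.FluidPDE.curl (U (-1))) Filter.atTop →
    ∃ L : Set (EuclideanSpace ℝ (Fin 3)), L ⊆ hotSet U ∧ (0 : EuclideanSpace ℝ (Fin 3)) ∈ L ∧ IsConnected L ∧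
      ¬ Bornology.IsBounded L ∧ ∀ x ∈ L, Literature.Analysis.FluidPDE.curl (U (-1)) x = 0

/-- **H4 BY NAME (v1.7)** — ns-k2-port-2 g4's p704094 `…Theorems.PoloidalWindowDoorPoloidalWindowRigidityHotHullNullEndTopology.nullEndTopology` (forward exit arcs +
Kuratowski upper limit of nested continua through `0`; `hotSet` δ-unfolded; critic BY-NAME READ ✓ 07:00:54Z). -/
theorem stub_nullEndTopology : NullEndTopology :=
  Summit.NavierStokesRegularity.NavierStokesRegularity.Theorems.PoloidalWindowDoorPoloidalWindowRigidityHotHullNullEndTopology.nullEndTopology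

/-! ### H5 — the PERSISTENT END: the forward translates of the leaf converge to the hot leaf of the hull limit (`LeafLimit`, PROVABLE, M: Grönwall) -/

/-- **H5 `LeafLimit` (PROVABLE, M; LOAD-BEARING).**  If the translates of `v(−1,·)` and `ω(−1,·)` by `γ(τs k)` converge locally uniformly to
`U(−1,·)`, `ω_U(−1,·)` (`ω_U(−1,·)` Lipschitz and bounded, `ω(−1,·)` bounded — tree `curl_slice_bounded_lipschitz`), then the re-based leaves
`σ ↦ γ(τs k + σ) − γ(τs k)` (integral curves of the translated vorticity through `0`) converge pointwise to THE integral curve `γ_U` of `ω_U(−1,·)`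
through `0`, which is global and runs inside `hotSet U` (limits of hot points; `U₂(−1,0) = N` from the convergence at `x = 0`).  Proof: the curves are
uniformly Lipschitz, stay in `closedBall 0 (B·S)` on `[−S, S]`, where the fields converge uniformly; Grönwall (Mathlib `dist_le_of_approx_trajectories_ODE`)
against the Lipschitz limit field. -/
def LeafLimit : Prop :=
  ∀ (v U : ℝ → EuclideanSpace ℝ (Fin 3) → EuclideanSpace ℝ (Fin 3)) (γ : ℝ → EuclideanSpace ℝ (Fin 3)) (τs : ℕ → ℝ),
    (∀ τ : ℝ, HasDerivAt γ (Literature.Analysis.FluidPDE.curl (v (-1)) (γ τ)) τ) → (∀ τ : ℝ, γ τ ∈ hotSet v) →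
    (∃ K : NNReal, LipschitzWith K (Literature.Analysis.FluidPDE.curl (U (-1)))) →
    (∃ B : ℝ, ∀ x, ‖Literature.Analysis.FluidPDE.curl (v (-1)) x‖ ≤ B) →
    (∃ B : ℝ, ∀ x, ‖Literature.Analysis.FluidPDE.curl (U (-1)) x‖ ≤ B) →
    IsClosed (hotSet U) → Continuous (U (-1)) →
    TendstoLocallyUniformly (fun k x => v (-1) (x + γ (τs k))) (U (-1)) Filter.atTop →
    TendstoLocallyUniformly (fun k x => Literature.Analysis.FluidPDE.curl (v (-1)) (x + γ (τs k)))
      (Literature.Analysis.FluidPDE.curl (U (-1))) Filter.atTop →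
    ∃ γU : ℝ → EuclideanSpace ℝ (Fin 3), γU 0 = 0 ∧
      (∀ σ : ℝ, HasDerivAt γU (Literature.Analysis.FluidPDE.curl (U (-1)) (γU σ)) σ) ∧ (∀ σ : ℝ, γU σ ∈ hotSet U) ∧
      ∀ σ : ℝ, Filter.Tendsto (fun k => γ (τs k + σ) - γ (τs k)) Filter.atTop (nhds (γU σ))

section H5proof
open Set Filter Topology

/-! #### H5 proof (v1.6): Grönwall comparison of re-based leaves with the limit leaf -/

/-- H5a. Forward Grönwall comparison of an exact integral curve `f` of a Lipschitz field `w` with an approximate one `g`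
from a common initial point (Mathlib `dist_le_of_approx_trajectories_ODE`). -/
theorem leafLimit_dist_fwd {w : EuclideanSpace ℝ (Fin 3) → EuclideanSpace ℝ (Fin 3)} {K : NNReal} (hK : LipschitzWith K w)
    {f g g' : ℝ → EuclideanSpace ℝ (Fin 3)} {S ε : ℝ}
    (hf : ∀ t, HasDerivAt f (w (f t)) t) (hg : ∀ t, HasDerivAt g (g' t) t) (h0 : f 0 = g 0)
    (hε : ∀ t ∈ Ico 0 S, dist (g' t) (w (g t)) ≤ ε) :
    ∀ t ∈ Icc 0 S, dist (f t) (g t) ≤ gronwallBound 0 K ε t := by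
  intro t ht
  have h := dist_le_of_approx_trajectories_ODE (v := fun _ => w) (K := K) (f := f) (g := g)
    (f' := fun t => w (f t)) (g' := g') (a := 0) (b := S) (εf := 0) (εg := ε) (δ := 0)
    (fun _ => hK) (fun t _ => (hf t).continuousAt.continuousWithinAt)
    (fun t _ => (hf t).hasDerivWithinAt) (fun t _ => by simp)
    (fun t _ => (hg t).continuousAt.continuousWithinAt) (fun t _ => (hg t).hasDerivWithinAt) hε
    (by rw [h0, dist_self]) t ht
  simpa using h

/-- H5b. A curve from `0` with speed `≤ B` stays in `closedBall 0 (B·t)`. -/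
theorem leafLimit_norm_le {g g' : ℝ → EuclideanSpace ℝ (Fin 3)} {B S : ℝ}
    (hg : ∀ t, HasDerivAt g (g' t) t) (h0 : g 0 = 0) (hB : ∀ t, ‖g' t‖ ≤ B) :
    ∀ t ∈ Icc 0 S, ‖g t‖ ≤ B * t := by
  intro t ht
  have h := norm_image_sub_le_of_norm_deriv_le_segment' (f := g) (f' := g') (a := 0) (b := S)
    (fun x _ => (hg x).hasDerivWithinAt) (fun x _ => hB x) t ht
  simpa [h0] using h

/-- H5c. The core convergence: re-based integral curves of the translated fields converge pointwise to the integral curve of the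
limit field through `0` (two-sided in the curve parameter, by time reversal). -/
theorem leafLimit_core {wv wU : EuclideanSpace ℝ (Fin 3) → EuclideanSpace ℝ (Fin 3)} {K : NNReal} (hK : LipschitzWith K wU)
    {Bv : ℝ} (hBv : ∀ x, ‖wv x‖ ≤ Bv) {γ : ℝ → EuclideanSpace ℝ (Fin 3)} {τs : ℕ → ℝ}
    (hγ' : ∀ τ, HasDerivAt γ (wv (γ τ)) τ)
    (hconv : TendstoLocallyUniformly (fun k x => wv (x + γ (τs k))) wU atTop)
    {γU : ℝ → EuclideanSpace ℝ (Fin 3)} (hγU0 : γU 0 = 0) (hγU' : ∀ σ, HasDerivAt γU (wU (γU σ)) σ) :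
    ∀ σ, Tendsto (fun k => γ (τs k + σ) - γ (τs k)) atTop (𝓝 (γU σ)) := by
  intro σ
  rw [Metric.tendsto_atTop]
  intro η hη
  -- the re-based leaves
  set β : ℕ → ℝ → EuclideanSpace ℝ (Fin 3) := fun k s => γ (τs k + s) - γ (τs k) with hβdef
  have hβ' : ∀ k s, HasDerivAt (β k) (wv (γ (τs k + s))) s := fun k s =>
    ((hγ' (τs k + s)).comp_const_add (τs k) s).sub_const _
  have hβ0 : ∀ k, β k 0 = 0 := fun k => by simp [β]
  have hβr' : ∀ k s, HasDerivAt (fun r => β k (-r)) (-wv (γ (τs k + -s))) s := fun k s => by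
    have h := (hβ' k (-s)).scomp s (hasDerivAt_neg s)
    simpa [Function.comp_def] using h
  have hBv0 : 0 ≤ Bv := (norm_nonneg _).trans (hBv 0)
  -- radius of a ball containing all re-based leaves on `[-S, S]`
  set S : ℝ := |σ| with hSdef
  have hS0 : 0 ≤ S := abs_nonneg σ
  set R : ℝ := Bv * S with hRdef
  have hballF : ∀ k, ∀ s ∈ Icc 0 S, β k s ∈ Metric.closedBall (0 : EuclideanSpace ℝ (Fin 3)) R := fun k s hs => by
    rw [mem_closedBall_zero_iff]
    exact (leafLimit_norm_le (S := S) (hβ' k) (hβ0 k) (fun t => hBv _) s hs).trans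
      (mul_le_mul_of_nonneg_left hs.2 hBv0)
  have hballB : ∀ k, ∀ s ∈ Icc 0 S, β k (-s) ∈ Metric.closedBall (0 : EuclideanSpace ℝ (Fin 3)) R := fun k s hs => by
    rw [mem_closedBall_zero_iff]
    have h := leafLimit_norm_le (S := S) (g := fun r => β k (-r)) (hβr' k) (by simp [hβ0]) (fun t => by
      rw [norm_neg]; exact hBv _) s hs
    exact h.trans (mul_le_mul_of_nonneg_left hs.2 hBv0)
  -- Grönwall tolerance
  obtain ⟨ε, hε, hεη⟩ : ∃ ε : ℝ, 0 < ε ∧ gronwallBound 0 K ε S < η := by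
    have ht : Tendsto (fun ε => gronwallBound 0 K ε S) (𝓝 0) (𝓝 0) := by
      simpa [gronwallBound_ε0_δ0] using (gronwallBound_continuous_ε 0 K S).tendsto 0
    have hev : ∀ᶠ ε in 𝓝 (0 : ℝ), gronwallBound 0 K ε S < η := ht (Iio_mem_nhds hη)
    obtain ⟨δ, hδ, hball⟩ := Metric.eventually_nhds_iff.mp hev
    refine ⟨δ / 2, by positivity, hball ?_⟩
    rw [Real.dist_eq, sub_zero, abs_of_pos (by positivity)]
    linarith
  -- uniform closeness of the fields on the ball, eventually
  have hU : TendstoUniformlyOn (fun k x => wv (x + γ (τs k))) wU atTop (Metric.closedBall 0 R) :=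
    (tendstoLocallyUniformly_iff_forall_isCompact.mp hconv) _ (isCompact_closedBall 0 R)
  obtain ⟨N, hN⟩ := eventually_atTop.mp (Metric.tendstoUniformlyOn_iff.mp hU ε hε)
  refine ⟨N, fun k hk => ?_⟩
  rw [dist_comm]
  rcases le_or_gt 0 σ with hσ | hσ
  · -- forward in the leaf parameter
    have hSσ : S = σ := abs_of_nonneg hσ
    have key := leafLimit_dist_fwd hK (f := γU) (g := β k) (g' := fun s => wv (γ (τs k + s))) (S := S) (ε := ε)
      hγU' (hβ' k) (by rw [hγU0, hβ0]) (fun s hs => by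
        have h := hN k hk (β k s) (hballF k s (Ico_subset_Icc_self hs))
        have e : β k s + γ (τs k) = γ (τs k + s) := by simp [β]
        rw [e] at h
        rw [dist_comm]; exact h.le) S ⟨hS0, le_rfl⟩
    rw [hSσ] at key hεη
    exact key.trans_lt hεη
  · -- backward in the leaf parameter: time reversal
    have hSσ : S = -σ := abs_of_neg hσ
    have hK' : LipschitzWith K (fun x => -wU x) :=
      LipschitzWith.of_dist_le_mul fun x y => by rw [dist_neg_neg]; exact hK.dist_le_mul x y
    have hf' : ∀ t, HasDerivAt (fun r => γU (-r)) (-wU (γU (-t))) t := fun t => by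
      have h := (hγU' (-t)).scomp t (hasDerivAt_neg t)
      simpa [Function.comp_def] using h
    have key := leafLimit_dist_fwd hK' (w := fun x => -wU x) (f := fun r => γU (-r)) (g := fun r => β k (-r))
      (g' := fun s => -wv (γ (τs k + -s))) (S := S) (ε := ε)
      hf' (hβr' k) (by simp [hγU0, hβ0]) (fun s hs => by
        have h := hN k hk (β k (-s)) (hballB k s (Ico_subset_Icc_self hs))
        have e : β k (-s) + γ (τs k) = γ (τs k + -s) := by simp [β]
        rw [e] at h
        rw [dist_neg_neg, dist_comm]; exact h.le) S ⟨hS0, le_rfl⟩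
    have e2 : -S = σ := by rw [hSσ, neg_neg]
    simp only [e2] at key
    exact key.trans_lt hεη

/-- **H5 `LeafLimit` PROVED (v1.6).** -/
theorem leafLimit_holds : LeafLimit := by
  intro v U γ τs hγ' hhot hK hBv hBU _hcl hUc hconv hcurlconv
  obtain ⟨K, hK⟩ := hK
  obtain ⟨Bv, hBv⟩ := hBv
  obtain ⟨BU, hBU⟩ := hBU
  obtain ⟨γU, hγU0, hγU'⟩ :=
    Literature.Analysis.ODE.exists_solution_real_of_lipschitz_of_bound hK hBU (0 : EuclideanSpace ℝ (Fin 3))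
  have hlim : ∀ σ, Tendsto (fun k => γ (τs k + σ) - γ (τs k)) atTop (𝓝 (γU σ)) :=
    leafLimit_core hK hBv hγ' hcurlconv hγU0 hγU'
  refine ⟨γU, hγU0, hγU', fun σ => ?_, hlim⟩
  have h2c : Continuous fun x : EuclideanSpace ℝ (Fin 3) => x 2 := by fun_prop
  have hc0 : ∀ k, (γ (τs k + σ) - γ (τs k)) 2 = 0 := fun k => by
    have a := (hhot (τs k + σ)).1
    have b := (hhot (τs k)).1
    simp [a, b]
  refine ⟨?_, ?_⟩
  · have t1 : Tendsto (fun k => (γ (τs k + σ) - γ (τs k)) 2) atTop (𝓝 ((γU σ) 2)) := (h2c.tendsto _).comp (hlim σ)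
    have t2 : Tendsto (fun k => (γ (τs k + σ) - γ (τs k)) 2) atTop (𝓝 0) := by
      simp_rw [hc0]; exact tendsto_const_nhds
    exact tendsto_nhds_unique t1 t2
  · have tσ : Tendsto (fun k => v (-1) ((γ (τs k + σ) - γ (τs k)) + γ (τs k))) atTop (𝓝 (U (-1) (γU σ))) :=
      hconv.tendsto_comp hUc.continuousAt (hlim σ)
    have t0 : Tendsto (fun k => v (-1) ((0 : EuclideanSpace ℝ (Fin 3)) + γ (τs k))) atTop (𝓝 (U (-1) 0)) :=
      hconv.tendsto_comp hUc.continuousAt tendsto_const_nhds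
    have e1 : ∀ k, v (-1) ((γ (τs k + σ) - γ (τs k)) + γ (τs k)) 2 = v (-1) 0 2 := fun k => by
      rw [sub_add_cancel]; exact (hhot _).2
    have e0 : ∀ k, v (-1) ((0 : EuclideanSpace ℝ (Fin 3)) + γ (τs k)) 2 = v (-1) 0 2 := fun k => by
      rw [zero_add]; exact (hhot _).2
    have l1 : (U (-1) (γU σ)) 2 = v (-1) 0 2 := by
      have A : Tendsto (fun k => v (-1) ((γ (τs k + σ) - γ (τs k)) + γ (τs k)) 2) atTop (𝓝 ((U (-1) (γU σ)) 2)) :=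
        (h2c.tendsto _).comp tσ
      have B : Tendsto (fun k => v (-1) ((γ (τs k + σ) - γ (τs k)) + γ (τs k)) 2) atTop (𝓝 (v (-1) 0 2)) := by
        simp_rw [e1]; exact tendsto_const_nhds
      exact tendsto_nhds_unique A B
    have l0 : (U (-1) 0) 2 = v (-1) 0 2 := by
      have A : Tendsto (fun k => v (-1) ((0 : EuclideanSpace ℝ (Fin 3)) + γ (τs k)) 2) atTop (𝓝 ((U (-1) 0) 2)) :=
        (h2c.tendsto _).comp t0
      have B : Tendsto (fun k => v (-1) ((0 : EuclideanSpace ℝ (Fin 3)) + γ (τs k)) 2) atTop (𝓝 (v (-1) 0 2)) := by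
        simp_rw [e0]; exact tendsto_const_nhds
      exact tendsto_nhds_unique A B
    show U (-1) (γU σ) 2 = U (-1) 0 2
    rw [l1, l0]

/-- **H5 on this line (v1.6)** — a TERM: `leafLimit_holds`. -/
theorem stub_leafLimit : LeafLimit := leafLimit_holds

end H5proof

/-! ### The two research cells of LINE 21 (OPEN): the null hot continuum (absorbing C2b′ and the null end of C2a′) and the persistent end -/

/-- **CELL NULL-CONTINUUM `CellNullContinuum` (OPEN, research) — ONE cell for the other residue C2b′ AND for the null escaping end of C2a′.**
Every binder of `stub_cellC2bRidge` except its last (all-null) one, the hot laws in hand (time pin R10, Laplacian sign R9, no-cycle F1a, separatrix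
F2 — all closed for every pinned peakless profile), then: a CONNECTED UNBOUNDED set `L ∋ 0` of hot points on which the vorticity vanishes.  In C2b′
`L` is the hot component of `0` (unbounded by tree `hotComponent_unbounded`); in C2a′'s null end it is the Hausdorff hull of the escaping end inside
the hull limit (H3 + H4).  Killing quantity missing (honest): the null hot continuum is a planar real-analytic continuum on which `v₂ = N`, `∇v₂ = 0`,
`ω = 0`, `∂ₜv₂ = N/2`, `N·Δ_h v₂ ≤ 0` — five scalar laws on a 1-dimensional unbounded set, none of them signed transversally. -/
def CellNullContinuum : Prop :=
  ∀ (C : ℝ) (v : ℝ → EuclideanSpace ℝ (Fin 3) → EuclideanSpace ℝ (Fin 3)) (W : Set (ℝ × EuclideanSpace ℝ (Fin 3))),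
    Pinned C v → ThickWindow v W → Peakless v →
    (∀ s < 0, ∀ y, ⟪fderiv ℝ (v s) y (Literature.Analysis.FluidPDE.curl (v s) y), EuclideanSpace.single 2 1⟫_ℝ = 0) →
    IsClosed (hotSet v) → (∀ y ∈ hotSet v, fderiv ℝ (fun x => v (-1) x 2) y = 0) →
    (∀ K O : Set (EuclideanSpace ℝ (Fin 3)), IsCompact K → K.Nonempty → K ⊆ hotSet v → IsOpen O → K ⊆ O →
      O ∩ hotSet v ⊆ K → False) →
    (∀ y ∈ hotSet v, ∀ r : ℝ, 0 < r →
      ∃ y' : EuclideanSpace ℝ (Fin 3), y' 2 = 0 ∧ dist y' y < r ∧ v (-1) y' 2 ≠ v (-1) 0 2) →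
    (∀ y ∈ hotSet v, deriv (fun s => v s y 2) (-1) = v (-1) 0 2 / 2) →
    (∀ y ∈ hotSet v, v (-1) 0 2 * lapH v y ≤ 0) →
    (∀ c : ℝ → EuclideanSpace ℝ (Fin 3), Continuous c → (∀ θ : ℝ, c (θ + 1) = c θ) → Set.InjOn c (Set.Ico 0 1) →
      (∀ θ : ℝ, c θ ∈ hotSet v) → False) →
    (∀ γ : ℝ → EuclideanSpace ℝ (Fin 3), (∀ τ : ℝ, HasDerivAt γ (Literature.Analysis.FluidPDE.curl (v (-1)) (γ τ)) τ) →
      ∀ q ∈ hotSet v, (MapClusterPt q Filter.atTop γ ∨ MapClusterPt q Filter.atBot γ) → ∀ τ : ℝ, γ τ ∈ hotSet v) →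
    ∀ L : Set (EuclideanSpace ℝ (Fin 3)), L ⊆ hotSet v → (0 : EuclideanSpace ℝ (Fin 3)) ∈ L → IsConnected L → ¬ Bornology.IsBounded L →
      (∀ y ∈ L, Literature.Analysis.FluidPDE.curl (v (-1)) y = 0) → False

/-- **stub NULL-CONTINUUM** (OPEN, research). -/
theorem stub_cellNullContinuum : CellNullContinuum := by
  sorry

/-- **CELL PERSISTENT-END `CellPersistentEnd` (OPEN, research).**  Every binder of `CellEscapingEnd` (the escaping end named by its filter
`l ∈ {atTop, atBot}`), then the END-VORTICITY PERSISTENCE `∃ᶠ τ → l, |ω(−1, γ τ)| ≥ δ > 0`, then THE HULL LIMIT IN HAND: a sequence `τs k → l` with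
`|ω(−1, γ(τs k))| ≥ δ`, a profile `U` — `Pinned C`, THICK (`ThickWindow U W'`, by H2 mod S0), `Peakless` — to which the translates of every slice and of
the vorticity slice converge locally uniformly, `|ω_U(−1,0)| ≥ δ` (so the pin of `U` is a REGULAR point of a complete hot leaf of `U`), and the hot leaf
`γ_U` of `U` through `0` as the pointwise limit of the re-based forward leaves `γ(τs k + σ) − γ(τs k)`.  Killing quantity missing (honest): `γ_U` is
"end-homogeneous" (a 2-sided limit of forward translates of ONE half-leaf) but no monotone or almost-periodic functional along hot leaves is known
(B-g9-4(iii), B-g10-2); the cell is the typed meeting point for such a functional, or for a second hull (iterate H3 inside `U`). -/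
def CellPersistentEnd : Prop :=
  ∀ (C : ℝ) (v : ℝ → EuclideanSpace ℝ (Fin 3) → EuclideanSpace ℝ (Fin 3)) (W : Set (ℝ × EuclideanSpace ℝ (Fin 3))),
    Pinned C v → ThickWindow v W → Peakless v →
    (∀ s < 0, ∀ y, ⟪fderiv ℝ (v s) y (Literature.Analysis.FluidPDE.curl (v s) y), EuclideanSpace.single 2 1⟫_ℝ = 0) →
    IsClosed (hotSet v) → (∀ y ∈ hotSet v, fderiv ℝ (fun x => v (-1) x 2) y = 0) →
    (∀ K O : Set (EuclideanSpace ℝ (Fin 3)), IsCompact K → K.Nonempty → K ⊆ hotSet v → IsOpen O → K ⊆ O →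
      O ∩ hotSet v ⊆ K → False) →
    (∀ y ∈ hotSet v, ∀ r : ℝ, 0 < r →
      ∃ y' : EuclideanSpace ℝ (Fin 3), y' 2 = 0 ∧ dist y' y < r ∧ v (-1) y' 2 ≠ v (-1) 0 2) →
    (∃ (γ : ℝ → EuclideanSpace ℝ (Fin 3)) (ε : ℝ), 0 < ε ∧ γ 0 ∈ hotSet v ∧
      Literature.Analysis.FluidPDE.curl (v (-1)) (γ 0) ≠ 0 ∧
      ∀ τ ∈ Set.Ioo (-ε) ε, HasDerivAt γ (Literature.Analysis.FluidPDE.curl (v (-1)) (γ τ)) τ ∧ γ τ ∈ hotSet v) →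
    (∀ y ∈ hotSet v, deriv (fun s => v s y 2) (-1) = v (-1) 0 2 / 2) →
    (∀ y ∈ hotSet v, v (-1) 0 2 * lapH v y ≤ 0) →
    (∀ c : ℝ → EuclideanSpace ℝ (Fin 3), Continuous c → (∀ θ : ℝ, c (θ + 1) = c θ) → Set.InjOn c (Set.Ico 0 1) →
      (∀ θ : ℝ, c θ ∈ hotSet v) → False) →
    (∀ γ : ℝ → EuclideanSpace ℝ (Fin 3), (∀ τ : ℝ, HasDerivAt γ (Literature.Analysis.FluidPDE.curl (v (-1)) (γ τ)) τ) →
      ∀ q ∈ hotSet v, (MapClusterPt q Filter.atTop γ ∨ MapClusterPt q Filter.atBot γ) → ∀ τ : ℝ, γ τ ∈ hotSet v) →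
    ∀ γ : ℝ → EuclideanSpace ℝ (Fin 3), γ 0 ∈ hotSet v → Literature.Analysis.FluidPDE.curl (v (-1)) (γ 0) ≠ 0 →
      (∀ τ : ℝ, HasDerivAt γ (Literature.Analysis.FluidPDE.curl (v (-1)) (γ τ)) τ) →
      (∀ τ : ℝ, γ τ ∈ hotSet v ∧ Literature.Analysis.FluidPDE.curl (v (-1)) (γ τ) ≠ 0 ∧
        lapH v (γ τ) * ‖Literature.Analysis.FluidPDE.curl (v (-1)) (γ 0)‖ ^ 2 = lapH v (γ 0) * ‖Literature.Analysis.FluidPDE.curl (v (-1)) (γ τ)‖ ^ 2) →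
      (lapH v (γ 0) ≠ 0 → ∀ τ : ℝ, curtain v (γ τ) = curtain v (γ 0)) → Function.Injective γ →
    ∀ l : Filter ℝ, (l = Filter.atTop ∨ l = Filter.atBot) → Filter.Tendsto γ l (Filter.cocompact _) →
    ∀ δ : ℝ, 0 < δ → (∃ᶠ τ in l, δ ≤ ‖Literature.Analysis.FluidPDE.curl (v (-1)) (γ τ)‖) →
    ∀ (τs : ℕ → ℝ) (U : ℝ → EuclideanSpace ℝ (Fin 3) → EuclideanSpace ℝ (Fin 3)) (W' : Set (ℝ × EuclideanSpace ℝ (Fin 3))),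
      Filter.Tendsto τs Filter.atTop l → (∀ k, δ ≤ ‖Literature.Analysis.FluidPDE.curl (v (-1)) (γ (τs k))‖) →
      Pinned C U → ThickWindow U W' → Peakless U →
      (∀ t < 0, TendstoLocallyUniformly (fun k x => v t (x + γ (τs k))) (U t) Filter.atTop) →
      TendstoLocallyUniformly (fun k x => Literature.Analysis.FluidPDE.curl (v (-1)) (x + γ (τs k)))
        (Literature.Analysis.FluidPDE.curl (U (-1))) Filter.atTop →
      δ ≤ ‖Literature.Analysis.FluidPDE.curl (U (-1)) 0‖ →
    ∀ γU : ℝ → EuclideanSpace ℝ (Fin 3), γU 0 = 0 →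
      (∀ σ : ℝ, HasDerivAt γU (Literature.Analysis.FluidPDE.curl (U (-1)) (γU σ)) σ) → (∀ σ : ℝ, γU σ ∈ hotSet U) →
      (∀ σ : ℝ, Filter.Tendsto (fun k => γ (τs k + σ) - γ (τs k)) Filter.atTop (nhds (γU σ))) →
    False

/-! ### v1.5 — PERSISTENT-END is CUT AGAIN by the liminf of the end vorticity: the uniformly persistent end is made RECURRENT (Birkhoff), the rest is OSCILLATING -/

/-- **H6 `LeafRecurrence` (PROVABLE, L; support — BIRKHOFF RECURRENCE IN THE HOT HULL).**  Let `v` be pinned and peakless and let `γ` be a complete hot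
leaf escaping at the end `l ∈ {atTop, atBot}` with END VORTICITY EVENTUALLY `≥ δ > 0` (the UNIFORMLY persistent end).  The SLIDING HULL of the end —
all locally uniform limits `U` of translates `v(·, · + γ(τₖ))`, `τₖ → l`, each carrying (H5) the limit leaf `γ_U` through `0` with `|ω_U| ≥ δ` along ALL of
it (two-sided, because `τₖ + σ → l` for every fixed `σ`) — is COMPACT in the locally uniform topology (H3 = KNSS Type-I compactness, PROVED on this line),
metrisable, and INVARIANT under the SLIDING FLOW `Φ_σ U := U(·, · + γ_U(σ))` (the leaf of the translate is the translated leaf, ODE uniqueness for the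
Lipschitz slice `ω_U(−1,·)`; `Φ` is continuous by the Grönwall leaf-limit lemma of H5, stated for hull members).  Bhatia–Szegö Thm 2.9.1 (every compact
invariant set contains a MINIMAL set, Zorn) + BIRKHOFF's Thm 2.9.7 (every trajectory in a compact minimal set is RECURRENT) + Thm 2.9.11 (recurrent ⟺
return times RELATIVELY DENSE) [corpus:book:bhatia1967-dynamical-systems-stability-theory-applications p.99, p.100, p.101] give a hull member `U` — still
a hull limit of `v` along some `τs → l` by a diagonal argument, pinned (the pins re-derive at the asymptotically hot centre, as in `pinned_translate`),
peakless (`peaklessClosed_holds`) — whose leaf `γ_U` through `0` is RECURRENT IN BOTH DIRECTIONS with SYNDETIC returns: `Φ_{σₖ} U → U` along some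
`σₖ → +∞` and some `σₖ' → −∞` (slices, vorticity slice, re-based leaves), and for every basic neighbourhood (`ε`, `R`) a return length `L(ε,R)`.
Not in Mathlib (`omegaLimit` and `Flow` exist in `Mathlib.Dynamics`, minimal sets only for group actions `MulAction.IsMinimal`; no Birkhoff recurrence
theorem): the hand builds the hull as a closed subset of `C((−∞,0) × ℝ³)` with the compact-open topology (`ContinuousMap.compactOpen`, locally uniform =
compact-open on a locally compact domain), runs Zorn on closed `Φ`-invariant subsets, and reads recurrence off minimality.  Why it might fail: only in
the bookkeeping (the flow property and the continuity of `U ↦ γ_U` on the hull need the H5 lemma for limits of hull MEMBERS, a generic Grönwall statement). -/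
def LeafRecurrence : Prop :=
  ∀ (C : ℝ) (v : ℝ → EuclideanSpace ℝ (Fin 3) → EuclideanSpace ℝ (Fin 3)) (γ : ℝ → EuclideanSpace ℝ (Fin 3)) (l : Filter ℝ) (δ : ℝ),
    Pinned C v → Peakless v →
    (∀ τ : ℝ, HasDerivAt γ (Literature.Analysis.FluidPDE.curl (v (-1)) (γ τ)) τ) → (∀ τ : ℝ, γ τ ∈ hotSet v) →
    (l = Filter.atTop ∨ l = Filter.atBot) → Filter.Tendsto γ l (Filter.cocompact _) →
    0 < δ → (∀ᶠ τ in l, δ ≤ ‖Literature.Analysis.FluidPDE.curl (v (-1)) (γ τ)‖) →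
    ∃ (U : ℝ → EuclideanSpace ℝ (Fin 3) → EuclideanSpace ℝ (Fin 3)) (γU : ℝ → EuclideanSpace ℝ (Fin 3)) (τs : ℕ → ℝ),
      Filter.Tendsto τs Filter.atTop l ∧ Pinned C U ∧ Peakless U ∧
      (∀ t < 0, TendstoLocallyUniformly (fun k x => v t (x + γ (τs k))) (U t) Filter.atTop) ∧
      TendstoLocallyUniformly (fun k x => Literature.Analysis.FluidPDE.curl (v (-1)) (x + γ (τs k)))
        (Literature.Analysis.FluidPDE.curl (U (-1))) Filter.atTop ∧
      γU 0 = 0 ∧ (∀ σ : ℝ, HasDerivAt γU (Literature.Analysis.FluidPDE.curl (U (-1)) (γU σ)) σ) ∧ (∀ σ : ℝ, γU σ ∈ hotSet U) ∧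
      (∀ σ : ℝ, δ ≤ ‖Literature.Analysis.FluidPDE.curl (U (-1)) (γU σ)‖) ∧
      (∃ σs : ℕ → ℝ, Filter.Tendsto σs Filter.atTop Filter.atTop ∧
        (∀ t < 0, TendstoLocallyUniformly (fun k x => U t (x + γU (σs k))) (U t) Filter.atTop) ∧
        TendstoLocallyUniformly (fun k x => Literature.Analysis.FluidPDE.curl (U (-1)) (x + γU (σs k)))
          (Literature.Analysis.FluidPDE.curl (U (-1))) Filter.atTop ∧
        (∀ σ : ℝ, Filter.Tendsto (fun k => γU (σs k + σ) - γU (σs k)) Filter.atTop (nhds (γU σ)))) ∧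
      (∃ σs : ℕ → ℝ, Filter.Tendsto σs Filter.atTop Filter.atBot ∧
        (∀ t < 0, TendstoLocallyUniformly (fun k x => U t (x + γU (σs k))) (U t) Filter.atTop) ∧
        TendstoLocallyUniformly (fun k x => Literature.Analysis.FluidPDE.curl (U (-1)) (x + γU (σs k)))
          (Literature.Analysis.FluidPDE.curl (U (-1))) Filter.atTop ∧
        (∀ σ : ℝ, Filter.Tendsto (fun k => γU (σs k + σ) - γU (σs k)) Filter.atTop (nhds (γU σ)))) ∧
      (∀ ε : ℝ, 0 < ε → ∀ R : ℝ, 0 < R → ∃ L : ℝ, 0 < L ∧ ∀ a : ℝ, ∃ σ ∈ Set.Icc a (a + L),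
        ∀ t ∈ Set.Icc (-R) (-R⁻¹), ∀ x ∈ Metric.closedBall (0 : EuclideanSpace ℝ (Fin 3)) R,
          dist (U t (x + γU σ)) (U t x) ≤ ε)

/-- **stub H6** — v1.9: PROVED BY NAME, K2-p2 g14's landed p708183
`…Theorems.PoloidalWindowDoorPoloidalWindowRigidityHotHullLeafRecurrence.leafRecurrence` (statement VERBATIM, `Pinned`/`Peakless`/`hotSet` unfolded; on S5 p707889
`…HotHullRecurrence` + S6a p707855 `…HotHullSlidingHull`; idea-crit-7 g8 kernel conform-read 08:16:30Z). -/
theorem stub_leafRecurrence : LeafRecurrence :=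
  Summit.NavierStokesRegularity.NavierStokesRegularity.Theorems.PoloidalWindowDoorPoloidalWindowRigidityHotHullLeafRecurrence.leafRecurrence

/-- **CELL RECURRENT-LEAF `CellRecurrentLeaf` (OPEN, research) — the uniformly persistent escaping end after BIRKHOFF.**  A pinned THICK peakless profile
`U` with its hot laws in hand (frozen vorticity, closed critical hot set, R3, R4, time pin R10, Laplacian sign R9, no hot cycle F1a, separatrix F2), a
COMPLETE HOT LEAF `γU` through the pin `0` with `|ω_U(−1, γU σ)| ≥ δ > 0` for ALL `σ ∈ ℝ` (hence — derivable, not supplied — `γU` is injective by F1a and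
ESCAPING AT BOTH ENDS by R19, and the ridge / curtain laws R8/R11/R16 hold along it by name), which is RECURRENT IN BOTH DIRECTIONS UNDER SLIDING: the
re-centred profiles `U(·, · + γU(σₖ))` converge back to `U` locally uniformly (all slices, the vorticity slice, the re-based leaves) along some `σₖ → +∞`
AND along some `σₖ' → −∞`, with SYNDETIC return times (for every `ε, R` a length `L` such that every leaf-time window of length `L` contains an
`(ε,R)`-return).  So the THICK world's last escaping configuration is an ALMOST-PERIODIC VORTEX LEAF: an unbounded injective planar curve along which the
whole Type-I ancient profile repeats itself up to `ε` within bounded leaf-time, carrying `v₂ = N`, `∇v₂ = 0`, `∂ₜv₂ = N/2`, `N·Δₕv₂ ≤ 0` and the two leaf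
invariants.  Killing quantity missing (honest; B-g9-4(iii), B-g10-2): recurrence converts ANY leaf-monotone functional into a leaf-CONSTANT one — the cell
is the typed meeting point for such a functional (none is known), or for a Liouville theorem for Type-I ancient solutions that are recurrent along an
unbounded curve of non-decay (`|U₂(−1, γU σ)| = |N|` for all `σ`, `|γU σ| → ∞`). -/
def CellRecurrentLeaf : Prop :=
  ∀ (C : ℝ) (U : ℝ → EuclideanSpace ℝ (Fin 3) → EuclideanSpace ℝ (Fin 3)) (W : Set (ℝ × EuclideanSpace ℝ (Fin 3))),
    Pinned C U → ThickWindow U W → Peakless U →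
    (∀ s < 0, ∀ y, ⟪fderiv ℝ (U s) y (Literature.Analysis.FluidPDE.curl (U s) y), EuclideanSpace.single 2 1⟫_ℝ = 0) →
    IsClosed (hotSet U) → (∀ y ∈ hotSet U, fderiv ℝ (fun x => U (-1) x 2) y = 0) →
    (∀ K O : Set (EuclideanSpace ℝ (Fin 3)), IsCompact K → K.Nonempty → K ⊆ hotSet U → IsOpen O → K ⊆ O →
      O ∩ hotSet U ⊆ K → False) →
    (∀ y ∈ hotSet U, ∀ r : ℝ, 0 < r →
      ∃ y' : EuclideanSpace ℝ (Fin 3), y' 2 = 0 ∧ dist y' y < r ∧ U (-1) y' 2 ≠ U (-1) 0 2) →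
    (∀ y ∈ hotSet U, deriv (fun s => U s y 2) (-1) = U (-1) 0 2 / 2) →
    (∀ y ∈ hotSet U, U (-1) 0 2 * lapH U y ≤ 0) →
    (∀ c : ℝ → EuclideanSpace ℝ (Fin 3), Continuous c → (∀ θ : ℝ, c (θ + 1) = c θ) → Set.InjOn c (Set.Ico 0 1) →
      (∀ θ : ℝ, c θ ∈ hotSet U) → False) →
    (∀ γ : ℝ → EuclideanSpace ℝ (Fin 3), (∀ τ : ℝ, HasDerivAt γ (Literature.Analysis.FluidPDE.curl (U (-1)) (γ τ)) τ) →
      ∀ q ∈ hotSet U, (MapClusterPt q Filter.atTop γ ∨ MapClusterPt q Filter.atBot γ) → ∀ τ : ℝ, γ τ ∈ hotSet U) →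
    ∀ (γU : ℝ → EuclideanSpace ℝ (Fin 3)) (δ : ℝ), γU 0 = 0 →
      (∀ σ : ℝ, HasDerivAt γU (Literature.Analysis.FluidPDE.curl (U (-1)) (γU σ)) σ) → (∀ σ : ℝ, γU σ ∈ hotSet U) →
      0 < δ → (∀ σ : ℝ, δ ≤ ‖Literature.Analysis.FluidPDE.curl (U (-1)) (γU σ)‖) →
      (∃ σs : ℕ → ℝ, Filter.Tendsto σs Filter.atTop Filter.atTop ∧
        (∀ t < 0, TendstoLocallyUniformly (fun k x => U t (x + γU (σs k))) (U t) Filter.atTop) ∧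
        TendstoLocallyUniformly (fun k x => Literature.Analysis.FluidPDE.curl (U (-1)) (x + γU (σs k)))
          (Literature.Analysis.FluidPDE.curl (U (-1))) Filter.atTop ∧
        (∀ σ : ℝ, Filter.Tendsto (fun k => γU (σs k + σ) - γU (σs k)) Filter.atTop (nhds (γU σ)))) →
      (∃ σs : ℕ → ℝ, Filter.Tendsto σs Filter.atTop Filter.atBot ∧
        (∀ t < 0, TendstoLocallyUniformly (fun k x => U t (x + γU (σs k))) (U t) Filter.atTop) ∧
        TendstoLocallyUniformly (fun k x => Literature.Analysis.FluidPDE.curl (U (-1)) (x + γU (σs k)))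
          (Literature.Analysis.FluidPDE.curl (U (-1))) Filter.atTop ∧
        (∀ σ : ℝ, Filter.Tendsto (fun k => γU (σs k + σ) - γU (σs k)) Filter.atTop (nhds (γU σ)))) →
      (∀ ε : ℝ, 0 < ε → ∀ R : ℝ, 0 < R → ∃ L : ℝ, 0 < L ∧ ∀ a : ℝ, ∃ σ ∈ Set.Icc a (a + L),
        ∀ t ∈ Set.Icc (-R) (-R⁻¹), ∀ x ∈ Metric.closedBall (0 : EuclideanSpace ℝ (Fin 3)) R,
          dist (U t (x + γU σ)) (U t x) ≤ ε) →
    False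

/-- **stub RECURRENT-LEAF** (OPEN, research). -/
theorem stub_cellRecurrentLeaf : CellRecurrentLeaf := by
  sorry

/-- **CELL OSCILLATING-END `CellOscillatingEnd` (OPEN, research) — PERSISTENT-END minus its uniformly persistent part.**  Every binder of
`CellPersistentEnd` VERBATIM (the escaping end `l`, `∃ᶠ τ → l, |ω(−1,γ τ)| ≥ δ`, the hull limit `U` at persistent times with its leaf `γ_U` through `0`),
plus ONE more hypothesis: the end vorticity has `liminf = 0` — `∀ η > 0, ∃ᶠ τ → l, |ω(−1, γ τ)| < η`.  So along the SAME escaping leaf the vorticity both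
returns above `δ` and dips below every `η` infinitely often: the hull at the dips is the NULL world (`ω_{U'}(0) = 0` on an unbounded hot continuum through
`0` which is NOT null — mixed), the hull at the peaks is `U` above.  Killing quantity missing (honest): an oscillation count / a zero of `σ ↦ |ω(γ σ)|`-type
functional along the leaf is point-local in `σ` but not signed (B-g10-1 hot-web counting is the nearest dead relative); the cell is the typed meeting point
for a quantity that is monotone between a dip and the next peak. -/
def CellOscillatingEnd : Prop :=
  ∀ (C : ℝ) (v : ℝ → EuclideanSpace ℝ (Fin 3) → EuclideanSpace ℝ (Fin 3)) (W : Set (ℝ × EuclideanSpace ℝ (Fin 3))),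
    Pinned C v → ThickWindow v W → Peakless v →
    (∀ s < 0, ∀ y, ⟪fderiv ℝ (v s) y (Literature.Analysis.FluidPDE.curl (v s) y), EuclideanSpace.single 2 1⟫_ℝ = 0) →
    IsClosed (hotSet v) → (∀ y ∈ hotSet v, fderiv ℝ (fun x => v (-1) x 2) y = 0) →
    (∀ K O : Set (EuclideanSpace ℝ (Fin 3)), IsCompact K → K.Nonempty → K ⊆ hotSet v → IsOpen O → K ⊆ O →
      O ∩ hotSet v ⊆ K → False) →
    (∀ y ∈ hotSet v, ∀ r : ℝ, 0 < r →
      ∃ y' : EuclideanSpace ℝ (Fin 3), y' 2 = 0 ∧ dist y' y < r ∧ v (-1) y' 2 ≠ v (-1) 0 2) →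
    (∃ (γ : ℝ → EuclideanSpace ℝ (Fin 3)) (ε : ℝ), 0 < ε ∧ γ 0 ∈ hotSet v ∧
      Literature.Analysis.FluidPDE.curl (v (-1)) (γ 0) ≠ 0 ∧
      ∀ τ ∈ Set.Ioo (-ε) ε, HasDerivAt γ (Literature.Analysis.FluidPDE.curl (v (-1)) (γ τ)) τ ∧ γ τ ∈ hotSet v) →
    (∀ y ∈ hotSet v, deriv (fun s => v s y 2) (-1) = v (-1) 0 2 / 2) →
    (∀ y ∈ hotSet v, v (-1) 0 2 * lapH v y ≤ 0) →
    (∀ c : ℝ → EuclideanSpace ℝ (Fin 3), Continuous c → (∀ θ : ℝ, c (θ + 1) = c θ) → Set.InjOn c (Set.Ico 0 1) →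
      (∀ θ : ℝ, c θ ∈ hotSet v) → False) →
    (∀ γ : ℝ → EuclideanSpace ℝ (Fin 3), (∀ τ : ℝ, HasDerivAt γ (Literature.Analysis.FluidPDE.curl (v (-1)) (γ τ)) τ) →
      ∀ q ∈ hotSet v, (MapClusterPt q Filter.atTop γ ∨ MapClusterPt q Filter.atBot γ) → ∀ τ : ℝ, γ τ ∈ hotSet v) →
    ∀ γ : ℝ → EuclideanSpace ℝ (Fin 3), γ 0 ∈ hotSet v → Literature.Analysis.FluidPDE.curl (v (-1)) (γ 0) ≠ 0 →
      (∀ τ : ℝ, HasDerivAt γ (Literature.Analysis.FluidPDE.curl (v (-1)) (γ τ)) τ) →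
      (∀ τ : ℝ, γ τ ∈ hotSet v ∧ Literature.Analysis.FluidPDE.curl (v (-1)) (γ τ) ≠ 0 ∧
        lapH v (γ τ) * ‖Literature.Analysis.FluidPDE.curl (v (-1)) (γ 0)‖ ^ 2 = lapH v (γ 0) * ‖Literature.Analysis.FluidPDE.curl (v (-1)) (γ τ)‖ ^ 2) →
      (lapH v (γ 0) ≠ 0 → ∀ τ : ℝ, curtain v (γ τ) = curtain v (γ 0)) → Function.Injective γ →
    ∀ l : Filter ℝ, (l = Filter.atTop ∨ l = Filter.atBot) → Filter.Tendsto γ l (Filter.cocompact _) →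
    ∀ δ : ℝ, 0 < δ → (∃ᶠ τ in l, δ ≤ ‖Literature.Analysis.FluidPDE.curl (v (-1)) (γ τ)‖) →
    (∀ η : ℝ, 0 < η → ∃ᶠ τ in l, ‖Literature.Analysis.FluidPDE.curl (v (-1)) (γ τ)‖ < η) →
    ∀ (τs : ℕ → ℝ) (U : ℝ → EuclideanSpace ℝ (Fin 3) → EuclideanSpace ℝ (Fin 3)) (W' : Set (ℝ × EuclideanSpace ℝ (Fin 3))),
      Filter.Tendsto τs Filter.atTop l → (∀ k, δ ≤ ‖Literature.Analysis.FluidPDE.curl (v (-1)) (γ (τs k))‖) →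
      Pinned C U → ThickWindow U W' → Peakless U →
      (∀ t < 0, TendstoLocallyUniformly (fun k x => v t (x + γ (τs k))) (U t) Filter.atTop) →
      TendstoLocallyUniformly (fun k x => Literature.Analysis.FluidPDE.curl (v (-1)) (x + γ (τs k)))
        (Literature.Analysis.FluidPDE.curl (U (-1))) Filter.atTop →
      δ ≤ ‖Literature.Analysis.FluidPDE.curl (U (-1)) 0‖ →
    ∀ γU : ℝ → EuclideanSpace ℝ (Fin 3), γU 0 = 0 →
      (∀ σ : ℝ, HasDerivAt γU (Literature.Analysis.FluidPDE.curl (U (-1)) (γU σ)) σ) → (∀ σ : ℝ, γU σ ∈ hotSet U) →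
      (∀ σ : ℝ, Filter.Tendsto (fun k => γ (τs k + σ) - γ (τs k)) Filter.atTop (nhds (γU σ))) →
    False

/-- **stub OSCILLATING-END** (OPEN, research). -/
theorem stub_cellOscillatingEnd : CellOscillatingEnd := by
  sorry

/-! ### Kernel: ESC-END ⇐ ThickDense(THGerm) ∧ H3 ∧ H4 ∧ H5 ∧ R9 ∧ R10 ∧ F1a ∧ F2 ∧ NULL-CONTINUUM ∧ PERSISTENT-END (checked, no sorry) -/

/-- The laws every pinned THICK peakless profile carries, BY NAME from the tree: frozen (`…FirstIntegral.stub_firstIntegral`), closed + critical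
(`…HotSplitRidgeReductions.hotSetClosedCritical`), R3 (`noCompactIsolatedHotPiece`), R4 (`hotSetNoInterior`, the hot set not being the whole plane by
cells A1 `…HotPlaneConst.stub_hotPlaneConst` + C1 `…ZeroModeNoHotPlane.hotSplit_cellC1`, which consume the thick window). -/
theorem limit_laws {C : ℝ} {U : ℝ → EuclideanSpace ℝ (Fin 3) → EuclideanSpace ℝ (Fin 3)} {W' : Set (ℝ × EuclideanSpace ℝ (Fin 3))}
    (hPU : Pinned C U) (hTW : ThickWindow U W') (hPkU : Peakless U) :
    (∀ s < 0, ∀ y, ⟪fderiv ℝ (U s) y (Literature.Analysis.FluidPDE.curl (U s) y), EuclideanSpace.single 2 1⟫_ℝ = 0) ∧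
    IsClosed (hotSet U) ∧ (∀ y ∈ hotSet U, fderiv ℝ (fun x => U (-1) x 2) y = 0) ∧
    (∀ K O : Set (EuclideanSpace ℝ (Fin 3)), IsCompact K → K.Nonempty → K ⊆ hotSet U → IsOpen O → K ⊆ O →
      O ∩ hotSet U ⊆ K → False) ∧
    (∀ y ∈ hotSet U, ∀ r : ℝ, 0 < r →
      ∃ y' : EuclideanSpace ℝ (Fin 3), y' 2 = 0 ∧ dist y' y < r ∧ U (-1) y' 2 ≠ U (-1) 0 2) := by
  have hPU' := hPU
  obtain ⟨hrate, hcont, hmild, hdiv, hpol, -, -, -, -⟩ := hPU'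
  -- the hot set of `U` is not the whole plane: cells A1 (`…HotPlaneConst.stub_hotPlaneConst`) and C1 (`…ZeroModeNoHotPlane.hotSplit_cellC1`) BY NAME
  have hnon : ∃ y : EuclideanSpace ℝ (Fin 3), y 2 = 0 ∧ U (-1) y 2 ≠ U (-1) 0 2 := by
    by_contra hcon
    push Not at hcon
    exact PoloidalWindowDoorPoloidalWindowRigidityZeroModeNoHotPlane.hotSplit_cellC1 C U W' hPU hTW hPkU
      (PoloidalWindowDoorPoloidalWindowRigidityHotPlaneConst.stub_hotPlaneConst C U hPU hcon)
  exact ⟨PoloidalWindowDoorPoloidalWindowRigidityFirstIntegral.stub_firstIntegral C U hrate hcont hmild hdiv (EuclideanSpace.single 2 1) hpol,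
    (PoloidalWindowDoorPoloidalWindowRigidityHotSplitRidgeReductions.hotSetClosedCritical C U hPU).1,
    (PoloidalWindowDoorPoloidalWindowRigidityHotSplitRidgeReductions.hotSetClosedCritical C U hPU).2,
    PoloidalWindowDoorPoloidalWindowRigidityHotSplitRidgeReductions.noCompactIsolatedHotPiece C U hPU hPkU,
    PoloidalWindowDoorPoloidalWindowRigidityHotSplitRidgeReductions.hotSetNoInterior C U hPU hnon⟩

/-- Slice regularity in hand, BY NAME (tree `slice_facts`, `curl_slice_bounded_lipschitz`). -/
theorem slice_regularity {C : ℝ} {U : ℝ → EuclideanSpace ℝ (Fin 3) → EuclideanSpace ℝ (Fin 3)} (hPU : Pinned C U) :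
    Continuous (U (-1)) ∧ (∃ K : NNReal, LipschitzWith K (Literature.Analysis.FluidPDE.curl (U (-1)))) ∧
      (∃ B : ℝ, ∀ x, ‖Literature.Analysis.FluidPDE.curl (U (-1)) x‖ ≤ B) := by
  have hPU' := hPU
  obtain ⟨hrate, hcont, hmild, hdiv, -, -, -, -, -⟩ := hPU'
  obtain ⟨K, B, hK, hB⟩ := PoloidalWindowDoorPoloidalWindowRigidityLeafUniformVortexLine.curl_slice_bounded_lipschitz hrate hcont hmild hdiv
    (show (-1 : ℝ) < 0 by norm_num)
  exact ⟨(PoloidalWindowDoorPoloidalWindowRigidityHotSplitRidgeReductions.slice_facts hPU).2.1.continuous, ⟨K, hK⟩, ⟨B, hB⟩⟩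

/-- **KERNEL `cellPersistentEnd_of_recurrence` (v1.5, checked).**  The persistent end `l` is cut by the LIMINF of the end vorticity: if it is eventually
`≥ δ' > 0` (UNIFORMLY persistent), H6 (Birkhoff recurrence in the compact sliding hull) hands a recurrent hull member `U₁` with its two-sided persistent
recurrent leaf; `U₁` is pinned and peakless (H6), THICK by H2 mod THGerm, and carries the hot laws by name (`limit_laws`, R9, R10, F1a, F2) ⇒
RECURRENT-LEAF.  Otherwise `liminf = 0` (`Filter.not_frequently`) ⇒ OSCILLATING-END with every binder passed through. -/
theorem cellPersistentEnd_of_recurrence (hTD : ThickDense) (hTH : THGerm) (hRec : LeafRecurrence) (hR9 : HotLapSign) (hR10 : HotTimePin)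
    (hF1a : NoHotCycle) (hF2 : HotSeparatrix) (hRL : CellRecurrentLeaf) (hOsc : CellOscillatingEnd) : CellPersistentEnd := by
  intro C v W hP hT hK hFL hcl hcrit hR3 hR4 harc hpin hlap hcyc hsep γ hγ0 hω0 hγ' hridge hcurt hinj l hl hesc δ hδ hfr
    τs U W' hτs hbig hPU hTW' hPkU hconv hcurlconv hδU γU hγU0 hγU' hγUH hγUlim
  by_cases hunif : ∃ δ' : ℝ, 0 < δ' ∧ ∀ᶠ τ in l, δ' ≤ ‖Literature.Analysis.FluidPDE.curl (v (-1)) (γ τ)‖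
  · -- the UNIFORMLY persistent end: Birkhoff recurrence (H6)
    obtain ⟨δ', hδ', hev⟩ := hunif
    have hhot : ∀ τ : ℝ, γ τ ∈ hotSet v := fun τ => (hridge τ).1
    obtain ⟨U₁, γ₁, τs₁, -, hPU₁, hPkU₁, -, -, hγ₁0, hγ₁', hγ₁H, hγ₁δ, hfwd, hbwd, hsynd⟩ :=
      hRec C v γ l δ' hP hK hγ' hhot hl hesc hδ' hev
    obtain ⟨W₁, hTW₁⟩ := thickWindow_of_dense hTD hTH hPU₁
    obtain ⟨hFLU, hclU, hcritU, hR3U, hR4U⟩ := limit_laws hPU₁ hTW₁ hPkU₁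
    exact hRL C U₁ W₁ hPU₁ hTW₁ hPkU₁ hFLU hclU hcritU hR3U hR4U (hR10 C U₁ hPU₁) (hR9 C U₁ hPU₁) (hF1a C U₁ hPU₁ hPkU₁ hR4U)
      (hF2 C U₁ hPU₁ hFLU) γ₁ δ' hγ₁0 hγ₁' hγ₁H hδ' hγ₁δ hfwd hbwd hsynd
  · -- the OSCILLATING end: liminf of the end vorticity is 0
    have hosc : ∀ η : ℝ, 0 < η → ∃ᶠ τ in l, ‖Literature.Analysis.FluidPDE.curl (v (-1)) (γ τ)‖ < η := by
      intro η hη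
      by_contra hcon
      rw [Filter.not_frequently] at hcon
      exact hunif ⟨η, hη, hcon.mono fun τ hτ => not_lt.mp hτ⟩
    exact hOsc C v W hP hT hK hFL hcl hcrit hR3 hR4 harc hpin hlap hcyc hsep γ hγ0 hω0 hγ' hridge hcurt hinj l hl hesc δ hδ hfr hosc
      τs U W' hτs hbig hPU hTW' hPkU hconv hcurlconv hδU γU hγU0 hγU' hγUH hγUlim

/-- **PERSISTENT-END on this line (v1.5)** ⇐ the recurrence kernel with H2 (THGerm from S0), H6, R9, R10, F1a, F2 and the two new cells — a TERM. -/
theorem stub_cellPersistentEnd : CellPersistentEnd :=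
  cellPersistentEnd_of_recurrence thickDense_holds thGerm_holds stub_leafRecurrence stub_hotLapSign stub_hotTimePin stub_noHotCycle
    stub_hotSeparatrix stub_cellRecurrentLeaf stub_cellOscillatingEnd

/-- **KERNEL `cellEscapingEnd_of_hull` (checked).**  The escaping end `l` of the hot leaf is cut by the behaviour of `|ω(−1,·)|` along it.
NULL (`→ 0`): a sequence `τs → l` (countably generated filter), H3 along the hot points `γ(τs k)` ⇒ hull limit `U` (pinned, peakless; THICK by H2 mod
THGerm), H4 ⇒ an unbounded null hot continuum through `0` in `U` ⇒ NULL-CONTINUUM applied to `U` (its laws by name: `limit_laws`, R9, R10, F1a, F2).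
PERSISTENT (`¬ → 0` ⇒ `∃ δ > 0, ∃ᶠ τ → l, |ω| ≥ δ`, Mathlib `exists_seq_forall_of_frequently`): H3 along such a sequence ⇒ `U` with `|ω_U(−1,0)| ≥ δ`
(pointwise limit), H5 ⇒ the limit leaf, H2 ⇒ a thick window of `U` ⇒ PERSISTENT-END. -/
theorem cellEscapingEnd_of_hull (hTD : ThickDense) (hTH : THGerm) (hHull : HullLimit) (hTop : NullEndTopology) (hLeaf : LeafLimit)
    (hR9 : HotLapSign) (hR10 : HotTimePin) (hF1a : NoHotCycle) (hF2 : HotSeparatrix)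
    (hNull : CellNullContinuum) (hPer : CellPersistentEnd) : CellEscapingEnd := by
  intro C v W hP hT hK hFL hcl hcrit hR3 hR4 harc hpin hlap hcyc hsep hleaf
  obtain ⟨γ, hγ0, hω0, hγ', hridge, hcurt, hinj, hend⟩ := hleaf
  have hγc : Continuous γ := continuous_iff_continuousAt.mpr fun τ => (hγ' τ).continuousAt
  have hhot : ∀ τ : ℝ, γ τ ∈ hotSet v := fun τ => (hridge τ).1
  obtain ⟨l, hl, hesc⟩ : ∃ l : Filter ℝ, (l = Filter.atTop ∨ l = Filter.atBot) ∧
      Filter.Tendsto γ l (Filter.cocompact _) := by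
    rcases hend with h | h
    exacts [⟨_, Or.inl rfl, h⟩, ⟨_, Or.inr rfl, h⟩]
  haveI hlc : l.IsCountablyGenerated := by rcases hl with rfl | rfl <;> infer_instance
  haveI hlb : l.NeBot := by rcases hl with rfl | rfl <;> infer_instance
  obtain ⟨-, ⟨Kv, hKv⟩, ⟨Bv, hBv⟩⟩ := slice_regularity hP
  by_cases hnull : Filter.Tendsto (fun τ => Literature.Analysis.FluidPDE.curl (v (-1)) (γ τ)) l (nhds 0)
  · -- the NULL end
    obtain ⟨τs, hτs⟩ := Filter.exists_seq_tendsto l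
    obtain ⟨φ, U, hφ, hPU, hPkU, hconv, hcurlconv⟩ := hHull C v hP hK (fun k => γ (τs k)) fun k => hhot (τs k)
    obtain ⟨W', hTW'⟩ := thickWindow_of_dense hTD hTH hPU
    obtain ⟨hFLU, hclU, hcritU, hR3U, hR4U⟩ := limit_laws hPU hTW' hPkU
    obtain ⟨hUc, ⟨KU, hKU⟩, -⟩ := slice_regularity hPU
    obtain ⟨L, hLH, h0L, hLconn, hLunb, hLnull⟩ := hTop v U γ (τs ∘ φ) l hl hγc hinj hhot hesc hnull
      (hτs.comp hφ.tendsto_atTop) hclU hUc hKU.continuous (hconv (-1) (by norm_num)) hcurlconv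
    exact hNull C U W' hPU hTW' hPkU hFLU hclU hcritU hR3U hR4U (hR10 C U hPU) (hR9 C U hPU) (hF1a C U hPU hPkU hR4U)
      (hF2 C U hPU hFLU) L hLH h0L hLconn hLunb hLnull
  · -- the PERSISTENT end
    have hfreq : ∃ δ : ℝ, 0 < δ ∧ ∃ᶠ τ in l, δ ≤ ‖Literature.Analysis.FluidPDE.curl (v (-1)) (γ τ)‖ := by
      by_contra hcon
      apply hnull
      rw [Metric.tendsto_nhds]
      intro ε hε
      have h' : ¬ ∃ᶠ τ in l, ε ≤ ‖Literature.Analysis.FluidPDE.curl (v (-1)) (γ τ)‖ := fun h => hcon ⟨ε, hε, h⟩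
      rw [Filter.not_frequently] at h'
      exact h'.mono fun τ hτ => by rw [dist_zero_right]; exact not_le.mp hτ
    obtain ⟨δ, hδ, hfr⟩ := hfreq
    obtain ⟨τs, hτs, hbig⟩ := Filter.exists_seq_forall_of_frequently hfr
    obtain ⟨φ, U, hφ, hPU, hPkU, hconv, hcurlconv⟩ := hHull C v hP hK (fun k => γ (τs k)) fun k => hhot (τs k)
    obtain ⟨W', hTW'⟩ := thickWindow_of_dense hTD hTH hPU
    obtain ⟨hFLU, hclU, hcritU, hR3U, hR4U⟩ := limit_laws hPU hTW' hPkU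
    obtain ⟨hUc, ⟨KU, hKU⟩, ⟨BU, hBU⟩⟩ := slice_regularity hPU
    have hδU : δ ≤ ‖Literature.Analysis.FluidPDE.curl (U (-1)) 0‖ := by
      have h0 : Filter.Tendsto (fun j => Literature.Analysis.FluidPDE.curl (v (-1)) ((0 : EuclideanSpace ℝ (Fin 3)) + γ (τs (φ j))))
          Filter.atTop (nhds (Literature.Analysis.FluidPDE.curl (U (-1)) 0)) :=
        (tendstoLocallyUniformlyOn_univ.mpr hcurlconv).tendsto_at (Set.mem_univ _)
      refine ge_of_tendsto (continuous_norm.continuousAt.tendsto.comp h0) (Filter.Eventually.of_forall fun j => ?_)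
      show δ ≤ ‖Literature.Analysis.FluidPDE.curl (v (-1)) ((0 : EuclideanSpace ℝ (Fin 3)) + γ (τs (φ j)))‖
      rw [zero_add]
      exact hbig (φ j)
    obtain ⟨γU, hγU0, hγU', hγUH, hγUlim⟩ := hLeaf v U γ (τs ∘ φ) hγ' hhot ⟨KU, hKU⟩ ⟨Bv, hBv⟩ ⟨BU, hBU⟩ hclU hUc
      (hconv (-1) (by norm_num)) hcurlconv
    exact hPer C v W hP hT hK hFL hcl hcrit hR3 hR4 harc hpin hlap hcyc hsep γ hγ0 hω0 hγ' hridge hcurt hinj l hl hesc δ hδ hfr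
      (τs ∘ φ) U W' (hτs.comp hφ.tendsto_atTop) (fun k => hbig (φ k)) hPU hTW' hPkU (fun t ht => hconv t ht) hcurlconv hδU
      γU hγU0 hγU' hγUH hγUlim

/-- **ESC-END on this line** ⇐ the kernel with H2 (`thickDense_holds`, THGerm by name from S0), H3, H4, H5, R9, R10, F1a, F2 and the two cells. -/
theorem cellEscapingEnd_holds : CellEscapingEnd :=
  cellEscapingEnd_of_hull thickDense_holds thGerm_holds hullLimit_holds stub_nullEndTopology stub_leafLimit stub_hotLapSign stub_hotTimePin
    stub_noHotCycle stub_hotSeparatrix stub_cellNullContinuum stub_cellPersistentEnd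


/-! ## The other residue C2b′ — DERIVED on this line from NULL-CONTINUUM -/

/-- **Residue C2b′ `stub_cellC2bRidge` (VERBATIM statement, hot_split v1.6) — now a TERM**: NULL-CONTINUUM applied to the hot component of `0`
(`connectedComponentIn (hotSet v) 0`: connected, `∋ 0`, `⊆ H`, unbounded by tree `…HotSplitRidgeKernels.hotComponent_unbounded`, null because all of `H` is),
with the hot laws by name (R10, R9, F1a, F2 — closed stubs of this file). -/
theorem stub_cellC2bRidge :
    ∀ (C : ℝ) (v : ℝ → EuclideanSpace ℝ (Fin 3) → EuclideanSpace ℝ (Fin 3)) (W : Set (ℝ × EuclideanSpace ℝ (Fin 3))),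
      Pinned C v → ThickWindow v W → Peakless v →
      (∀ s < 0, ∀ y, ⟪fderiv ℝ (v s) y (Literature.Analysis.FluidPDE.curl (v s) y), EuclideanSpace.single 2 1⟫_ℝ = 0) →
      IsClosed (hotSet v) → (∀ y ∈ hotSet v, fderiv ℝ (fun x => v (-1) x 2) y = 0) →
      (∀ K O : Set (EuclideanSpace ℝ (Fin 3)), IsCompact K → K.Nonempty → K ⊆ hotSet v → IsOpen O → K ⊆ O →
        O ∩ hotSet v ⊆ K → False) →
      (∀ y ∈ hotSet v, ∀ r : ℝ, 0 < r →
        ∃ y' : EuclideanSpace ℝ (Fin 3), y' 2 = 0 ∧ dist y' y < r ∧ v (-1) y' 2 ≠ v (-1) 0 2) →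
      (∀ y ∈ hotSet v, Literature.Analysis.FluidPDE.curl (v (-1)) y = 0) →
      False :=
  fun C v W hP hT hK hFL hcl hcrit hR3 hR4 hnull =>
    have h0 : (0 : EuclideanSpace ℝ (Fin 3)) ∈ hotSet v := ⟨rfl, rfl⟩
    stub_cellNullContinuum C v W hP hT hK hFL hcl hcrit hR3 hR4 (stub_hotTimePin C v hP) (stub_hotLapSign C v hP)
      (stub_noHotCycle C v hP hK hR4) (stub_hotSeparatrix C v hP hFL) (connectedComponentIn (hotSet v) 0) (connectedComponentIn_subset _ _)
      (mem_connectedComponentIn h0) (isConnected_connectedComponentIn_iff.mpr h0)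
      (PoloidalWindowDoorPoloidalWindowRigidityHotSplitRidgeKernels.hotComponent_unbounded C v hP hK 0 h0)
      fun y hy => hnull y (connectedComponentIn_subset _ _ hy)

/-! ## Kernel (VERBATIM LINE 20): C2a′ ⇐ R9 ∧ R10 ∧ R15 ∧ R16 ∧ R18 ∧ R19 ∧ R20 ∧ F1a ∧ F1b ∧ F2 ∧ F3 ∧ ESC-END ∧ CONVERGENT-WEB (sorry-free) -/

/-- **KERNEL `cellC2aRidge_of_forest`** — the statement of hot_split's `stub_cellC2aRidge` (v1.6, VERBATIM) from the two forest cells; every structure stub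
is consumed (V1 through `capturedEndConverges_holds`).  Logic only: extend the arc to a complete leaf (R15/R16), get injectivity and the end dichotomy (R18/R19);
an escaping end is ESC-END; two clustering ends converge (F3) to hot flat vertices (R19/R20), distinct by F1b (the leaf never meets a vorticity zero) —
CONVERGENT-WEB, which is also handed F1a and F2. -/
theorem cellC2aRidge_of_forest (hR9 : HotLapSign) (hR10 : HotTimePin) (hR15 : VortexLineGlobal) (hR16 : LeafGlobalLaw) (hR18 : HotRegularAlone)
    (hR19 : LeafEnds) (hR20 : HotFlatPointHFlat) (hF1a : NoHotCycle) (hF1b : NoHotLoop) (hF2 : HotSeparatrix) (hF3 : CapturedEndConverges)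
    (hEsc : CellEscapingEnd) (hWeb : CellConvergentWeb) :
    ∀ (C : ℝ) (v : ℝ → EuclideanSpace ℝ (Fin 3) → EuclideanSpace ℝ (Fin 3)) (W : Set (ℝ × EuclideanSpace ℝ (Fin 3))),
      Pinned C v → ThickWindow v W → Peakless v →
      (∀ s < 0, ∀ y, ⟪fderiv ℝ (v s) y (Literature.Analysis.FluidPDE.curl (v s) y), EuclideanSpace.single 2 1⟫_ℝ = 0) →
      IsClosed (hotSet v) → (∀ y ∈ hotSet v, fderiv ℝ (fun x => v (-1) x 2) y = 0) →
      (∀ K O : Set (EuclideanSpace ℝ (Fin 3)), IsCompact K → K.Nonempty → K ⊆ hotSet v → IsOpen O → K ⊆ O →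
        O ∩ hotSet v ⊆ K → False) →
      (∀ y ∈ hotSet v, ∀ r : ℝ, 0 < r →
        ∃ y' : EuclideanSpace ℝ (Fin 3), y' 2 = 0 ∧ dist y' y < r ∧ v (-1) y' 2 ≠ v (-1) 0 2) →
      (∃ (γ : ℝ → EuclideanSpace ℝ (Fin 3)) (ε : ℝ), 0 < ε ∧ γ 0 ∈ hotSet v ∧
        Literature.Analysis.FluidPDE.curl (v (-1)) (γ 0) ≠ 0 ∧
        ∀ τ ∈ Set.Ioo (-ε) ε, HasDerivAt γ (Literature.Analysis.FluidPDE.curl (v (-1)) (γ τ)) τ ∧ γ τ ∈ hotSet v) →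
      False := by
  intro C v W hP hT hK hFL hcl hcrit hR3 hR4 harc
  obtain ⟨γ₀, ε, hε, hγ0, hω0, hγ⟩ := harc
  obtain ⟨γ, hγ0', hγ'⟩ := hR15 C v hP (γ₀ 0)
  have hγ0mem : γ 0 ∈ hotSet v := by rw [hγ0']; exact hγ0
  have hω0' : Literature.Analysis.FluidPDE.curl (v (-1)) (γ 0) ≠ 0 := by rw [hγ0']; exact hω0
  obtain ⟨hridge, hcurt⟩ := hR16 C v hP hFL hcrit γ hγ' hγ0mem hω0'
  have hpin : ∀ y ∈ hotSet v, deriv (fun s => v s y 2) (-1) = v (-1) 0 2 / 2 := hR10 C v hP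
  have hlap : ∀ y ∈ hotSet v, v (-1) 0 2 * lapH v y ≤ 0 := hR9 C v hP
  have hcyc := hF1a C v hP hK hR4
  have hsep := hF2 C v hP hFL
  have halone := hR18 C v hP hFL hR4
  obtain ⟨hinj, htop, hbot⟩ := hR19 C v hP hcl hR3 halone γ hγ' hridge
  have hreg : ∀ τ : ℝ, γ τ ∈ hotSet v ∧ Literature.Analysis.FluidPDE.curl (v (-1)) (γ τ) ≠ 0 :=
    fun τ => ⟨(hridge τ).1, (hridge τ).2.1⟩
  have hconv := hF3 C v hP hR4 γ hγ' hreg hinj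
  have hγc : Continuous γ := continuous_iff_continuousAt.mpr fun τ => (hγ' τ).continuousAt
  rcases htop with htop | ⟨qp, hqp, hqpH, hqpω, hqpL⟩
  · exact hEsc C v W hP hT hK hFL hcl hcrit hR3 hR4 ⟨γ₀, ε, hε, hγ0, hω0, hγ⟩ hpin hlap hcyc hsep
      ⟨γ, hγ0mem, hω0', hγ', hridge, hcurt, hinj, Or.inl htop⟩
  · rcases hbot with hbot | ⟨qm, hqm, hqmH, hqmω, hqmL⟩
    · exact hEsc C v W hP hT hK hFL hcl hcrit hR3 hR4 ⟨γ₀, ε, hε, hγ0, hω0, hγ⟩ hpin hlap hcyc hsep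
        ⟨γ, hγ0mem, hω0', hγ', hridge, hcurt, hinj, Or.inr hbot⟩
    · have htp : Filter.Tendsto γ Filter.atTop (nhds qp) := (hconv qp hqpω).1 hqp
      have hbt : Filter.Tendsto γ Filter.atBot (nhds qm) := (hconv qm hqmω).2 hqm
      have hne : qp ≠ qm := by
        intro heq
        have hbt' : Filter.Tendsto γ Filter.atBot (nhds qp) := by rw [heq]; exact hbt
        have havoid : ∀ τ : ℝ, γ τ ≠ qp := fun τ h => (hreg τ).2 (by rw [h]; exact hqpω)
        exact hF1b C v hP hK hR4 γ hγc hinj (fun τ => (hreg τ).1) qp havoid htp hbt'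
      exact hWeb C v W hP hT hK hFL hcl hcrit hR3 hR4 ⟨γ₀, ε, hε, hγ0, hω0, hγ⟩ hpin hlap hcyc hsep
        ⟨γ, qp, qm, hγ0mem, hω0', hγ', hridge, hcurt, hinj, htp, hbt, hqpH, hqmH, hqpω, hqmω,
          hR20 C v hP qp hqpH hqpL, hR20 C v hP qm hqmH hqmL, hne⟩

/-- **Residue C2a′ (hot_split `stub_cellC2aRidge`, VERBATIM statement) on this line** ⇐ R9 ∧ R10 ∧ R15 ∧ R16 ∧ R18 ∧ R19 ∧ R20 ∧ F1a ∧ F1b ∧ F2 ∧ F3 ∧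
ESC-END ∧ CONVERGENT-WEB. -/
theorem stub_cellC2aRidge (hO : Literature.ModelTheory.ExponentialFields.VandendriesMiller1994_realAnExp_isOMinimal) :
    ∀ (C : ℝ) (v : ℝ → EuclideanSpace ℝ (Fin 3) → EuclideanSpace ℝ (Fin 3)) (W : Set (ℝ × EuclideanSpace ℝ (Fin 3))),
      Pinned C v → ThickWindow v W → Peakless v →
      (∀ s < 0, ∀ y, ⟪fderiv ℝ (v s) y (Literature.Analysis.FluidPDE.curl (v s) y), EuclideanSpace.single 2 1⟫_ℝ = 0) →
      IsClosed (hotSet v) → (∀ y ∈ hotSet v, fderiv ℝ (fun x => v (-1) x 2) y = 0) →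
      (∀ K O : Set (EuclideanSpace ℝ (Fin 3)), IsCompact K → K.Nonempty → K ⊆ hotSet v → IsOpen O → K ⊆ O →
        O ∩ hotSet v ⊆ K → False) →
      (∀ y ∈ hotSet v, ∀ r : ℝ, 0 < r →
        ∃ y' : EuclideanSpace ℝ (Fin 3), y' 2 = 0 ∧ dist y' y < r ∧ v (-1) y' 2 ≠ v (-1) 0 2) →
      (∃ (γ : ℝ → EuclideanSpace ℝ (Fin 3)) (ε : ℝ), 0 < ε ∧ γ 0 ∈ hotSet v ∧
        Literature.Analysis.FluidPDE.curl (v (-1)) (γ 0) ≠ 0 ∧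
        ∀ τ ∈ Set.Ioo (-ε) ε, HasDerivAt γ (Literature.Analysis.FluidPDE.curl (v (-1)) (γ τ)) τ ∧ γ τ ∈ hotSet v) →
      False :=
  cellC2aRidge_of_forest stub_hotLapSign stub_hotTimePin stub_vortexLineGlobal stub_leafGlobalLaw stub_hotRegularAlone stub_leafEnds
    stub_hotFlatPointHFlat stub_noHotCycle stub_noHotLoop stub_hotSeparatrix (capturedEndConverges_holds hO) cellEscapingEnd_holds stub_cellConvergentWeb

/-! ## Kernel: HL3′ ⇐ cells, with A1, C1, C2a ⇐ C2a′, C2b ⇐ C2b′ ALL BY NAME from Theorems (K2-p2 g12/g13 landings) -/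

/-- **HL3′ (the statement of `stub_peaklessEmpty`, hot_loops v4.3 / hot_split, VERBATIM) on this line**: hot_split's trichotomy with A1 :=
`…HotPlaneConst.stub_hotPlaneConst`, C1 := `…ZeroModeNoHotPlane.hotSplit_cellC1`, C2a := `…HotSplitRidgeKernels.cellC2a_of_ridge stub_cellC2aRidge`,
C2b := `…HotSplitRidgeKernels.cellC2b_of_ridge stub_cellC2bRidge`, the frozen law from `…FirstIntegral.stub_firstIntegral`.  Kernel-checked. -/
theorem hotHull_peaklessEmpty (hO : Literature.ModelTheory.ExponentialFields.VandendriesMiller1994_realAnExp_isOMinimal) :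
    ∀ (C : ℝ) (v : ℝ → EuclideanSpace ℝ (Fin 3) → EuclideanSpace ℝ (Fin 3)),
      Literature.Analysis.FluidPDE.HasTypeITimeDecay C v →
      ContinuousOn (Function.uncurry v) (Set.Iio (0 : ℝ) ×ˢ Set.univ) →
      (∀ s t : ℝ, s < t → t < 0 → ∀ x, v t x =
        Literature.Analysis.UnboundedOperators.heatExtension (v s) (t - s) x -
          Literature.Analysis.FluidPDE.oseenDuhamel 1 s v v t x) →
      (∀ t < 0, Literature.Analysis.FluidPDE.VectorCalculus.IsDivFree (v t)) →
      (∀ s < 0, ∀ y, ⟪Literature.Analysis.FluidPDE.curl (v s) y, EuclideanSpace.single 2 1⟫_ℝ = 0) →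
      v (-1) 0 2 ≠ 0 → (∀ t < 0, ∀ x, Real.sqrt (-t) * |v t x 2| ≤ |v (-1) 0 2|) →
      (∀ h : EuclideanSpace ℝ (Fin 3), fderiv ℝ (v (-1)) 0 h 2 = 0) →
      (deriv (fun s => v s 0 2) (-1) = v (-1) 0 2 / 2 ∧ v (-1) 0 2 * (Δ (fun y => v (-1) y 2)) 0 ≤ 0) →
      ∀ W : Set (ℝ × EuclideanSpace ℝ (Fin 3)), IsOpen W → W ⊆ Set.Iio (0 : ℝ) ×ˢ Set.univ →
        (∀ z ∈ W, (Literature.Analysis.FluidPDE.curl (v z.1) z.2 ≠ 0 ∧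
            (fderiv ℝ (v z.1) z.2 (EuclideanSpace.single 0 1) 2 ≠ 0 ∨ fderiv ℝ (v z.1) z.2 (EuclideanSpace.single 1 1) 2 ≠ 0) ∧
            (fderiv ℝ (v z.1) z.2 (EuclideanSpace.single 2 1) 0 ≠ 0 ∨ fderiv ℝ (v z.1) z.2 (EuclideanSpace.single 2 1) 1 ≠ 0)) ∧
          (fderiv ℝ (fun x => fderiv ℝ (v z.1) x (EuclideanSpace.single 2 1) 2) z.2 (EuclideanSpace.single 0 1) *
                fderiv ℝ (v z.1) z.2 (EuclideanSpace.single 1 1) 2 -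
              fderiv ℝ (fun x => fderiv ℝ (v z.1) x (EuclideanSpace.single 2 1) 2) z.2 (EuclideanSpace.single 1 1) *
                fderiv ℝ (v z.1) z.2 (EuclideanSpace.single 0 1) 2 ≠ 0)) →
        (∀ m : ℝ → ℝ → ℝ, ∀ W₁ : Set (ℝ × EuclideanSpace ℝ (Fin 3)), W₁ ⊆ W → IsOpen W₁ → W₁.Nonempty →
            ∃ z ∈ W₁, ∃ b : Fin 3, b ≠ 2 ∧
              fderiv ℝ (v z.1) z.2 (EuclideanSpace.single 2 1) b ≠
                m z.1 (z.2 2) * fderiv ℝ (v z.1) z.2 (EuclideanSpace.single b 1) 2) →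
        (∀ r : ℝ, 0 < r → (Metric.ball ((-1 : ℝ), (0 : EuclideanSpace ℝ (Fin 3))) r ∩ W).Nonempty) →
        (∀ (s z₀ σ M : ℝ) (K O : Set (EuclideanSpace ℝ (Fin 3))), s < 0 →
          ((σ = 1 ∨ σ = -1) ∧ IsCompact K ∧ K.Nonempty ∧ (∀ y ∈ K, y 2 = z₀ ∧ σ * v s y 2 = M) ∧
            IsOpen O ∧ K ⊆ O ∧ (∀ y ∈ O, y 2 = z₀ → σ * v s y 2 ≤ M) ∧
            (∀ y ∈ O, y 2 = z₀ → σ * v s y 2 = M → y ∈ K)) → False) →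
        False :=
  -- v1.1 (critic A1): HL3′ ⇐ C2a′ ∧ C2b′ BY NAME through the tree's `…HotSplitCells.peaklessEmpty_of_ridges` (K2-p2 g13, p690711);
  -- `Pinned`/`ThickWindow`/`Peakless`/`hotSet` unfold definitionally to the Theorems file's verbatim binders.
  PoloidalWindowDoorPoloidalWindowRigidityHotSplitCells.peaklessEmpty_of_ridges (stub_cellC2aRidge hO) stub_cellC2bRidge

/-! ## Compositions to the crux items BY NAME -/

/-- **The crux `PoloidalWindowRigidity` (K2, stmt-NavierStokesRegularity-19708) BY NAME ⇐ S0 ∧ ⟨27893⟩ ∧ (R9,R10,R15,R16,R18–R20,F1–F3, ESC-END, CONVERGENT-WEB) ∧ C2b′**: tree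
`…HotSplitComposition.poloidalWindowRigidity_of_residues` (v1.1; v1 went through `…HotLoopsReduction…` + this file's HL3′).  CONDITIONAL; no summit is proved. -/
theorem PoloidalWindowRigidity_of_hotHull (hO : Literature.ModelTheory.ExponentialFields.VandendriesMiller1994_realAnExp_isOMinimal) :
    Summit.NavierStokesRegularity.NavierStokesRegularity.Theses.PoloidalWindowDoor.PoloidalWindowRigidity :=
  -- v1.1 (critic A1): `hotHull_peaklessEmpty` is HL3′ BY NAME through `…HotSplitCells.peaklessEmpty_of_ridges`; this term is definitionally the tree's
  -- `…HotSplitComposition.poloidalWindowRigidity_of_residues stub_localTHEmptyHypNUGRS stub_wall stub_cellC2aRidge stub_cellC2bRidge` (see the `example`s below).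
  PoloidalWindowDoorPoloidalWindowRigidityHotLoopsReduction.poloidalWindowRigidity_of_NUGRS_of_growth_of_peakless
    stub_localTHEmptyHypNUGRS stub_wall (hotHull_peaklessEmpty hO)

/-- **The item `LrcModEntire` (stmt-NavierStokesRegularity-20428) BY NAME ⇐ S0 ∧ ⟨27893⟩ ∧ (R9,R10,R15,R16,R18–R20,F1–F3, ESC-END, CONVERGENT-WEB) ∧ C2b′.** CONDITIONAL. -/
theorem LrcModEntire_of_hotHull (hO : Literature.ModelTheory.ExponentialFields.VandendriesMiller1994_realAnExp_isOMinimal) :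
    Summit.NavierStokesRegularity.NavierStokesRegularity.Theses.PoloidalWindowDoor.LrcModEntire :=
  PoloidalWindowDoorPoloidalWindowRigidityHotLoopsReduction.lrcModEntire_of_NUGRS_of_growth_of_peakless
    stub_localTHEmptyHypNUGRS stub_wall (hotHull_peaklessEmpty hO)

/-- v1.1 (critic A1): the same two compositions through the tree's `…HotSplitComposition…_of_residues` BY NAME (S0, wall, C2a′, C2b′ — the residue of
this line being the DERIVED one); `example`s, so the census reads them and the audit counts no duplicate items. -/
example (hO : Literature.ModelTheory.ExponentialFields.VandendriesMiller1994_realAnExp_isOMinimal) :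
    Summit.NavierStokesRegularity.NavierStokesRegularity.Theses.PoloidalWindowDoor.PoloidalWindowRigidity :=
  PoloidalWindowDoorPoloidalWindowRigidityHotSplitComposition.poloidalWindowRigidity_of_residues
    stub_localTHEmptyHypNUGRS stub_wall (stub_cellC2aRidge hO) stub_cellC2bRidge

example (hO : Literature.ModelTheory.ExponentialFields.VandendriesMiller1994_realAnExp_isOMinimal) :
    Summit.NavierStokesRegularity.NavierStokesRegularity.Theses.PoloidalWindowDoor.LrcModEntire :=
  PoloidalWindowDoorPoloidalWindowRigidityHotSplitComposition.lrcModEntire_of_residues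
    stub_localTHEmptyHypNUGRS stub_wall (stub_cellC2aRidge hO) stub_cellC2bRidge

end Summit.NavierStokesRegularity.NavierStokesRegularity.Cruxes.PoloidalWindowRigidity.HotHull
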